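import Literature.AlgebraicGeometry.Resolution.WeightedCentreFirstStage
import Literature.AlgebraicGeometry.Resolution.WeightedCentreGradedAutomorphism
import Mathlib.Algebra.MvPolynomial.Expand
import Mathlib.Algebra.MvPolynomial.PDeriv
import Mathlib.LinearAlgebra.Dimension.OrzechProperty
import Mathlib.LinearAlgebra.Basis.VectorSpace
import HarnessLib

/-!
# Hironaka's vertex theorem in the weighted-centre model: `δ`-prepared ⇒ `b_{τ+1} ≤ ν·δ`

[CJS20] Cossart–Jannsen–Saito, *Desingularization: Invariants and Strategy*, LNM 2270 (2020):
Def. 7.1–7.2 (pp. 107–108: admissible / strictly admissible `(y, u)`, `n_(u)(f)`, `in_0(f) = F(Y)`),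
Def. 8.1–8.2 (pp. 117–118: F-subsets, faces `E_L` and vertices, `δ(Δ)`, the polyhedron `Δ(g, y, u)`
generated by the points `A/(n_(u)(g) − |B|)`, `in_v(g)`, `in_{E_L}(g)`), Def. 8.5 (4) (p. 119:
`V(f, y, u)`), Def. 8.13 (pp. 120–121: "(f, y, u) is called solvable at v … if there are λ_1, …, λ_r ∈ k[U]
such that in_v(f_i) = F_i(Y + λ) with F_i(Y) = in_0(f_i)"), Def. 8.15 (p. 121: prepared at `v` /
along a face / `δ`-prepared), **Thm. 8.16** (p. 121; = [H3] Hironaka, *Characteristic polyhedra of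
singularities*, J. Math. Kyoto Univ. 7 (1967), Thm. (4.8)): "Let v be a vertex of Δ(f, y, u) such that
(f, y, u) is prepared at v. Then v is a vertex of Δ(J, u)", Thm. 8.22 (a) (p. 124): "Any solution for
(f, y, u) at v is of the form λ with λ_i = c_i U^v … In particular, if it exists, a solution is always
non-trivial and v ∈ ℤ^e", App. (B. Schober) Def. 18.34 and the remark after it (p. 208): "δ(J, u) is an
invariant of the singularity Spec(R/J) …, see [CJSc, Corollary B(3)]"; [ATW24]
Abramovich–Temkin–Włodarczyk, Algebra & Number Theory 18 (2024), Lemma 5.2.10, Thm. 5.3.1 (pp. 1577–1578: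
the invariant `(a₁, …, a_k)` and the maximal admissible centre), §3.4 (p. 1570); [AQS25]
Abramovich–Quek–Schober, Thm. 3.5 (the invariant is the lex-maximum over admissible centres).

POLYNOMIAL MODEL, as in the sibling files `WeightedCentreInvariantSet` (`IsCentreFor f Ψ γ`:
`Ψ` an origin-fixing `k`-algebra automorphism of `k[x₁, …, x_n]`, `Ψ⁻¹ f` admissible for the weights
`γ`), `WeightedCentreDelta` (`hironakaDelta S ν f = δ(f; u; y)` for `(y, u) = (X_S, X_{Sᶜ})`,
`blockWeights S ν c` = the cocharacter of `(y^ν, u^{νc})`), `WeightedCentreFirstStage`,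
`WeightedCentreDirectrix`.  Throughout `ν = ord f` (`monomialOrd 1 f = ν`), `in_ν f ∈ k[X_S]` and
`|S| = τ(in_ν f)`, so that `(u) = X_{Sᶜ}` is admissible, `(y, u)` strictly admissible and `n_(u)(f) = ν`
[CJS20 Def. 7.1, Cor. 8.17]; the ideal is the hypersurface `J = (f)` (`m = 1`).

DEFINED here (hypersurface case, integral points `v`): `zeroInitial` = `in_0(f)` and `pointInitial` =
`in_v(f)` [Def. 8.2], `IsSolvableAt` [Def. 8.13 in the form forced by Thm. 8.22 (a):
`in_v(f) = in_0(f)(Y + c U^v)`, `c ∈ k^r`], `IsVertex` [Def. 8.1 (2): `E_L = {v}` for a positive form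
`L`, tested on the generating points of Def. 8.2 (1)], `IsDeltaPrepared` [Def. 8.15 (3); for `m = 1`
normalizedness (Def. 8.11–8.12) is vacuous and by Thm. 8.22 (a) only integral vertices can be solvable].

PROVED here — statements and proofs OURS, in the model; what is modelled is [CJS20 Thm. 8.16 =
H3 Thm. (4.8)] (vertices at which `(f, y, u)` is prepared persist under changes of `(y, f)`) combined
with the invariance of `δ(J, u)` under the choice of `(u)` [CJS20 p. 208 / CJSc Cor. B(3)]:
* `not_isCentreFor_blockWeights_of_isDeltaPrepared` — if `(f; X_S; X_{Sᶜ})` is `δ`-prepared,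
  `δ = δ(f; u; y)`, then for NO origin-fixing automorphism `Ψ` (it may change `u` as well as `y`) and
  no `c > δ` is `(Ψ; y^ν, u^{νc})` a centre for `f`;
* `succ_card_le_card_of_isCentreFor_of_isDeltaPrepared`, `succ_card_le_countP_exps_of_isDeltaPrepared`
  — hence every centre `(Ψ; γ)` for `f` with `γ ≤ 1/ν` has at least `τ + 1` weights `≥ 1/(νδ)`: the
  sorted exponent list `exps γ` has its `(τ+1)`-th entry `≤ ν·δ(f; u; y)`.  With
  `firstStage_mem_admissibleInvariants` (`WeightedCentreFirstStage`: `(ν^τ, (νδ)^{n−τ}) ∈ W(f)`) the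
  `(τ+1)`-th exponent of the lex-maximal element of `W(f)` is exactly `ν·δ(f; u; y)` for `δ`-prepared
  data;
* the two cases `caseA_false` (the new `y'`-block has all pure-`u` monomials of degree `> δ`: Lemma R,
  `le_monomialOrd_symm_iff`) and `caseB_false` (a pure-`u` monomial of degree `m₀ ≤ δ`: three graded
  computations with Lemma G, `weightedHomogeneousComponent_map_of_le_monomialOrd`, the block inverse
  `sum_jacobianBlock_symm_mul_jacobianBlock`, and Lemma W `mem_invarianceSpace_of_aeval_eq`), and the
  reduction of an arbitrary centre to block shape `exists_isCentreFor_blockWeights_of_card_le`.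
No convex geometry is used: the exposing linear form of the vertex produced in case (b) is arithmetic
(weights `L^j`, `eq_of_weight_pow_eq`).
REV. 2 (same model, same hypotheses) adds:
* `hironakaDelta_symm_le_of_isDeltaPrepared`, `hironakaDelta_symm_eq_of_isDeltaPrepared` — the
  prepared `δ` cannot be raised by any origin-fixing `Ψ` and is the same for any two `δ`-prepared
  presentations [CJS20 p. 208 / CJSc Cor. B(3), in the model]; `caseB_false` is now stated for every
  `c > max(1, m₀)` (it was `c > δ`);
* §9, the `δ`-face read through a competitor: `deltaInitial` = `in_δ(f)` [Def. 8.2 (4)],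
  `uHomogeneousPart` (the pure-`u` degree-`δ` part `Φ_i` of a coordinate, the candidate solution `λ_i(U)`
  of Def. 8.13), `competitorSpan` = `T(Ψ, γ) = ⟨X_S, ℓ_j : γ_j = 1/(νδ)⟩ ⊆ gr¹` [Thm. 8.16 (∗)];
  `deltaInitial_eq_aeval_of_isCentreFor` (`in_δ(f) = (in_w Ψ⁻¹f)(in_w z)`, `in_w Ψ⁻¹f ∈ k[X_S, X_M]`),
  `deltaInitial_mem_linearFormsSubalgebra_of_isCentreFor` and the COUNT
  `hironakaTau_deltaInitial_le_of_isCentreFor`: for every centre `(Ψ; γ)` with `γ = 1/ν` on `S`,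
  `γ ≤ 1/(νδ)` off `S` whose twists `Φ_i` lie in `k[T(Ψ, γ)]`,  `τ(in_δ f) ≤ |S| + #{j ∉ S : γ_j = 1/(νδ)}`;
  unconditionally in `Ψ` when `δ ∉ ℕ` (`hironakaTau_deltaInitial_le_of_forall_natCast_ne`) or when the
  `y'`-block is untwisted (`…_of_forall_degree_ne`), and for `τ = 1`, `ν ∈ kˣ`, `f` Tschirnhaus-normalised
  along the `δ`-face (`uHomogeneousPart_mem_linearFormsSubalgebra_of_tau_eq_one`,
  `hironakaTau_deltaInitial_le_of_tau_eq_one`: the twist `Φ` is itself a polynomial in the `ℓ_j`).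
REV. 4 (same model) adds §10, the twisted count for GENERAL `τ`:
`uHomogeneousPart_mem_linearFormsSubalgebra_of_linearIndependent` and
`hironakaTau_deltaInitial_le_of_linearIndependent` — if the `δ`-face of `f` carries no monomial of
`y`-degree `ν − 1` (N0) and the partials `∂_l in_ν f` (`l ∈ S`) are linearly independent (IND; automatic
for `τ = 1`, `ν ∈ kˣ`: `linearIndependent_pderiv_of_tau_eq_one`), then every twist `Φ_i` lies in
`k[T(Ψ, γ)]` and `τ(in_δ f) ≤ |S| + #{j ∉ S : γ_j = 1/(νδ)}` for EVERY centre of the class; proof by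
grading the identity `in_δ f = (in_w Ψ⁻¹f)(in_w z)` by `X_S`-degree (top slice `in_ν f = H_ν(Lin)`,
next slice = first-order Taylor term), the chain rule, and coefficient extraction along `k[X_S]` with
dual functionals. (N0)/(IND) are necessary in residue characteristic `p ∣ ν`: over `𝔽₂`,
`f = (y + u₁²)(y + u₂²)` has `τ(in_δ f) = 3` but admits centres with a single `u`-weight `1/(νδ)`.
NOT claimed: Thm. 8.16 for general ideals / standard bases (`m > 1`, normalizedness), persistence of
vertices off the `δ`-face, formal (power-series) coordinate changes — automorphisms of the polynomial
ring only —, the twisted count without the hypotheses (N0)/(IND), and nothing about later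
stages of the invariant beyond the entries forced by `δ` and `τ(in_δ f)`.
-/

noncomputable section

open MvPolynomial
open Finsupp (weight)

namespace Literature.AlgebraicGeometry.Resolution

namespace WeightedBlowup

variable {k : Type*} [Field k] {n : ℕ}

/-! ## §1 The `v`-initial form, solvability, vertices, preparedness -/

section Defs

variable (S : Finset (Fin n)) (ν : ℕ)

/-- The `u`-part `A` of an exponent `d = (B, A)` of `y^B u^A` (`B` on the block `S` of
`y`-variables, `A` off `S`), as an exponent vanishing on `S`.
[cite: CossartJannsenSaito2020, Def. 8.2 (1) (pp. 117–118) (the exponents `(A, B)` of `g = Σ C_{A,B} y^B u^A`)] -/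
def coPart (d : Fin n →₀ ℕ) : Fin n →₀ ℕ := d.filter fun i => i ∉ S

/-- The `0`-initial form `in_0(f) = Σ_{|B| = ν, A = 0} c_{0,B} Y^B` of `f` with respect to
`(y, u) = (X_S, X_{Sᶜ})` and `ν = n_(u)(f)` (polynomial model: the sum of the terms of `f` of
`y`-degree `ν` and `u`-degree `0`).
[cite: CossartJannsenSaito2020, Def. 7.2 (3) (p. 108) (`in_0(f) = F(Y)`), Def. 8.11 (`G_i = F_i(Y) + Σ_{|B|<n_i} Y^B P_{i,B}(U)`) (p. 120)] -/
def zeroInitial (f : MvPolynomial (Fin n) k) : MvPolynomial (Fin n) k :=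
  ∑ d ∈ f.support with (blockDeg S d = ν ∧ coPart S d = 0), monomial d (coeff d f)

/-- The `v`-initial form of `f` at an INTEGRAL point `v ∈ ℤ^e_{≥0}`:
`in_v(f) = in_0(f) + Σ_{|B| < ν, A = (ν − |B|)·v} c_{A,B} Y^B U^A` (polynomial model; the
condition `|B| ≤ ν ∧ A = (ν − |B|)•v` covers both summands).
[cite: CossartJannsenSaito2020, Def. 8.2 (2)–(4) (p. 118) (`in_v(g)`, `in_{E_L}(g) = in_0(g) + Σ … Y^B U^A`, the sum
over `|B| < n_(u)(g)`, `L(A) = δ_L (n_(u)(g) − |B|)`)] -/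
def pointInitial (v : Fin n →₀ ℕ) (f : MvPolynomial (Fin n) k) : MvPolynomial (Fin n) k :=
  ∑ d ∈ f.support with (blockDeg S d ≤ ν ∧ coPart S d = (ν - blockDeg S d) • v),
    monomial d (coeff d f)

/-- `(f; y; u) = (f; X_S; X_{Sᶜ})` is SOLVABLE at the integral point `v`: there are constants
`c_i ∈ k` with `in_v(f) = in_0(f)(Y_i ↦ Y_i + c_i U^v)` (hypersurface case `m = 1`; by
Thm. 8.22 (a) every solution `λ_i ∈ k[U]` of Def. 8.13 has this form, and only integral `v` can be
solvable). [cite: CossartJannsenSaito2020, Def. 8.13 (pp. 120–121) ("in_v(f_i) = F_i(Y + λ) with F_i(Y) = in_0(f_i)"),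
Thm. 8.22 (a) (p. 124) ("Any solution … is of the form λ with λ_i = c_i U^v … and v ∈ ℤ^e")] -/
def IsSolvableAt (f : MvPolynomial (Fin n) k) (v : Fin n →₀ ℕ) : Prop :=
  ∃ c : Fin n → k, pointInitial S ν v f =
    aeval (fun i => if i ∈ S then X i + C (c i) * monomial v 1 else X i) (zeroInitial S ν f)

/-- `v` is a VERTEX of the polyhedron `Δ(f; u; y)` (polynomial model, integral `v`): `v` is one of
the generating points `A/(ν − |B|)` (`c_{A,B} ≠ 0`, `|B| < ν`) and there is a positive linear form
`L` (positive integer coefficients) whose face `E_L` is `{v}`, i.e. `L(A) ≥ (ν − |B|) L(v)` on all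
generating points with equality only at `A = (ν − |B|) v`.
[cite: CossartJannsenSaito2020, Def. 8.1 (2) (p. 117) ("E_L = Δ ∩ {L = δ_L(Δ)} … If E_L consists of a unique point v,
we call v a vertex of Δ"), Def. 8.2 (1), (3) (pp. 117–118) (`Δ(g,y,u)` = the smallest F-subset
containing the points `A/(n_(u)(g) − |B|)`; `δ_L(g,y,u) = min L(A)/(n_(u)(g) − |B|)`),
Def. 8.5 (4) (p. 119) (`V(f,y,u)`)] -/
def IsVertex (f : MvPolynomial (Fin n) k) (v : Fin n →₀ ℕ) : Prop :=
  (∃ d ∈ f.support, blockDeg S d < ν ∧ coPart S d = (ν - blockDeg S d) • v) ∧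
    ∃ L : Fin n → ℕ, (∀ i, 0 < L i) ∧ ∀ d ∈ f.support, blockDeg S d < ν →
      (ν - blockDeg S d) * weight L v ≤ weight L (coPart S d) ∧
        ((ν - blockDeg S d) * weight L v = weight L (coPart S d) →
          coPart S d = (ν - blockDeg S d) • v)

/-- `(f; y; u) = (f; X_S; X_{Sᶜ})` is `δ`-PREPARED: it is not solvable at any vertex of the
`δ`-face `{|v| = δ(f;u;y)}` of `Δ(f; u; y)` (hypersurface case: for `m = 1` the normalizedness half
of "prepared" (Def. 8.11–8.12) is vacuous, and by Thm. 8.22 (a) non-integral vertices are never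
solvable, so only integral vertices `v` are constrained).
[cite: CossartJannsenSaito2020, Def. 8.15 (2)–(3) (p. 121) ("prepared along a face E_L … not solvable at any
v ∈ V(f,y,u) ∩ E_L"; "δ-prepared if it is prepared along the δ-face"), Def. 8.1 (3) (p. 117)
(the `δ`-face `E_{L_0}`)] -/
def IsDeltaPrepared (f : MvPolynomial (Fin n) k) : Prop :=
  ∀ v : Fin n →₀ ℕ, IsVertex S ν f v → ((v.degree : ℚ) : WithTop ℚ) = hironakaDelta S ν f →
    ¬ IsSolvableAt S ν f v

end Defs

/-! ## §2 Elementary lemmas on exponents -/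

section Exponents

variable (S : Finset (Fin n))

/-- `coPart S d i = if i ∈ S then 0 else d i`. [folklore] -/
private theorem coPart_apply (d : Fin n →₀ ℕ) (i : Fin n) :
    coPart S d i = if i ∉ S then d i else 0 := by
  simp [coPart, Finsupp.filter_apply]

/-- `coPart S d` vanishes on `S`. [folklore] -/
private theorem coPart_apply_of_mem {d : Fin n →₀ ℕ} {i : Fin n} (hi : i ∈ S) : coPart S d i = 0 := by
  simp [coPart_apply, hi]

/-- `coPart S d` agrees with `d` off `S`. [folklore] -/
private theorem coPart_apply_of_not_mem {d : Fin n →₀ ℕ} {i : Fin n} (hi : i ∉ S) :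
    coPart S d i = d i := by
  simp [coPart_apply, hi]

/-- `|A| = deg (coPart S d)` is the `u`-degree `coDeg S d`.
[cite: CossartJannsenSaito2020, Def. 8.1 (3) (p. 117) (`|A| = a₁ + ⋯ + a_e`)] -/
theorem degree_coPart (d : Fin n →₀ ℕ) : (coPart S d).degree = coDeg S d := by
  classical
  rw [Finsupp.degree_apply, coDeg, coPart, Finsupp.support_filter]
  refine Finset.sum_congr rfl fun i hi => ?_
  rw [Finset.mem_filter] at hi
  rw [Finsupp.filter_apply, if_pos hi.2]

/-- `|B| = Σ_{i ∈ S} d i`. [folklore] -/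
private theorem blockDeg_eq_sum_univ (d : Fin n →₀ ℕ) :
    blockDeg S d = ∑ i ∈ S, d i := by
  classical
  rw [blockDeg]
  refine (Finset.sum_subset (fun i hi => (Finset.mem_filter.mp hi).2) fun i hiS hi => ?_).trans rfl
  · simpa [Finset.mem_filter, hiS] using hi

/-- `|A| = Σ_{i ∉ S} d i`. [folklore] -/
private theorem coDeg_eq_sum_univ (d : Fin n →₀ ℕ) :
    coDeg S d = ∑ i ∈ Finset.univ.filter (· ∉ S), d i := by
  classical
  rw [coDeg]
  refine Finset.sum_subset (fun i hi => by simpa using (Finset.mem_filter.mp hi).2)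
    fun i hiS hi => ?_
  rw [Finset.mem_filter] at hiS
  simpa [Finset.mem_filter, hiS.2] using hi

end Exponents

/-! ## §3 Monotonicity and relabelling of centres -/

section Plumbing

/-- `v_γ(d) = Σ_i d_i γ_i` as a sum over all indices. [folklore] -/
private theorem monomialValuation_eq_sum_univ (γ : Fin n → ℚ) (d : Fin n →₀ ℕ) :
    monomialValuation γ d = ∑ i, (d i : ℚ) * γ i := by
  rw [monomialValuation, Finsupp.sum_fintype]
  intro i; simp

/-- `v_γ(d)` is monotone in the weights `γ`. [folklore] -/
private theorem monomialValuation_mono {γ γ' : Fin n → ℚ} (h : ∀ i, γ i ≤ γ' i) (d : Fin n →₀ ℕ) :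
    monomialValuation γ d ≤ monomialValuation γ' d := by
  rw [monomialValuation_eq_sum_univ, monomialValuation_eq_sum_univ]
  exact Finset.sum_le_sum fun i _ => mul_le_mul_of_nonneg_left (h i) (Nat.cast_nonneg _)

/-- Raising the weights (= lowering the exponents `1/γ_i`) preserves admissibility.
[cite: AbramovichTemkinWlodarczyk2024, Def. 2.4.1 and Rem. 2.4.2 (p. 1568) (`J`-admissibility is monotone in `J`)] -/
theorem IsAdmissibleFor.mono {γ γ' : Fin n → ℚ} (h : ∀ i, γ i ≤ γ' i) {F : MvPolynomial (Fin n) k}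
    (hF : IsAdmissibleFor γ F) : IsAdmissibleFor γ' F :=
  fun d hd => (hF d hd).trans (monomialValuation_mono h d)

/-- Raising the weights preserves being a centre for `f`.
[cite: AbramovichTemkinWlodarczyk2024, Def. 2.4.1 and Rem. 2.4.2 (p. 1568)] -/
theorem IsCentreFor.mono {f : MvPolynomial (Fin n) k}
    {Ψ : MvPolynomial (Fin n) k ≃ₐ[k] MvPolynomial (Fin n) k} {γ γ' : Fin n → ℚ}
    (h : IsCentreFor f Ψ γ) (hle : ∀ i, γ i ≤ γ' i) : IsCentreFor f Ψ γ' :=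
  ⟨h.1, fun i => (h.2.1 i).trans (hle i), h.2.2.mono hle⟩

/-- `v_{γ ∘ π}(d ∘ π) = v_γ(d)` for a permutation `π` of the variables. [folklore] -/
private theorem monomialValuation_comp_perm (γ : Fin n → ℚ) (π : Equiv.Perm (Fin n)) (d : Fin n →₀ ℕ) :
    monomialValuation (γ ∘ π) (Finsupp.mapDomain π.symm d) = monomialValuation γ d := by
  rw [monomialValuation_eq_sum_univ, monomialValuation_eq_sum_univ]
  simp only [Finsupp.mapDomain_equiv_apply, Equiv.symm_symm, Function.comp_apply]
  exact Equiv.sum_comp π (fun i => (d i : ℚ) * γ i)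

/-- **Relabelling the variables of a centre**: `(Ψ ∘ π; γ ∘ π)` is a centre for `f` when
`(Ψ; γ)` is, for any permutation `π` of the variables (the exponent multiset is unchanged).
[cite: AbramovichTemkinWlodarczyk2024, §2.4 (p. 1568) (centres `(x₁^{a₁}, …, x_k^{a_k})` up to reordering)] -/
theorem IsCentreFor.perm {f : MvPolynomial (Fin n) k}
    {Ψ : MvPolynomial (Fin n) k ≃ₐ[k] MvPolynomial (Fin n) k} {γ : Fin n → ℚ}
    (h : IsCentreFor f Ψ γ) (π : Equiv.Perm (Fin n)) :
    IsCentreFor f ((renameEquiv k π).trans Ψ) (γ ∘ π) := by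
  classical
  obtain ⟨hΨ, hγ, hadm⟩ := h
  refine ⟨fun i => ?_, fun i => hγ (π i), ?_⟩
  · change constantCoeff (Ψ (renameEquiv k π (X i))) = 0
    change constantCoeff (Ψ (rename π (X i))) = 0
    rw [rename_X]; exact hΨ (π i)
  · intro d hd
    change d ∈ ((renameEquiv k π).symm (Ψ.symm f)).support at hd
    rw [renameEquiv_symm] at hd
    change d ∈ (rename π.symm (Ψ.symm f)).support at hd
    rw [support_rename_of_injective π.symm.injective, Finset.mem_image] at hd
    obtain ⟨e, he, rfl⟩ := hd
    rw [monomialValuation_comp_perm]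
    exact hadm e he

/-- Two subsets of `Fin n` of the same size are exchanged by a permutation. [folklore] -/
private theorem exists_perm_mem_iff {S A : Finset (Fin n)} (h : A.card = S.card) :
    ∃ π : Equiv.Perm (Fin n), ∀ i, π i ∈ A ↔ i ∈ S := by
  classical
  have h1 : Fintype.card {x // x ∈ S} = Fintype.card {x // x ∈ A} := by simp [h]
  have h2 : Fintype.card {x // ¬ x ∈ S} = Fintype.card {x // ¬ x ∈ A} := by
    rw [Fintype.card_subtype_compl, Fintype.card_subtype_compl, h1]
  refine ⟨Equiv.subtypeCongr (Fintype.equivOfCardEq h1) (Fintype.equivOfCardEq h2), fun i => ?_⟩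
  by_cases hi : i ∈ S
  · simp only [Equiv.subtypeCongr, Equiv.trans_apply, Equiv.sumCompl_symm_apply_of_pos hi,
      Equiv.sumCongr_apply, Sum.map_inl, Equiv.sumCompl_apply_inl]
    exact ⟨fun _ => hi, fun _ => (Fintype.equivOfCardEq h1 ⟨i, hi⟩).2⟩
  · simp only [Equiv.subtypeCongr, Equiv.trans_apply, Equiv.sumCompl_symm_apply_of_neg hi,
      Equiv.sumCongr_apply, Sum.map_inr, Equiv.sumCompl_apply_inr]
    exact ⟨fun h' => absurd h' (Fintype.equivOfCardEq h2 ⟨i, hi⟩).2, fun h' => absurd h' hi⟩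

/-- Block weights transported along a permutation exchanging the blocks. [folklore] -/
private theorem blockWeights_comp_perm {S A : Finset (Fin n)} {π : Equiv.Perm (Fin n)}
    (hπ : ∀ i, π i ∈ A ↔ i ∈ S) (ν : ℕ) (c : ℚ) :
    blockWeights A ν c ∘ π = blockWeights S ν c := by
  funext i
  by_cases hi : i ∈ S
  · simp [blockWeights, hi, (hπ i).mpr hi]
  · simp [blockWeights, hi, mt (hπ i).mp hi]

/-- **Reduction to block shape.** Let `ν = ord f`, `|S| = τ(in_ν f)` and let `(Ψ; γ)` be a centre
for `f` with `γ ≤ 1/ν` having AT MOST `|S|` weights `≥ 1/(νδ)` (`δ ≥ 1`). Then, after relabelling,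
`f` admits a centre of block shape `(Ψ'; y^ν, u^{νc})` on the block `S` with some `c > δ`: the `τ`
weights equal to `1/ν` (`hironakaTau_le_card_inv_nu`) are moved onto `S`, and all other weights are
`< 1/(νδ)`, hence `≤ 1/(νc)` for the largest of them. (Proof ours, in the model.)
[cite: AbramovichTemkinWlodarczyk2024, Thm. 5.3.1 (2)–(3) and Lemma 5.2.10 (pp. 1577–1578) (the first `ℓ` entries of the
invariant and the parameters `x₁, …, x_ℓ` of the maximal centre)] -/
theorem exists_isCentreFor_blockWeights_of_card_le {f : MvPolynomial (Fin n) k} {ν : ℕ}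
    (hord : monomialOrd (fun _ => 1) f = ν) {S : Finset (Fin n)}
    (hτ : S.card = hironakaTau k {homogeneousComponent ν f})
    {Ψ : MvPolynomial (Fin n) k ≃ₐ[k] MvPolynomial (Fin n) k} {γ : Fin n → ℚ}
    (h : IsCentreFor f Ψ γ) (hle : ∀ i, γ i ≤ (ν : ℚ)⁻¹) {δ : ℚ} (hδ : 1 ≤ δ)
    (hcard : (Finset.univ.filter fun i => ((ν : ℚ) * δ)⁻¹ ≤ γ i).card ≤ S.card) :
    ∃ (Ψ' : MvPolynomial (Fin n) k ≃ₐ[k] MvPolynomial (Fin n) k) (c : ℚ), δ < c ∧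
      IsCentreFor f Ψ' (blockWeights S ν c) := by
  classical
  set A := Finset.univ.filter fun i => γ i = (ν : ℚ)⁻¹ with hA_def
  have hτA : hironakaTau k {homogeneousComponent ν f} ≤ A.card :=
    hironakaTau_le_card_inv_nu hord h hle
  have hν : (0 : ℚ) < ν := by
    -- if ν = 0 then every weight is ≤ 0⁻¹ = 0, so γ = 0 and v_γ ≡ 0: but `Ψ.symm f ≠ 0`
    rcases Nat.eq_zero_or_pos ν with h0 | h0
    · exfalso
      subst h0
      have hγ0 : ∀ i, γ i = 0 := fun i => le_antisymm (by simpa using hle i) (h.2.1 i)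
      have hf : Ψ.symm f ≠ 0 := by
        intro hf
        have : f = 0 := by simpa using congrArg Ψ hf
        simp [this, monomialOrd] at hord
      obtain ⟨d, hd⟩ := Finset.nonempty_of_ne_empty (mt MvPolynomial.support_eq_empty.mp hf)
      have := h.2.2 d hd
      rw [monomialValuation_eq_sum_univ] at this
      simp [hγ0] at this
      exact absurd this (by norm_num)
    · exact_mod_cast h0
  have hsub : A ⊆ Finset.univ.filter fun i => ((ν : ℚ) * δ)⁻¹ ≤ γ i := by
    intro i hi
    rw [Finset.mem_filter] at hi ⊢
    refine ⟨Finset.mem_univ _, ?_⟩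
    rw [hi.2, mul_inv]
    exact mul_le_of_le_one_right (inv_nonneg.mpr hν.le) (inv_le_one_of_one_le₀ hδ)
  have hAeq : A = Finset.univ.filter fun i => ((ν : ℚ) * δ)⁻¹ ≤ γ i :=
    Finset.eq_of_subset_of_card_le hsub (hcard.trans (hτ ▸ hτA))
  have hAS : A.card = S.card := le_antisymm (hAeq ▸ hcard) (hτ ▸ hτA)
  -- off `A` the weights are `< 1/(νδ)`
  have hlt : ∀ i, i ∉ A → γ i < ((ν : ℚ) * δ)⁻¹ := by
    intro i hi
    by_contra hge
    exact hi (hAeq ▸ Finset.mem_filter.mpr ⟨Finset.mem_univ _, not_lt.mp hge⟩)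
  -- the exponent `c`
  set T := Finset.univ.filter fun i => i ∉ A ∧ 0 < γ i with hT_def
  have hδpos : 0 < δ := one_pos.trans_le hδ
  obtain ⟨c, hcδ, hcT⟩ : ∃ c : ℚ, δ < c ∧ ∀ i ∈ T, c ≤ ((ν : ℚ) * γ i)⁻¹ := by
    by_cases hT : T.Nonempty
    · refine ⟨T.inf' hT fun i => ((ν : ℚ) * γ i)⁻¹, ?_, fun i hi => Finset.inf'_le _ hi⟩
      rw [Finset.lt_inf'_iff]
      intro i hi
      rw [hT_def, Finset.mem_filter] at hi
      have hγi := hlt i hi.2.1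
      rw [lt_inv_comm₀ hδpos (mul_pos hν hi.2.2)]
      calc (ν : ℚ) * γ i < ν * ((ν : ℚ) * δ)⁻¹ := mul_lt_mul_of_pos_left hγi hν
        _ = δ⁻¹ := by rw [mul_inv, ← mul_assoc, mul_inv_cancel₀ hν.ne', one_mul]
    · exact ⟨δ + 1, lt_add_one δ, fun i hi => (hT ⟨i, hi⟩).elim⟩
  have hcpos : 0 < c := hδpos.trans hcδ
  -- domination `γ ≤ blockWeights A ν c`
  have hdom : ∀ i, γ i ≤ blockWeights A ν c i := by
    intro i
    by_cases hi : i ∈ A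
    · have : γ i = (ν : ℚ)⁻¹ := (Finset.mem_filter.mp hi).2
      simp [blockWeights, hi, this]
    · simp only [blockWeights, hi, if_false]
      rcases (h.2.1 i).eq_or_lt with h0 | hpos
      · rw [← h0]; positivity
      · have hiT : i ∈ T := Finset.mem_filter.mpr ⟨Finset.mem_univ _, hi, hpos⟩
        have := hcT i hiT
        rw [le_inv_comm₀ hcpos (mul_pos hν hpos)] at this
        calc γ i = ((ν : ℚ) * γ i) * (ν : ℚ)⁻¹ := by field_simp
          _ ≤ c⁻¹ * (ν : ℚ)⁻¹ := mul_le_mul_of_nonneg_right this (inv_nonneg.mpr hν.le)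
          _ = ((ν : ℚ) * c)⁻¹ := by rw [mul_inv, mul_comm]
  obtain ⟨π, hπ⟩ := exists_perm_mem_iff hAS
  refine ⟨(renameEquiv k π).trans Ψ, c, hcδ, ?_⟩
  rw [← blockWeights_comp_perm hπ ν c]
  exact (h.mono hdom).perm π

end Plumbing

/-! ## §4 Consequences of `ord f = ν`, `in_ν f ∈ k[X_S]`, `|S| = τ` -/

section Structure

variable {f : MvPolynomial (Fin n) k} {ν : ℕ} {S : Finset (Fin n)}

/-- The weight of `d` for the block weights `(p on S, q off S)` is `p|B| + q|A|`. [folklore] -/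
private theorem weight_block (S : Finset (Fin n)) (p q : ℕ) (d : Fin n →₀ ℕ) :
    weight (fun i => if i ∈ S then p else q) d = p * blockDeg S d + q * coDeg S d := by
  classical
  rw [Finsupp.weight_apply, Finsupp.sum, blockDeg, coDeg, Finset.mul_sum, Finset.mul_sum,
    ← Finset.sum_filter_add_sum_filter_not d.support (· ∈ S)]
  congr 1
  · refine Finset.sum_congr rfl fun i hi => ?_
    rw [Finset.mem_filter] at hi
    simp [hi.2, mul_comm]
  · refine Finset.sum_congr rfl fun i hi => ?_
    rw [Finset.mem_filter] at hi
    simp [hi.2, mul_comm]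

/-- `deg d = |B| + |A|`. [cite: CossartJannsenSaito2020, Def. 7.2 (1) (p. 107)] -/
theorem degree_eq_blockDeg_add_coDeg (S : Finset (Fin n)) (d : Fin n →₀ ℕ) :
    d.degree = blockDeg S d + coDeg S d := (blockDeg_add_coDeg S d).symm

/-- Every monomial of `f` has degree `≥ ord f`. [folklore] -/
private theorem le_degree_of_monomialOrd (hord : monomialOrd (fun _ => 1) f = ν) {d : Fin n →₀ ℕ}
    (hd : d ∈ f.support) : ν ≤ d.degree :=
  (le_monomialOrd_one_iff f ν).mp hord.symm.le d hd

/-- Under `in_ν f ∈ k[X_S]`, a monomial of `f` of degree `ν` is a pure `y`-monomial.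
[cite: CossartJannsenSaito2020, Def. 7.1 (p. 107) (`(u)` admissible: `In(J) ∩ k[Y]` generates), Lemma 8.4 / (18.8)
(p. 208) (`δ ≥ 1 ⟺ n_(u)(g) = ord(g)`)] -/
theorem coPart_eq_zero_of_degree_eq (hFS : ∀ d ∈ (homogeneousComponent ν f).support, ∀ j ∉ S, d j = 0)
    {d : Fin n →₀ ℕ} (hd : d ∈ f.support) (hdeg : d.degree = ν) : coPart S d = 0 := by
  classical
  have hdF : d ∈ (homogeneousComponent ν f).support := by
    rw [mem_support_iff, coeff_homogeneousComponent, if_pos hdeg]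
    exact mem_support_iff.mp hd
  ext j
  by_cases hj : j ∈ S
  · simp [coPart_apply, hj]
  · simp [coPart_apply, hj, hFS d hdF j hj]

/-- `|A| = 0 ⟺ A = 0`. [folklore] -/
private theorem coDeg_eq_zero_iff_coPart_eq_zero (S : Finset (Fin n)) (d : Fin n →₀ ℕ) :
    coDeg S d = 0 ↔ coPart S d = 0 := by
  rw [← degree_coPart, Finsupp.degree_eq_zero_iff]

/-- Under `ord f = ν` and `in_ν f ∈ k[X_S]`, every generating point of `Δ(f;u;y)` has
`|A| > ν − |B|`, i.e. `Δ(f;u;y) ⊂ {|v| > 1}`.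
[cite: CossartJannsenSaito2020, Cor. 8.17 (2)⟺(3) and Thm. 8.7 (pp. 119–121) (`δ(f,y,u) > 1` ⟺ `(y,u)` strictly
admissible and `f` admissible for `(y,u)`)] -/
theorem one_lt_ratio (hord : monomialOrd (fun _ => 1) f = ν)
    (hFS : ∀ d ∈ (homogeneousComponent ν f).support, ∀ j ∉ S, d j = 0)
    {d : Fin n →₀ ℕ} (hd : d ∈ f.support) (hb : blockDeg S d < ν) :
    ν - blockDeg S d < coDeg S d := by
  have h1 := le_degree_of_monomialOrd hord hd
  rw [degree_eq_blockDeg_add_coDeg S] at h1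
  rcases (show ν - blockDeg S d ≤ coDeg S d by omega).eq_or_lt with h2 | h2
  · exfalso
    have hdeg : d.degree = ν := by rw [degree_eq_blockDeg_add_coDeg S]; omega
    have := coPart_eq_zero_of_degree_eq hFS hd hdeg
    rw [← coDeg_eq_zero_iff_coPart_eq_zero] at this
    omega
  · exact h2

/-- `δ(f; u; y) > 1` under `ord f = ν`, `in_ν f ∈ k[X_S]` (and `δ < ∞`).
[cite: CossartJannsenSaito2020, Cor. 8.17 (p. 121) ((3) ⇒ (2): "`δ(f, y, u) > 1`")] -/
theorem one_lt_hironakaDelta (hord : monomialOrd (fun _ => 1) f = ν)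
    (hFS : ∀ d ∈ (homogeneousComponent ν f).support, ∀ j ∉ S, d j = 0)
    {δ : ℚ} (hδ : hironakaDelta S ν f = δ) : 1 < δ := by
  classical
  by_cases hex : ∃ d ∈ f.support, blockDeg S d < ν
  · obtain ⟨d, hd, hb, heq⟩ := exists_hironakaDelta_eq S ν f hex
    rw [hδ, WithTop.coe_eq_coe] at heq
    rw [heq, lt_div_iff₀ (by exact_mod_cast Nat.sub_pos_of_lt hb), one_mul]
    exact_mod_cast one_lt_ratio hord hFS hd hb
  · push Not at hex
    have : hironakaDelta S ν f = ⊤ := (hironakaDelta_eq_top_iff S ν f).mpr hex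
    rw [hδ] at this
    exact absurd this WithTop.coe_ne_top

/-- `δ·(ν − |B|) ≤ |A|` for every monomial `y^B u^A` of `f` with `|B| < ν` (`δ = δ(f;u;y)`).
[cite: CossartJannsenSaito2020, Def. 8.1 (3), Def. 8.2 (3) (pp. 117–118) (`δ = min |A|/(n_(u) − |B|)`)] -/
theorem delta_mul_le_coDeg {δ : ℚ} (hδ : hironakaDelta S ν f = δ) {d : Fin n →₀ ℕ}
    (hd : d ∈ f.support) (hb : blockDeg S d < ν) :
    δ * ((ν - blockDeg S d : ℕ) : ℚ) ≤ coDeg S d := by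
  have := ((le_hironakaDelta_iff S ν f δ).mp hδ.symm.le) d hd hb
  rwa [le_div_iff₀ (by exact_mod_cast Nat.sub_pos_of_lt hb)] at this

/-- `in_0(f) = in_ν(f)` when `in_ν f ∈ k[X_S]` (polynomial model of `F(Y) = in_0(f)`,
`F = in_𝔪(f)` for admissible `(y,u)`).
[cite: CossartJannsenSaito2020, Def. 7.2 (3) (p. 108), Lemma 8.4 (`δ ≥ 1 ⟺ n_(u)(g) = ord(g)`; quoted p. 208 (18.8))] -/
theorem zeroInitial_eq_homogeneousComponent
    (hFS : ∀ d ∈ (homogeneousComponent ν f).support, ∀ j ∉ S, d j = 0) :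
    zeroInitial S ν f = homogeneousComponent ν f := by
  classical
  rw [zeroInitial, homogeneousComponent_apply]
  refine Finset.sum_congr ?_ fun _ _ => rfl
  ext d
  simp only [Finset.mem_filter, and_congr_right_iff]
  intro hd
  constructor
  · rintro ⟨hb, hc⟩
    rw [degree_eq_blockDeg_add_coDeg S, hb, (coDeg_eq_zero_iff_coPart_eq_zero S d).mpr hc,
      add_zero]
  · intro hdeg
    have hc := coPart_eq_zero_of_degree_eq hFS hd hdeg
    refine ⟨?_, hc⟩
    have := degree_eq_blockDeg_add_coDeg S d
    rw [hdeg, (coDeg_eq_zero_iff_coPart_eq_zero S d).mpr hc, add_zero] at this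
    exact this.symm

/-- With `|S| = τ(in_ν f)` and `in_ν f ∈ k[X_S]`, the directrix of `in_ν f` is EXACTLY the span
of the `X_i`, `i ∈ S` (as linear forms): `(y) = X_S` is a minimal set of variables for `in_ν f`.
(From `WeightedCentreFirstStage.directrix_eq_span_of_isCentreFor_blockWeights` with `Ψ = id`.)
[cite: CossartJannsenSaito2020, Def. 7.1 (p. 107) (strictly admissible: `In_𝔪(J)` generated in `k[Y]`, `Y` spanning
the directrix, `r = τ`)] -/
theorem directrix_eq_comap_span_X (hord : monomialOrd (fun _ => 1) f = ν) (hν : 0 < ν)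
    (hτ : S.card = hironakaTau k {homogeneousComponent ν f})
    (hFS : ∀ d ∈ (homogeneousComponent ν f).support, ∀ j ∉ S, d j = 0)
    {δ : ℚ} (hδ : hironakaDelta S ν f = δ) :
    directrix k {homogeneousComponent ν f} =
      (Submodule.span k ((fun i => (X i : MvPolynomial (Fin n) k)) '' (S : Set (Fin n)))).comap
        (linearFormPolyₗ k) := by
  classical
  have hδ1 := one_lt_hironakaDelta hord hFS hδ
  have h : IsCentreFor f AlgEquiv.refl (blockWeights S ν δ) := by
    rw [isCentreFor_blockWeights_iff f _ S hν (one_pos.trans hδ1)]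
    exact ⟨fun i => by simp, by simp [hδ]⟩
  have := directrix_eq_span_of_isCentreFor_blockWeights hord hν hδ1 h hτ.le
  rw [this]
  congr 2
  refine Set.image_congr' fun i => ?_
  change homogeneousComponent 1 (X i) = X i
  rw [homogeneousComponent_of_mem (isHomogeneous_X k i), if_pos rfl]

/-- A polynomial in the span of the `X_i`, `i ∈ S`, has no `X_j`-coefficient for `j ∉ S`. [folklore] -/
private theorem coeff_single_eq_zero_of_mem_span {P : MvPolynomial (Fin n) k}
    (hP : P ∈ Submodule.span k ((fun i => (X i : MvPolynomial (Fin n) k)) '' (S : Set (Fin n))))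
    {j : Fin n} (hj : j ∉ S) : coeff (Finsupp.single j 1) P = 0 := by
  classical
  induction hP using Submodule.span_induction with
  | mem x hx =>
    obtain ⟨i, hi, rfl⟩ := hx
    rw [coeff_X]
    rw [if_neg]
    intro h
    have := Finsupp.single_left_injective one_ne_zero h
    exact hj (this ▸ hi)
  | zero => simp
  | add x y _ _ hx hy => rw [coeff_add, hx, hy, add_zero]
  | smul a x _ hx => rw [coeff_smul, hx, smul_zero]

/-- **The `y'`-block is tangent to `(y)`.** If `(Ψ; y^ν, u^{νc})` with `c > 1` is a centre for
`f` on the block `S` (`|S| = τ`, `in_ν f ∈ k[X_S]`), then the linear part of each `y'_i = Ψ(X_i)`,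
`i ∈ S`, lies in `span(X_S)`: it has no `X_j`-term for `j ∉ S`.
(From `directrix_eq_span_of_isCentreFor_blockWeights`; proof ours, in the model.)
[cite: AbramovichTemkinWlodarczyk2024, proof of Thm. 5.3.1 (2)–(3) (p. 1578) ("x₁ ∈ (x'₁, …, x'_ℓ) + m_p²");
CossartJannsenSaito2020, Def. 7.1 (p. 107)] -/
theorem coeff_single_eq_zero_of_isCentreFor (hord : monomialOrd (fun _ => 1) f = ν) (hν : 0 < ν)
    (hτ : S.card = hironakaTau k {homogeneousComponent ν f})
    (hFS : ∀ d ∈ (homogeneousComponent ν f).support, ∀ j ∉ S, d j = 0)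
    {δ : ℚ} (hδ : hironakaDelta S ν f = δ) {c : ℚ} (hc : 1 < c)
    {Ψ : MvPolynomial (Fin n) k ≃ₐ[k] MvPolynomial (Fin n) k}
    (h : IsCentreFor f Ψ (blockWeights S ν c)) {i : Fin n} (hi : i ∈ S) {j : Fin n} (hj : j ∉ S) :
    coeff (Finsupp.single j 1) (Ψ (X i)) = 0 := by
  classical
  have h1 := directrix_eq_span_of_isCentreFor_blockWeights hord hν hc h hτ.le
  rw [directrix_eq_comap_span_X hord hν hτ hFS hδ] at h1
  have h2 := congrArg (Submodule.map (linearFormPolyₗ k)) h1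
  rw [map_comap_linearFormPolyₗ k, map_comap_linearFormPolyₗ k] at h2
  · have hmem : homogeneousComponent 1 (Ψ (X i)) ∈
        Submodule.span k ((fun i => homogeneousComponent 1 (Ψ (X i))) '' (S : Set (Fin n))) :=
      Submodule.subset_span ⟨i, hi, rfl⟩
    rw [← h2] at hmem
    have := coeff_single_eq_zero_of_mem_span hmem hj
    rwa [coeff_homogeneousComponent, if_pos (by simp [Finsupp.degree_single])] at this
  · exact Submodule.span_le.mpr (by rintro _ ⟨l, _, rfl⟩; exact homogeneousComponent_mem 1 _)
  · exact Submodule.span_le.mpr (by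
      rintro _ ⟨l, _, rfl⟩; exact (mem_homogeneousSubmodule 1 _).mpr (isHomogeneous_X k l))

/-- With `|S| = τ(in_ν f)`, `in_ν f ∈ k[X_S]`: every vector of the invariance space `𝕎(in_ν f)`
vanishes on `S` (dual form of `directrix_eq_comap_span_X`).
[cite: Hironaka1967, §1 (the directrix as the smallest space of variables); CossartJannsenSaito2020, Def. 1.26–1.29 and
Def. 7.1 (pp. 19–20, 107)] -/
theorem apply_eq_zero_of_mem_invarianceSpace (hord : monomialOrd (fun _ => 1) f = ν) (hν : 0 < ν)
    (hτ : S.card = hironakaTau k {homogeneousComponent ν f})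
    (hFS : ∀ d ∈ (homogeneousComponent ν f).support, ∀ j ∉ S, d j = 0)
    {δ : ℚ} (hδ : hironakaDelta S ν f = δ) {w : Fin n → k}
    (hw : w ∈ invarianceSpace k {homogeneousComponent ν f}) {i : Fin n} (hi : i ∈ S) : w i = 0 := by
  classical
  have hproj : (LinearMap.proj i : Module.Dual k (Fin n → k)) ∈
      directrix k {homogeneousComponent ν f} := by
    rw [directrix_eq_comap_span_X hord hν hτ hFS hδ, Submodule.mem_comap, linearFormPolyₗ_apply,
      linearFormPoly_proj]
    exact Submodule.subset_span ⟨i, hi, rfl⟩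
  have := (mem_directrix_iff k).mp hproj w hw
  simpa using this

end Structure

/-! ## §5 Case (a): the `y'`-block has no pure-`u` terms of degree `≤ δ` -/

section CaseA

variable {f : MvPolynomial (Fin n) k} {ν : ℕ} {S : Finset (Fin n)}

/-- **Domination of the block weights.** For the weights `(p on S, q off S)`, `q ≤ p`, an
origin-fixing `Ψ` dominates them (`w_i ≤ ord_w Ψ(X_i)`) as soon as every pure-`u` monomial `u^A` of a
`y'`-variable `Ψ(X_i)`, `i ∈ S`, has `q·|A| ≥ p`. (Ours, in the model; the hypothesis of Lemma G.)
[cite: AbramovichTemkinWlodarczyk2024, §3.4 (p. 1570) and proof of Thm. 5.3.1 (p. 1578) (graded coordinate changes)] -/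
theorem blockWeights_le_monomialOrd {p q : ℕ} (hqp : q ≤ p)
    {Ψ : MvPolynomial (Fin n) k ≃ₐ[k] MvPolynomial (Fin n) k} (hΨ : ∀ i, constantCoeff (Ψ (X i)) = 0)
    (hpure : ∀ i ∈ S, ∀ d ∈ (Ψ (X i)).support, blockDeg S d = 0 → p ≤ q * d.degree) (i : Fin n) :
    ((fun i => if i ∈ S then p else q) i : ℕ∞) ≤
      monomialOrd (fun i => if i ∈ S then p else q) (Ψ (X i)) := by
  classical
  rw [le_monomialOrd_iff]
  intro d hd
  rw [weight_block]
  have hd0 : d ≠ 0 := by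
    rintro rfl
    have := hΨ i
    rw [constantCoeff_eq] at this
    exact (mem_support_iff.mp hd) this
  have hdeg : 1 ≤ d.degree := by
    rw [Nat.one_le_iff_ne_zero, ne_eq, Finsupp.degree_eq_zero_iff]; exact hd0
  rw [degree_eq_blockDeg_add_coDeg S] at hdeg
  by_cases hi : i ∈ S
  · simp only [hi, if_true]
    rcases Nat.eq_zero_or_pos (blockDeg S d) with hb | hb
    · have := hpure i hi d hd hb
      rw [degree_eq_blockDeg_add_coDeg S, hb, zero_add] at this
      rw [hb]; simpa using this
    · nlinarith
  · simp only [hi, if_false]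
    nlinarith

/-- **Case (a) of the vertex theorem: all pure-`u` monomials of the `y'`-block have degree `> δ`.**
Then `Ψ` dominates the block weights `(c' on S, 1 off S)` for a rational `c'` with `δ < c' ≤ c`, and
Lemma R (`le_monomialOrd_symm_iff`: admissibility is invariant under dominated coordinate changes)
transports the admissibility of `Ψ⁻¹ f` for `(y^ν, u^{νc'})` back to `f` itself — contradicting
`c' > δ(f;u;y)` (`isAdmissibleFor_blockWeights_iff_le_delta`). No preparedness is needed here.
(Ours, in the model.) [cite: CossartJannsenSaito2020, Thm. 8.16 (p. 121); Hironaka1967, Thm. (4.8)] -/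
theorem caseA_false (hν : 0 < ν) {δ : ℚ} (hδ : hironakaDelta S ν f = δ) (hδ1 : 1 ≤ δ)
    {c : ℚ} (hc : δ < c) {Ψ : MvPolynomial (Fin n) k ≃ₐ[k] MvPolynomial (Fin n) k}
    (h : IsCentreFor f Ψ (blockWeights S ν c))
    (hpure : ∀ i ∈ S, ∀ d ∈ (Ψ (X i)).support, blockDeg S d = 0 → δ < d.degree) : False := by
  classical
  obtain ⟨hΨ, -, hadm⟩ := h
  -- the finite set of degrees of pure-`u` monomials in the `y'`-block
  set E : Finset ℕ := (S.biUnion fun i => (Ψ (X i)).support.filter fun d => blockDeg S d = 0).image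
    Finsupp.degree with hE
  have hEgt : ∀ m ∈ E, δ < m := by
    intro m hm
    rw [hE, Finset.mem_image] at hm
    obtain ⟨d, hd, rfl⟩ := hm
    rw [Finset.mem_biUnion] at hd
    obtain ⟨i, hi, hd⟩ := hd
    rw [Finset.mem_filter] at hd
    exact hpure i hi d hd.1 hd.2
  -- choose `c'`
  obtain ⟨c', hδc', hc'c, hc'E⟩ : ∃ c' : ℚ, δ < c' ∧ c' ≤ c ∧ ∀ m ∈ E, c' ≤ m := by
    by_cases hne : E.Nonempty
    · refine ⟨min c (E.min' hne : ℕ), lt_min hc (by exact_mod_cast hEgt _ (E.min'_mem hne)),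
        min_le_left _ _, fun m hm => (min_le_right _ _).trans (by exact_mod_cast E.min'_le m hm)⟩
    · exact ⟨c, hc, le_rfl, fun m hm => (hne ⟨m, hm⟩).elim⟩
  have hc'pos : 0 < c' := (one_pos.trans_le hδ1).trans hδc'
  have hc'1 : 1 ≤ c' := hδ1.trans hδc'.le
  -- `c' = p / q`
  obtain ⟨p, hp⟩ := Int.eq_ofNat_of_zero_le (Rat.num_nonneg.mpr hc'pos.le)
  set q : ℕ := c'.den with hq
  have hqpos : 0 < q := c'.den_pos
  have hc'pq : c' = (p : ℚ) / q := by
    rw [← Rat.num_div_den c', hp]; simp [hq]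
  have hqp : q ≤ p := by
    have : (q : ℚ) ≤ p := by
      rw [hc'pq, le_div_iff₀ (by exact_mod_cast hqpos), one_mul] at hc'1; exact hc'1
    exact_mod_cast this
  have hppos : 0 < p := hqpos.trans_le hqp
  -- weights
  set w : Fin n → ℕ := fun i => if i ∈ S then p else q with hw
  have hN : 0 < ν * p := Nat.mul_pos hν hppos
  have hwγ : ∀ i, (w i : ℚ) = ((ν * p : ℕ) : ℚ) * blockWeights S ν c' i := by
    intro i
    have hνq : (ν : ℚ) ≠ 0 := by exact_mod_cast hν.ne'
    by_cases hi : i ∈ S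
    · simp only [hw, blockWeights, hi, if_true, Nat.cast_mul]
      field_simp
    · simp only [hw, blockWeights, hi, if_false, Nat.cast_mul, hc'pq]
      have : (p : ℚ) ≠ 0 := by exact_mod_cast hppos.ne'
      have : (q : ℚ) ≠ 0 := by exact_mod_cast hqpos.ne'
      field_simp
  have hdom : ∀ i, (w i : ℕ∞) ≤ monomialOrd w (Ψ (X i)) := by
    refine blockWeights_le_monomialOrd hqp hΨ fun i hi d hd hb => ?_
    have h1 : c' ≤ (d.degree : ℚ) := hc'E _ (by
      rw [hE, Finset.mem_image]
      exact ⟨d, Finset.mem_biUnion.mpr ⟨i, hi, Finset.mem_filter.mpr ⟨hd, hb⟩⟩, rfl⟩)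
    have : (p : ℚ) ≤ q * d.degree := by
      rw [hc'pq, div_le_iff₀ (by exact_mod_cast hqpos)] at h1
      linarith
    exact_mod_cast this
  -- admissibility transported to `f`
  have hadm' : IsAdmissibleFor (blockWeights S ν c') (Ψ.symm f) := by
    refine hadm.mono fun i => ?_
    by_cases hi : i ∈ S
    · simp [blockWeights, hi]
    · simp only [blockWeights, hi, if_false]
      have hνq : (0 : ℚ) < ν := by exact_mod_cast hν
      exact inv_anti₀ (mul_pos hνq hc'pos) (mul_le_mul_of_nonneg_left hc'c hνq.le)
  have h1 : ((ν * p : ℕ) : ℕ∞) ≤ monomialOrd w (Ψ.symm f) :=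
    (isAdmissibleFor_iff_le_monomialOrd _ w hN hwγ _).mp hadm'
  rw [le_monomialOrd_symm_iff w Ψ hdom] at h1
  have h2 : IsAdmissibleFor (blockWeights S ν c') f :=
    (isAdmissibleFor_iff_le_monomialOrd _ w hN hwγ _).mpr h1
  rw [isAdmissibleFor_blockWeights_iff_le_delta S hν hc'pos, hδ, WithTop.coe_le_coe] at h2
  exact absurd h2 (not_le.mpr hδc')

end CaseA

/-! ## §6 Helpers for case (b) -/

section Helpers

variable (S : Finset (Fin n))

/-- Coefficients of a support-restricted sum of the monomials of `g`. [folklore] -/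
private theorem coeff_sum_filter_monomial (P : (Fin n →₀ ℕ) → Prop) [DecidablePred P]
    (g : MvPolynomial (Fin n) k) (d : Fin n →₀ ℕ) :
    coeff d (∑ e ∈ g.support with P e, monomial e (coeff e g)) = if P d then coeff d g else 0 := by
  classical
  rw [coeff_sum]
  simp_rw [coeff_monomial]
  by_cases hP : P d
  · rw [if_pos hP]
    by_cases hd : d ∈ g.support
    · rw [Finset.sum_eq_single_of_mem d (Finset.mem_filter.mpr ⟨hd, hP⟩)
        (fun e _ hne => if_neg hne), if_pos rfl]
    · rw [notMem_support_iff.mp hd]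
      exact Finset.sum_eq_zero fun e he => by
        rw [ite_eq_right_iff]
        rintro rfl
        exact absurd (Finset.mem_filter.mp he).1 hd
  · rw [if_neg hP]
    exact Finset.sum_eq_zero fun e he => by
      rw [ite_eq_right_iff]
      rintro rfl
      exact absurd (Finset.mem_filter.mp he).2 hP

/-- The support of a support-restricted sum of the monomials of `g`. [folklore] -/
private theorem mem_support_sum_filter_monomial (P : (Fin n →₀ ℕ) → Prop) [DecidablePred P]
    (g : MvPolynomial (Fin n) k) (d : Fin n →₀ ℕ) :
    d ∈ (∑ e ∈ g.support with P e, monomial e (coeff e g)).support ↔ d ∈ g.support ∧ P d := by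
  rw [mem_support_iff, coeff_sum_filter_monomial, mem_support_iff]
  by_cases hP : P d <;> simp [hP]

/-- `|B| = 0 ⟺ d` vanishes on `S`. [folklore] -/
private theorem blockDeg_eq_zero_iff (d : Fin n →₀ ℕ) : blockDeg S d = 0 ↔ ∀ i ∈ S, d i = 0 := by
  rw [blockDeg_eq_sum_univ, Finset.sum_eq_zero_iff]

/-- A pure-`u` exponent is its own `u`-part. [folklore] -/
private theorem coPart_eq_self_of_blockDeg_eq_zero {d : Fin n →₀ ℕ} (h : blockDeg S d = 0) :
    coPart S d = d := by
  rw [blockDeg_eq_zero_iff] at h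
  ext i
  by_cases hi : i ∈ S
  · rw [coPart_apply_of_mem S hi, h i hi]
  · rw [coPart_apply_of_not_mem S hi]

/-- The `u`-part is supported off `S`. [folklore] -/
private theorem coPart_support_subset (d : Fin n →₀ ℕ) : ∀ i ∈ (coPart S d).support, i ∉ S := by
  intro i hi hiS
  rw [Finsupp.mem_support_iff, coPart_apply_of_mem S hiS] at hi
  exact hi rfl

/-- The `u`-part has `y`-degree `0`. [folklore] -/
private theorem blockDeg_coPart (d : Fin n →₀ ℕ) : blockDeg S (coPart S d) = 0 := by
  rw [blockDeg_eq_zero_iff]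
  exact fun i hi => coPart_apply_of_mem S hi

/-- `|j•B| = j|B|`. [folklore] -/
private theorem blockDeg_nsmul (j : ℕ) (d : Fin n →₀ ℕ) : blockDeg S (j • d) = j * blockDeg S d := by
  simp [blockDeg_eq_sum_univ, Finset.mul_sum]

/-- The weight of `d` for `(M on S, λ off S)` is `M|B| + λ(A)`. [folklore] -/
private theorem weight_block_fun (M : ℕ) (lam : Fin n → ℕ) (d : Fin n →₀ ℕ) :
    weight (fun i => if i ∈ S then M else lam i) d = M * blockDeg S d + weight lam (coPart S d) := by
  classical
  simp only [Finsupp.weight_apply, smul_eq_mul, blockDeg_eq_sum_univ, Finset.mul_sum]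
  rw [Finsupp.sum_fintype _ _ (fun _ => by simp), Finsupp.sum_fintype _ _ (fun _ => by simp)]
  have h1 : ∀ i, d i * (if i ∈ S then M else lam i) =
      (if i ∈ S then M * d i else 0) + coPart S d i * lam i := by
    intro i
    by_cases hi : i ∈ S
    · simp [hi, coPart_apply_of_mem S hi, mul_comm]
    · simp [hi, coPart_apply_of_not_mem S hi]
  rw [Finset.sum_congr rfl fun i _ => h1 i, Finset.sum_add_distrib, ← Finset.sum_filter]
  simp

/-- For a pure-`u` exponent the block weight `(M on S, λ off S)` is `λ(d)`. [folklore] -/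
private theorem weight_eq_of_blockDeg_eq_zero (M : ℕ) (lam : Fin n → ℕ) {d : Fin n →₀ ℕ}
    (h : blockDeg S d = 0) : weight (fun i => if i ∈ S then M else lam i) d = weight lam d := by
  rw [weight_block_fun, h, mul_zero, zero_add, coPart_eq_self_of_blockDeg_eq_zero S h]

/-- Base-`L` digit expansions with digit sum `< L` are unique. [folklore] -/
private theorem digits_injective : ∀ (m L : ℕ) (A A' : Fin m → ℕ), (∑ j, A j) < L → (∑ j, A' j) < L →
    ∑ j, A j * L ^ (j : ℕ) = ∑ j, A' j * L ^ (j : ℕ) → A = A' := by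
  intro m
  induction m with
  | zero => intro L A A' _ _ _; funext j; exact j.elim0
  | succ m ih =>
    intro L A A' hA hA' h
    have hL : 0 < L := by omega
    rw [Fin.sum_univ_castSucc] at hA hA'
    rw [Fin.sum_univ_castSucc, Fin.sum_univ_castSucc] at h
    simp only [Fin.val_castSucc, Fin.val_last] at h
    -- the lower parts are `< L^m`
    have low : ∀ B : Fin (m + 1) → ℕ, (∑ j : Fin m, B j.castSucc) + B (Fin.last m) < L →
        ∑ j : Fin m, B j.castSucc * L ^ (j : ℕ) < L ^ m := by
      intro B hB
      have : L * ∑ j : Fin m, B j.castSucc * L ^ (j : ℕ) < L * L ^ m := by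
        calc L * ∑ j : Fin m, B j.castSucc * L ^ (j : ℕ)
            = ∑ j : Fin m, B j.castSucc * L ^ ((j : ℕ) + 1) := by
              rw [Finset.mul_sum]; exact Finset.sum_congr rfl fun j _ => by ring
          _ ≤ ∑ j : Fin m, B j.castSucc * L ^ m :=
              Finset.sum_le_sum fun j _ => Nat.mul_le_mul_left _
                (Nat.pow_le_pow_right hL (by have := j.2; omega))
          _ = (∑ j : Fin m, B j.castSucc) * L ^ m := by rw [Finset.sum_mul]
          _ < L * L ^ m := Nat.mul_lt_mul_of_pos_right (by omega) (Nat.pow_pos hL)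
      exact Nat.lt_of_mul_lt_mul_left this
    have hs := low A hA
    have hs' := low A' hA'
    have hpow : 0 < L ^ m := Nat.pow_pos hL
    -- compare quotients and remainders mod `L^m`
    have hq : A (Fin.last m) = A' (Fin.last m) := by
      have h1 : (∑ j : Fin m, A j.castSucc * L ^ (j : ℕ) + A (Fin.last m) * L ^ m) / L ^ m =
          (∑ j : Fin m, A' j.castSucc * L ^ (j : ℕ) + A' (Fin.last m) * L ^ m) / L ^ m := by
        rw [h]
      rwa [Nat.add_mul_div_right _ _ hpow, Nat.add_mul_div_right _ _ hpow,
        Nat.div_eq_of_lt hs, Nat.div_eq_of_lt hs', zero_add, zero_add] at h1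
    have hr : ∑ j : Fin m, A j.castSucc * L ^ (j : ℕ) = ∑ j : Fin m, A' j.castSucc * L ^ (j : ℕ) := by
      have h1 : (∑ j : Fin m, A j.castSucc * L ^ (j : ℕ) + A (Fin.last m) * L ^ m) % L ^ m =
          (∑ j : Fin m, A' j.castSucc * L ^ (j : ℕ) + A' (Fin.last m) * L ^ m) % L ^ m := by
        rw [h]
      rwa [Nat.add_mul_mod_self_right, Nat.add_mul_mod_self_right, Nat.mod_eq_of_lt hs,
        Nat.mod_eq_of_lt hs'] at h1
    have hlow := ih L (fun j => A j.castSucc) (fun j => A' j.castSucc) (by omega) (by omega) hr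
    funext j
    refine Fin.lastCases hq (fun i => ?_) j
    exact congrFun hlow i

/-- **The exposing weights `λ_j = L^j` separate exponents of degree `< L`**: `λ(A) = λ(A')`
forces `A = A'` (base-`L` digits). This replaces the choice of a generic linear form. [folklore] -/
private theorem eq_of_weight_pow_eq {L : ℕ} {A A' : Fin n →₀ ℕ} (hA : A.degree < L) (hA' : A'.degree < L)
    (h : weight (fun j : Fin n => L ^ (j : ℕ)) A = weight (fun j : Fin n => L ^ (j : ℕ)) A') :
    A = A' := by
  classical
  rw [Finsupp.degree_eq_sum] at hA hA'
  rw [Finsupp.weight_apply, Finsupp.weight_apply, Finsupp.sum_fintype _ _ (fun _ => by simp),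
    Finsupp.sum_fintype _ _ (fun _ => by simp)] at h
  simp only [smul_eq_mul] at h
  have := digits_injective n L A A' hA hA' h
  exact Finsupp.ext fun i => congrFun this i

/-- Evaluations agreeing on the variables `X_S` agree on `k[X_S]`. [folklore] -/
private theorem aeval_congr_of_vars {A : Type*} [CommRing A] [Algebra k A] {F : MvPolynomial (Fin n) k}
    (hF : ∀ d ∈ F.support, ∀ j ∉ S, d j = 0) {g₁ g₂ : Fin n → A} (h : ∀ i ∈ S, g₁ i = g₂ i) :
    aeval g₁ F = aeval g₂ F := by
  classical
  have key : (aeval g₁).toRingHom F = (aeval g₂).toRingHom F := by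
    refine hom_congr_vars ?_ (fun i hi _ => ?_) rfl
    · ext a
      simp
    · rw [mem_vars_iff_mem_support] at hi
      obtain ⟨d, hd, hid⟩ := hi
      have hiS : i ∈ S := by
        by_contra hiS
        exact (Finsupp.mem_support_iff.mp hid) (hF d hd i hiS)
      simp [h i hiS]
  simpa using key

/-- Evaluating `X^{A₀}` at a map constant `= T` on `supp A₀` gives `T^{|A₀|}`. [folklore] -/
private theorem aeval_monomial_eq_pow {A : Type*} [CommRing A] [Algebra k A] (g : Fin n → A) (T : A)
    (A₀ : Fin n →₀ ℕ) (h : ∀ j ∈ A₀.support, g j = T) :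
    aeval g (monomial A₀ (1 : k)) = T ^ A₀.degree := by
  rw [aeval_monomial, map_one, one_mul, Finsupp.prod, Finsupp.degree_apply,
    ← Finset.prod_pow_eq_pow_sum]
  exact Finset.prod_congr rfl fun j hj => by rw [h j hj]

/-- **Lemma W (translation by a monomial ⇒ invariance vector).** If `F ∈ k[X_S]` satisfies
`F(X_i ↦ X_i + c_i U^{A₀}) = F` with `A₀ ≠ 0` supported off `S`, then `c ∈ 𝕎(F)`, i.e.
`F(X + cT) = F(X)` for an indeterminate `T`: substitute `X_i ↦ X_i^{|A₀|}` (`i ∈ S`), `X_j ↦ T`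
(`j ∉ S`) and cancel the injective Frobenius-like `expand |A₀|`. (Ours.)
[cite: Hironaka1967, §1 (translation-invariance and the directrix); CossartJannsenSaito2020, Def. 1.26–1.29 (pp. 19–20)] -/
theorem mem_invarianceSpace_of_aeval_eq {F : MvPolynomial (Fin n) k}
    (hF : ∀ d ∈ F.support, ∀ j ∉ S, d j = 0) {A₀ : Fin n →₀ ℕ} (hA₀ : A₀ ≠ 0)
    (hA₀S : ∀ i ∈ S, A₀ i = 0) {c : Fin n → k}
    (h : aeval (fun i => X i + C (c i) * monomial A₀ 1) F = F) :
    c ∈ invarianceSpace k {F} := by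
  classical
  rw [mem_invarianceSpace_iff]
  intro F' hF'
  rw [Set.mem_singleton_iff] at hF'
  subst hF'
  set a := A₀.degree with ha
  have hapos : 0 < a := by
    rw [ha, Nat.pos_iff_ne_zero, ne_eq, Finsupp.degree_eq_zero_iff]; exact hA₀
  -- `ρ : X_i ↦ X_i^a (i ∈ S), X_j ↦ T (j ∉ S)`
  let ρ : MvPolynomial (Fin n) k →ₐ[k] MvPolynomial (Option (Fin n)) k :=
    aeval fun i => if i ∈ S then X (some i) ^ a else X none
  have hρU : ρ (monomial A₀ 1) = X none ^ a := by
    refine aeval_monomial_eq_pow _ _ A₀ fun j hj => ?_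
    have : j ∉ S := fun hjS => (Finsupp.mem_support_iff.mp hj) (hA₀S j hjS)
    simp [this]
  have hexp : (expand a).comp (rename some) =
      aeval (fun i : Fin n => (X (some i) : MvPolynomial (Option (Fin n)) k) ^ a) :=
    MvPolynomial.algHom_ext fun i => by simp [expand_X]
  have hρF : ρ F' = expand a (rename some F') := by
    rw [← AlgHom.comp_apply, hexp]
    exact aeval_congr_of_vars S hF (fun i hi => by simp [hi])
  have htr : translate k c (rename some F') =
      aeval (fun i => X (some i) + C (c i) * X none) F' := by
    have := MvPolynomial.algHom_ext (f := (translate k c).comp (rename some))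
      (g := aeval fun i => (X (some i) : MvPolynomial (Option (Fin n)) k) + C (c i) * X none)
      fun i => by simp [translate_X_some]
    exact AlgHom.congr_fun this F'
  have hρτ : ρ (aeval (fun i => X i + C (c i) * monomial A₀ 1) F') =
      expand a (translate k c (rename some F')) := by
    rw [htr, ← AlgHom.comp_apply, comp_aeval, ← AlgHom.comp_apply, comp_aeval]
    refine aeval_congr_of_vars S hF fun i hi => ?_
    simp only [map_add, map_mul, hρU, MvPolynomial.algHom_C, MvPolynomial.algebraMap_eq, expand_X]
    simp [ρ, hi]
  have key := congrArg ρ h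
  rw [hρτ, hρF] at key
  exact expand_injective hapos key

end Helpers

/-! ## §7 Case (b): the `y'`-block contains a pure-`u` monomial of degree `m₀ ≤ δ` -/

section CaseB

variable {f : MvPolynomial (Fin n) k} {ν : ℕ} {S : Finset (Fin n)}

/-- The linear part as a sum: `in_1(P) = Σ_j (∂P/∂X_j)(0) X_j`.
[cite: AbramovichTemkinWlodarczyk2024, §3.4 (p. 1570)] -/
theorem homogeneousComponent_one_eq_sum (P : MvPolynomial (Fin n) k) :
    homogeneousComponent 1 P = ∑ j, C (coeff (Finsupp.single j 1) P) * X j := by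
  classical
  have h1 : homogeneousComponent 1 (homogeneousComponent 1 P) = homogeneousComponent 1 P := by
    rw [homogeneousComponent_of_mem (homogeneousComponent_mem 1 P), if_pos rfl]
  rw [← h1]
  have := weightedHomogeneousComponent_one_weightedHomogeneousComponent (fun _ : Fin n => (1 : ℕ)) 1 P
  change homogeneousComponent 1 (homogeneousComponent 1 P) = _ at this
  rw [this]
  exact Finset.sum_congr (by ext; simp) fun _ _ => rfl

/-- `(λ + B·𝟙)(A) = λ(A) + B|A|`. [folklore] -/
private theorem weight_add_const (lam : Fin n → ℕ) (B : ℕ) (A : Fin n →₀ ℕ) :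
    weight (fun j => lam j + B) A = weight lam A + B * A.degree := by
  classical
  simp only [Finsupp.weight_apply, smul_eq_mul, Finsupp.degree_eq_sum]
  rw [Finsupp.sum_fintype _ _ (fun _ => by simp), Finsupp.sum_fintype _ _ (fun _ => by simp),
    Finset.mul_sum, ← Finset.sum_add_distrib]
  exact Finset.sum_congr rfl fun j _ => by ring

/-- Exponents of degree `1` are unit vectors. [folklore] -/
private theorem eq_single_of_degree_eq_one {d : Fin n →₀ ℕ} (hd : d.degree = 1) : ∃ j, d = Finsupp.single j 1 := by
  rw [Finsupp.degree_eq_weight_one] at hd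
  rcases eq_single_or_forall_lt_of_weight_eq (fun _ : Fin n => (1 : ℕ)) (fun _ => one_pos) hd with
    ⟨j, hj, -⟩ | h
  · exact ⟨j, hj⟩
  · exfalso
    have hd0 : d ≠ 0 := by
      rintro rfl; simp at hd
    obtain ⟨j, hj⟩ := Finsupp.support_nonempty_iff.mpr hd0
    exact lt_irrefl _ (h j hj)

/-- `|B|` of a unit vector. [folklore] -/
private theorem blockDeg_single (S : Finset (Fin n)) (j : Fin n) :
    blockDeg S (Finsupp.single j 1) = if j ∈ S then 1 else 0 := by
  classical
  rw [blockDeg_eq_sum_univ]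
  by_cases hj : j ∈ S
  · rw [if_pos hj, Finset.sum_eq_single_of_mem j hj (fun i _ hij => by simp [Ne.symm hij])]
    simp
  · rw [if_neg hj]
    exact Finset.sum_eq_zero fun i hi => by
      rw [Finsupp.single_apply, if_neg]
      rintro rfl; exact hj hi

/-- **Case (b) of the vertex theorem: the `y'`-block contains a pure-`u` monomial of least degree
`m₀ ≤ δ`.** Write `z_i = Ψ(X_i)`, `g = Ψ⁻¹ f`, `G₀ = in_0(g)`, `F = in_ν f`. Two applications of
Lemma G (`weightedHomogeneousComponent_map_of_le_monomialOrd`) give `F = G₀(lin z)` and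
`in_{(m₀ on S,1 off S)}(f) = G₀(θ)`, `θ_i = lin z_i + (pure-u part of degree m₀ of z_i)`; a third,
for the exposing weights `W = (M* on S, L^j off S)` (`M*` = the least `L^•`-weight `λ(A₀)` of a
degree-`m₀` pure-`u` exponent `A₀` of the block), isolates `in_{A₀}(f) = F(X + c' U^{A₀})` with
`c' = (block inverse)·(coeff of U^{A₀} in z) ≠ 0` and shows that `A₀` is exposed. If `A₀` is a point
of `Δ(f;u;y)` it is a solvable vertex of the `δ`-face (`δ = m₀`), contradicting preparedness; if not,
`F(X + c'U^{A₀}) = F` and Lemma W puts `c' ≠ 0` in `𝕎(F)`, contradicting `|S| = τ`. Stated for a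
centre `(Ψ; y^ν, u^{νc})` with any `c > max(1, m₀)` (rev. 2; rev. 1 had `c > δ`), so that it also
serves `c = δ` in §9. (Ours, in the model.)
[cite: CossartJannsenSaito2020, Thm. 8.16 (p. 121), Thm. 8.22 (a) (p. 124); Hironaka1967, Thm. (4.8)] -/
theorem caseB_false (hord : monomialOrd (fun _ => 1) f = ν) (hν : 0 < ν)
    (hτ : S.card = hironakaTau k {homogeneousComponent ν f})
    (hFS : ∀ d ∈ (homogeneousComponent ν f).support, ∀ j ∉ S, d j = 0)
    (hprep : IsDeltaPrepared S ν f) {δ : ℚ} (hδ : hironakaDelta S ν f = δ)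
    {c : ℚ} (hc1 : 1 < c) {Ψ : MvPolynomial (Fin n) k ≃ₐ[k] MvPolynomial (Fin n) k}
    (h : IsCentreFor f Ψ (blockWeights S ν c)) {m₀ : ℕ} (hm₀δ : (m₀ : ℚ) ≤ δ) (hcm₀ : (m₀ : ℚ) < c)
    (hmin : ∀ i ∈ S, ∀ d ∈ (Ψ (X i)).support, blockDeg S d = 0 → m₀ ≤ d.degree)
    {i₀ : Fin n} (hi₀ : i₀ ∈ S) {A₁ : Fin n →₀ ℕ} (hA₁ : A₁ ∈ (Ψ (X i₀)).support)
    (hA₁b : blockDeg S A₁ = 0) (hA₁deg : A₁.degree = m₀) : False := by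
  classical
  have hΨ := h.1
  have hadm := h.2.2
  set g := Ψ.symm f with hg
  have hfg : Ψ g = f := Ψ.apply_symm_apply f
  have hδ1 : 1 < δ := one_lt_hironakaDelta hord hFS hδ
  have hcpos : 0 < c := one_pos.trans hc1
  have hνq : (0 : ℚ) < ν := by exact_mod_cast hν
  have hlin : ∀ i ∈ S, ∀ j ∉ S, coeff (Finsupp.single j 1) (Ψ (X i)) = 0 := fun i hi j hj =>
    coeff_single_eq_zero_of_isCentreFor hord hν hτ hFS hδ hc1 h hi hj
  have hF4 : zeroInitial S ν f = homogeneousComponent ν f := zeroInitial_eq_homogeneousComponent hFS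
  -- `m₀ ≥ 2`
  have hm₀2 : 2 ≤ m₀ := by
    rw [← hA₁deg]
    by_contra hlt
    push Not at hlt
    have hA₁0 : A₁ ≠ 0 := by
      rintro rfl
      have := hΨ i₀
      rw [constantCoeff_eq] at this
      exact (mem_support_iff.mp hA₁) this
    have hdeg1 : A₁.degree = 1 := by
      have := Nat.pos_of_ne_zero (mt (Finsupp.degree_eq_zero_iff A₁).mp hA₁0); omega
    obtain ⟨j, rfl⟩ := eq_single_of_degree_eq_one hdeg1
    have hj : j ∉ S := by
      intro hj; rw [blockDeg_single, if_pos hj] at hA₁b; exact one_ne_zero hA₁b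
    exact (mem_support_iff.mp hA₁) (hlin i₀ hi₀ j hj)
  have hm₀pos : 0 < m₀ := by omega
  -- weights `w₀ = (m₀ on S, 1 off S)`
  set w₀ : Fin n → ℕ := fun i => if i ∈ S then m₀ else 1 with hw₀
  have hw₀pos : ∀ i, 0 < w₀ i := fun i => by by_cases hi : i ∈ S <;> simp [hw₀, hi, hm₀pos]
  have hw₀S : ∀ i, w₀ i = m₀ ↔ i ∈ S := fun i => by
    by_cases hi : i ∈ S <;> simp [hw₀, hi]; omega
  have hdom₀ : ∀ i, (w₀ i : ℕ∞) ≤ monomialOrd w₀ (Ψ (X i)) :=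
    blockWeights_le_monomialOrd (S := S) (p := m₀) (q := 1) (by omega) hΨ
      (fun i hi d hd hb => by simpa using hmin i hi d hd hb)
  -- admissibility ⇒ shape of the low-weight monomials of `g`
  have hadm_m : ∀ m : ℕ, (m : ℚ) < c → 1 ≤ m → ∀ d ∈ g.support,
      (m * blockDeg S d + coDeg S d = ν * m ↔ blockDeg S d = ν ∧ coPart S d = 0) := by
    intro m hmc hm1 d hd
    constructor
    · intro hw
      by_cases hb : blockDeg S d < ν
      · exfalso
        have h1 := ((isAdmissibleFor_blockWeights_iff S hν hcpos g).mp hadm) d hd hb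
        have h2 : (m : ℚ) * ((ν - blockDeg S d : ℕ) : ℚ) < coDeg S d :=
          lt_of_lt_of_le (mul_lt_mul_of_pos_right hmc (by exact_mod_cast Nat.sub_pos_of_lt hb)) h1
        have h3 : m * (ν - blockDeg S d) < coDeg S d := by exact_mod_cast h2
        have h4 : m * blockDeg S d + m * (ν - blockDeg S d) = m * ν := by
          rw [← Nat.mul_add]; congr 1; omega
        have h5 : ν * m = m * ν := Nat.mul_comm _ _
        omega
      · push Not at hb
        have h1 : m * ν ≤ m * blockDeg S d := Nat.mul_le_mul_left m hb
        have h5 : ν * m = m * ν := Nat.mul_comm _ _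
        have h6 : coDeg S d = 0 := by omega
        have h7 : m * blockDeg S d = m * ν := by omega
        refine ⟨Nat.eq_of_mul_eq_mul_left (by omega) h7, ?_⟩
        rwa [coDeg_eq_zero_iff_coPart_eq_zero] at h6
    · rintro ⟨hb, hcp⟩
      rw [hb, (coDeg_eq_zero_iff_coPart_eq_zero S d).mpr hcp, add_zero, Nat.mul_comm]
  -- `G₀ := in_0(g)` is supported in the `S`-variables
  have hG₀supp : ∀ d ∈ (zeroInitial S ν g).support, ∀ j ∉ S, d j = 0 := by
    intro d hd j hj
    rw [zeroInitial, mem_support_sum_filter_monomial] at hd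
    have := DFunLike.congr_fun hd.2.2 j
    rwa [coPart_apply_of_not_mem S hj] at this
  have hG₀shape : ∀ d ∈ (zeroInitial S ν g).support, blockDeg S d = ν ∧ coPart S d = 0 := by
    intro d hd
    rw [zeroInitial, mem_support_sum_filter_monomial] at hd
    exact hd.2
  -- (B2) `in_{w₀, νm₀}(g) = G₀`
  have hB2 : weightedHomogeneousComponent w₀ (ν * m₀) g = zeroInitial S ν g := by
    ext d
    rw [coeff_weightedHomogeneousComponent, zeroInitial, coeff_sum_filter_monomial, weight_block,
      one_mul]
    by_cases hd : d ∈ g.support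
    · have key := hadm_m m₀ hcm₀ (by omega) d hd
      by_cases hB : blockDeg S d = ν ∧ coPart S d = 0
      · rw [if_pos (key.mpr hB), if_pos hB]
      · rw [if_neg (mt key.mp hB), if_neg hB]
    · simp [notMem_support_iff.mp hd]
  -- (B3) `in_ν(g) = G₀`
  have hB3 : homogeneousComponent ν g = zeroInitial S ν g := by
    ext d
    rw [coeff_homogeneousComponent, zeroInitial, coeff_sum_filter_monomial,
      degree_eq_blockDeg_add_coDeg S]
    by_cases hd : d ∈ g.support
    · have key := hadm_m 1 (by exact_mod_cast hc1) le_rfl d hd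
      rw [one_mul, mul_one] at key
      by_cases hB : blockDeg S d = ν ∧ coPart S d = 0
      · rw [if_pos (key.mpr hB), if_pos hB]
      · rw [if_neg (mt key.mp hB), if_neg hB]
    · simp [notMem_support_iff.mp hd]
  -- (★★) `F = G₀(lin z)`
  have hordg : monomialOrd (fun _ => 1) g = ν := by rw [hg, monomialOrd_one_symm_eq Ψ hΨ f, hord]
  have hdom1 : ∀ i, ((fun _ => 1 : Fin n → ℕ) i : ℕ∞) ≤ monomialOrd (fun _ => 1) (Ψ (X i)) :=
    fun i => one_le_monomialOrd_one_of_constantCoeff_eq_zero _ (hΨ i)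
  have hSS := weightedHomogeneousComponent_map_of_le_monomialOrd (fun _ => 1)
    (Ψ : MvPolynomial (Fin n) k →ₐ[k] MvPolynomial (Fin n) k) hdom1 g (m := ν) hordg.symm.le
  simp only [AlgEquiv.coe_toAlgHom, hfg] at hSS
  change homogeneousComponent ν f =
    aeval (fun i => homogeneousComponent 1 (Ψ (X i))) (homogeneousComponent ν g) at hSS
  rw [hB3] at hSS
  -- (★) `in_{w₀, νm₀}(f) = G₀(θ)`
  have hadm_m₀ : IsAdmissibleFor (blockWeights S ν m₀) g := by
    refine hadm.mono fun i => ?_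
    by_cases hi : i ∈ S
    · simp [blockWeights, hi]
    · simp only [blockWeights, hi, if_false]
      exact inv_anti₀ (mul_pos hνq (by exact_mod_cast hm₀pos)) (mul_le_mul_of_nonneg_left hcm₀.le hνq.le)
  have hwγ₀ : ∀ i, (w₀ i : ℚ) = ((ν * m₀ : ℕ) : ℚ) * blockWeights S ν (m₀ : ℚ) i := by
    intro i
    have hm₀q : (m₀ : ℚ) ≠ 0 := by exact_mod_cast hm₀pos.ne'
    by_cases hi : i ∈ S
    · simp only [hw₀, blockWeights, hi, if_true, Nat.cast_mul]; field_simp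
    · simp only [hw₀, blockWeights, hi, if_false, Nat.cast_mul, Nat.cast_one]; field_simp
  have hN₀ : ((ν * m₀ : ℕ) : ℕ∞) ≤ monomialOrd w₀ g :=
    (isAdmissibleFor_iff_le_monomialOrd (blockWeights S ν (m₀ : ℚ)) w₀ (Nat.mul_pos hν hm₀pos)
      hwγ₀ g).mp hadm_m₀
  have hS := weightedHomogeneousComponent_map_of_le_monomialOrd w₀
    (Ψ : MvPolynomial (Fin n) k →ₐ[k] MvPolynomial (Fin n) k) hdom₀ g hN₀
  simp only [AlgEquiv.coe_toAlgHom, hfg, hB2] at hS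
  set θ : Fin n → MvPolynomial (Fin n) k := fun i => weightedHomogeneousComponent w₀ (w₀ i) (Ψ (X i))
    with hθ
  -- monomials of `θ i`, `i ∈ S`: the `X_j` (`j ∈ S`) and pure-`u` monomials of degree `m₀`
  have hθsupp : ∀ i ∈ S, ∀ d ∈ (θ i).support,
      d ∈ (Ψ (X i)).support ∧ ((∃ j ∈ S, d = Finsupp.single j 1) ∨ (blockDeg S d = 0 ∧ d.degree = m₀)) := by
    intro i hi d hd
    have hwi : w₀ i = m₀ := (hw₀S i).mpr hi
    rw [hθ] at hd
    simp only [mem_support_iff, coeff_weightedHomogeneousComponent, hwi] at hd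
    have hwt : weight w₀ d = m₀ := by by_contra hne; exact hd (if_neg hne)
    rw [if_pos hwt] at hd
    refine ⟨mem_support_iff.mpr hd, ?_⟩
    rw [weight_block, one_mul] at hwt
    rcases Nat.eq_zero_or_pos (blockDeg S d) with hb | hb
    · right
      refine ⟨hb, ?_⟩
      rw [degree_eq_blockDeg_add_coDeg S, hb, zero_add]; rw [hb, mul_zero, zero_add] at hwt; exact hwt
    · left
      have hle : m₀ ≤ m₀ * blockDeg S d := Nat.le_mul_of_pos_right m₀ hb
      have hc0 : coDeg S d = 0 := by omega
      have hb1 : blockDeg S d = 1 :=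
        Nat.eq_of_mul_eq_mul_left hm₀pos (by rw [mul_one]; omega)
      have hdeg : d.degree = 1 := by rw [degree_eq_blockDeg_add_coDeg S, hb1, hc0]
      obtain ⟨j, rfl⟩ := eq_single_of_degree_eq_one hdeg
      refine ⟨j, ?_, rfl⟩
      by_contra hj
      rw [blockDeg_single, if_neg hj] at hb1
      exact zero_ne_one hb1
  -- exposing data: `L`, `λ_j = L^j`, the set `E` of pure-`u` degree-`m₀` exponents, `A₀`
  set L : ℕ := ν * m₀ + 1 with hL
  set lam : Fin n → ℕ := fun j => L ^ (j : ℕ) with hlam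
  have hinj : ∀ A A' : Fin n →₀ ℕ, A.degree < L → A'.degree < L →
      weight lam A = weight lam A' → A = A' := fun A A' hA hA' hAA' => eq_of_weight_pow_eq hA hA' hAA'
  set E : Finset (Fin n →₀ ℕ) :=
    S.biUnion fun i => (Ψ (X i)).support.filter fun d => blockDeg S d = 0 ∧ d.degree = m₀ with hE
  have hmemE : ∀ {A}, A ∈ E ↔ ∃ i ∈ S, A ∈ (Ψ (X i)).support ∧ blockDeg S A = 0 ∧ A.degree = m₀ := by
    intro A
    simp only [hE, Finset.mem_biUnion, Finset.mem_filter]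
  have hEne : E.Nonempty := ⟨A₁, hmemE.mpr ⟨i₀, hi₀, hA₁, hA₁b, hA₁deg⟩⟩
  obtain ⟨A₀, hA₀E, hA₀min⟩ := Finset.exists_min_image E (fun A => weight lam A) hEne
  obtain ⟨i₁, hi₁, hA₀i₁, hA₀b, hA₀deg⟩ := hmemE.mp hA₀E
  set Mstar : ℕ := weight lam A₀ with hMstar
  have hm₀L : m₀ < L := by
    have : m₀ ≤ ν * m₀ := Nat.le_mul_of_pos_left m₀ hν
    omega
  have hA₀uniq : ∀ A ∈ E, weight lam A = Mstar → A = A₀ := by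
    intro A hA hwA
    obtain ⟨-, -, -, -, hAdeg⟩ := hmemE.mp hA
    exact hinj A A₀ (by rw [hAdeg]; exact hm₀L) (by rw [hA₀deg]; exact hm₀L) hwA
  have hA₀S : ∀ i ∈ S, A₀ i = 0 := (blockDeg_eq_zero_iff S A₀).mp hA₀b
  have hA₀ne : A₀ ≠ 0 := by
    intro h0; rw [h0] at hA₀deg; simp at hA₀deg; omega
  have hA₀co : coPart S A₀ = A₀ := coPart_eq_self_of_blockDeg_eq_zero S hA₀b
  -- `W = (M* on S, λ off S)`
  set W : Fin n → ℕ := fun i => if i ∈ S then Mstar else lam i with hW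
  have hWblock : ∀ d, weight W d = Mstar * blockDeg S d + weight lam (coPart S d) :=
    weight_block_fun S Mstar lam
  have hWsingle : ∀ j ∈ S, weight W (Finsupp.single j 1) = Mstar := by
    intro j hj
    rw [Finsupp.weight_single, one_smul]; simp [hW, hj]
  have hWpure : ∀ d, blockDeg S d = 0 → weight W d = weight lam d := fun d hd =>
    weight_eq_of_blockDeg_eq_zero S Mstar lam hd
  -- `θ'` and its domination of `W`
  set θ' : Fin n → MvPolynomial (Fin n) k := fun i => if i ∈ S then θ i else X i with hθ'
  have hD1 : ∀ i, (W i : ℕ∞) ≤ monomialOrd W (aeval θ' (X i : MvPolynomial (Fin n) k)) := by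
    intro i
    rw [aeval_X]
    by_cases hi : i ∈ S
    · simp only [hθ', hi, if_true]
      rw [le_monomialOrd_iff]
      intro d hd
      simp only [hW, hi, if_true]
      obtain ⟨hdz, hshape⟩ := hθsupp i hi d hd
      rcases hshape with ⟨j, hj, rfl⟩ | ⟨hb, hdeg⟩
      · exact (hWsingle j hj).ge
      · rw [show weight (fun i => if i ∈ S then Mstar else lam i) d = weight lam d from hWpure d hb]
        exact hA₀min d (hmemE.mpr ⟨i, hi, hdz, hb, hdeg⟩)
    · simp only [hθ', hi, if_false]
      exact (monomialOrd_X W i).ge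
  -- `G₀` is `W`-homogeneous of weight `ν M*`
  have hG₀W : ∀ d ∈ (zeroInitial S ν g).support, weight W d = ν * Mstar := by
    intro d hd
    obtain ⟨hb, hcp⟩ := hG₀shape d hd
    rw [hWblock, hb, hcp, map_zero, add_zero, Nat.mul_comm]
  have hG₀ord : ((ν * Mstar : ℕ) : ℕ∞) ≤ monomialOrd W (zeroInitial S ν g) := by
    rw [le_monomialOrd_iff]
    exact fun d hd => (hG₀W d hd).ge
  have hG₀hom : weightedHomogeneousComponent W (ν * Mstar) (zeroInitial S ν g) = zeroInitial S ν g := by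
    ext d
    rw [coeff_weightedHomogeneousComponent]
    by_cases hd : d ∈ (zeroInitial S ν g).support
    · rw [if_pos (hG₀W d hd)]
    · rw [notMem_support_iff.mp hd]; split_ifs <;> rfl
  -- Lemma G for `Λ₁ = aeval θ'`
  have hΛ := weightedHomogeneousComponent_map_of_le_monomialOrd W (aeval θ') hD1 (zeroInitial S ν g) hG₀ord
  simp only [aeval_X, hG₀hom] at hΛ
  -- `θ'' i = lin z_i + c_i U^{A₀}` on `S`
  have hθ''S : ∀ i ∈ S, weightedHomogeneousComponent W (W i) (θ' i) =
      homogeneousComponent 1 (Ψ (X i)) + C (coeff A₀ (Ψ (X i))) * monomial A₀ 1 := by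
    intro i hi
    have hWi : W i = Mstar := by simp [hW, hi]
    have hwi : w₀ i = m₀ := (hw₀S i).mpr hi
    simp only [hθ', hi, if_true, hWi]
    ext d
    rw [coeff_weightedHomogeneousComponent, coeff_add, coeff_homogeneousComponent, coeff_C_mul,
      coeff_monomial]
    have hθcoeff : coeff d (θ i) = if weight w₀ d = m₀ then coeff d (Ψ (X i)) else 0 := by
      rw [hθ]; simp only [coeff_weightedHomogeneousComponent, hwi]
    rw [hθcoeff]
    by_cases hdA : d = A₀
    · subst hdA
      have h1 : weight w₀ d = m₀ := by
        rw [weight_block, hA₀b, mul_zero, zero_add, one_mul, ← degree_coPart, hA₀co, hA₀deg]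
      have h2 : weight W d = Mstar := by rw [hWpure d hA₀b]
      have h3 : d.degree ≠ 1 := by rw [hA₀deg]; omega
      simp [h1, h2, h3]
    · rw [if_neg (Ne.symm hdA), mul_zero, add_zero]
      by_cases hdeg : d.degree = 1
      · rw [if_pos hdeg]
        obtain ⟨j, rfl⟩ := eq_single_of_degree_eq_one hdeg
        by_cases hj : j ∈ S
        · have h1 : weight w₀ (Finsupp.single j 1) = m₀ := by
            rw [Finsupp.weight_single, one_smul]; exact (hw₀S j).mpr hj
          rw [if_pos (hWsingle j hj), if_pos h1]
        · rw [hlin i hi j hj]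
          have h1 : weight w₀ (Finsupp.single j 1) ≠ m₀ := by
            rw [Finsupp.weight_single, one_smul]; simp [hw₀, hj]; omega
          simp [h1]
      · rw [if_neg hdeg]
        by_cases hWd : weight W d = Mstar
        · rw [if_pos hWd]
          by_cases hwd : weight w₀ d = m₀
          · rw [if_pos hwd]
            by_contra hne
            have hdθ : d ∈ (θ i).support := by
              rw [mem_support_iff, hθcoeff, if_pos hwd]; exact hne
            obtain ⟨hdz, hshape⟩ := hθsupp i hi d hdθ
            rcases hshape with ⟨j, hj, rfl⟩ | ⟨hb, hdg⟩
            · exact hdeg (by simp [Finsupp.degree_single])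
            · rw [hWpure d hb] at hWd
              exact hdA (hA₀uniq d (hmemE.mpr ⟨i, hi, hdz, hb, hdg⟩) hWd)
          · rw [if_neg hwd]
        · rw [if_neg hWd]
  set cvec : Fin n → k := fun i => coeff A₀ (Ψ (X i)) with hcvec
  set θ'' : Fin n → MvPolynomial (Fin n) k := fun i =>
    if i ∈ S then homogeneousComponent 1 (Ψ (X i)) + C (cvec i) * monomial A₀ 1 else X i with hθ''def
  have hθ''eq : (fun i => weightedHomogeneousComponent W (W i) (θ' i)) = θ'' := by
    funext i
    by_cases hi : i ∈ S
    · rw [hθ''def]; simp only [hi, if_true]; exact hθ''S i hi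
    · simp only [hθ''def, hθ', hi, if_false]
      exact weightedHomogeneousComponent_eq_self (isWeightedHomogeneous_X k W i)
  rw [hθ''eq] at hΛ
  -- (B9) `in_{W}(in_{w₀}(f)) = in_{A₀}(f)`
  have hB9 : weightedHomogeneousComponent W (ν * Mstar) (weightedHomogeneousComponent w₀ (ν * m₀) f) =
      pointInitial S ν A₀ f := by
    ext d
    rw [coeff_weightedHomogeneousComponent, coeff_weightedHomogeneousComponent, pointInitial,
      coeff_sum_filter_monomial]
    have key : (weight w₀ d = ν * m₀ ∧ weight W d = ν * Mstar) ↔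
        (blockDeg S d ≤ ν ∧ coPart S d = (ν - blockDeg S d) • A₀) := by
      rw [weight_block, one_mul, hWblock]
      constructor
      · rintro ⟨h1, h2⟩
        have hb : blockDeg S d ≤ ν := by
          by_contra hlt; push Not at hlt
          have h6 : m₀ * (ν + 1) ≤ m₀ * blockDeg S d := Nat.mul_le_mul_left _ hlt
          have h7 : m₀ * (ν + 1) = m₀ * ν + m₀ := by ring
          have h8 : ν * m₀ = m₀ * ν := Nat.mul_comm _ _
          omega
        refine ⟨hb, hinj _ _ ?_ ?_ ?_⟩
        · rw [degree_coPart]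
          have : coDeg S d ≤ ν * m₀ := by omega
          omega
        · rw [map_nsmul, hA₀deg, smul_eq_mul]
          have : (ν - blockDeg S d) * m₀ ≤ ν * m₀ := Nat.mul_le_mul_right _ (Nat.sub_le _ _)
          omega
        · rw [map_nsmul, smul_eq_mul, ← hMstar]
          have h3 : Mstar * blockDeg S d + Mstar * (ν - blockDeg S d) = Mstar * ν := by
            rw [← Nat.mul_add]; congr 1; omega
          have h4 : ν * Mstar = Mstar * ν := Nat.mul_comm _ _
          have h5 : (ν - blockDeg S d) * Mstar = Mstar * (ν - blockDeg S d) := Nat.mul_comm _ _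
          omega
      · rintro ⟨hb, hcp⟩
        have hcd : coDeg S d = (ν - blockDeg S d) * m₀ := by
          rw [← degree_coPart, hcp, map_nsmul, hA₀deg, smul_eq_mul]
        constructor
        · rw [hcd]
          have h3 : m₀ * blockDeg S d + m₀ * (ν - blockDeg S d) = m₀ * ν := by
            rw [← Nat.mul_add]; congr 1; omega
          have h4 : (ν - blockDeg S d) * m₀ = m₀ * (ν - blockDeg S d) := Nat.mul_comm _ _
          have h5 : ν * m₀ = m₀ * ν := Nat.mul_comm _ _
          omega
        · rw [hcp, map_nsmul, smul_eq_mul, ← hMstar]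
          have h3 : Mstar * blockDeg S d + Mstar * (ν - blockDeg S d) = Mstar * ν := by
            rw [← Nat.mul_add]; congr 1; omega
          have h4 : ν * Mstar = Mstar * ν := Nat.mul_comm _ _
          have h5 : (ν - blockDeg S d) * Mstar = Mstar * (ν - blockDeg S d) := Nat.mul_comm _ _
          omega
    by_cases hP : blockDeg S d ≤ ν ∧ coPart S d = (ν - blockDeg S d) • A₀
    · obtain ⟨h1, h2⟩ := key.mpr hP
      rw [if_pos h2, if_pos h1, if_pos hP]
    · rw [if_neg hP]
      by_cases h2 : weight W d = ν * Mstar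
      · rw [if_pos h2, if_neg (fun h1 => hP (key.mp ⟨h1, h2⟩))]
      · rw [if_neg h2]
  -- the identity `in_{A₀}(f) = G₀(θ'')`
  have hθθ' : aeval θ (zeroInitial S ν g) = aeval θ' (zeroInitial S ν g) :=
    aeval_congr_of_vars S hG₀supp fun i hi => by simp [hθ', hi]
  have hE1 : pointInitial S ν A₀ f = aeval θ'' (zeroInitial S ν g) := by
    rw [← hB9, hS, hθθ', hΛ]
  -- (E2) every `w₀`-face monomial of `f` has `W`-weight `≥ ν M*`
  have hE2 : ∀ d ∈ f.support, weight w₀ d = ν * m₀ → ν * Mstar ≤ weight W d := by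
    intro d hd hwd
    have h1 : ((ν * Mstar : ℕ) : ℕ∞) ≤ monomialOrd W (aeval θ' (zeroInitial S ν g)) :=
      hG₀ord.trans (monomialOrd_le_monomialOrd_map W
        (aeval θ' : MvPolynomial (Fin n) k →ₐ[k] MvPolynomial (Fin n) k).toRingHom
        (fun i => by simpa using hD1 i) _)
    rw [← hθθ', ← hS, le_monomialOrd_iff] at h1
    exact h1 d (by rw [mem_support_iff, coeff_weightedHomogeneousComponent, if_pos hwd]; exact mem_support_iff.mp hd)
  -- the block inverse: `c' := B c`
  have hdom₀' : ∀ i, (w₀ i : ℕ∞) ≤ monomialOrd w₀ (Ψ.symm (X i)) := fun i =>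
    (monomialOrd_ringEquiv_symm_X w₀ (Ψ : MvPolynomial (Fin n) k ≃+* MvPolynomial (Fin n) k) hdom₀ i).ge
  have hMB : ∀ i ∈ S, ∀ l ∈ S, ∑ j ∈ S, coeff (Finsupp.single j 1) (Ψ (X i)) *
      coeff (Finsupp.single l 1) (Ψ.symm (X j)) = if i = l then 1 else 0 := by
    intro i hi l hl
    have := sum_jacobianBlock_symm_mul_jacobianBlock w₀ hw₀pos Ψ.symm hdom₀' (i := i) (l := l)
      (by rw [(hw₀S l).mpr hl, (hw₀S i).mpr hi])
    rw [AlgEquiv.symm_symm] at this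
    rw [← this]
    refine Finset.sum_congr ?_ fun _ _ => rfl
    ext j
    simp only [Finset.mem_filter, Finset.mem_univ, true_and, (hw₀S i).mpr hi]
    exact ((hw₀S j)).symm
  set c' : Fin n → k := fun j =>
    if j ∈ S then ∑ l ∈ S, coeff (Finsupp.single l 1) (Ψ.symm (X j)) * cvec l else 0 with hc'
  have hc'S : ∀ j ∉ S, c' j = 0 := fun j hj => by simp [hc', hj]
  have hMc' : ∀ i ∈ S, ∑ j ∈ S, coeff (Finsupp.single j 1) (Ψ (X i)) * c' j = cvec i := by
    intro i hi
    calc ∑ j ∈ S, coeff (Finsupp.single j 1) (Ψ (X i)) * c' j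
        = ∑ j ∈ S, ∑ l ∈ S, coeff (Finsupp.single j 1) (Ψ (X i)) *
            coeff (Finsupp.single l 1) (Ψ.symm (X j)) * cvec l := by
          refine Finset.sum_congr rfl fun j hj => ?_
          simp only [hc', hj, if_true, Finset.mul_sum, mul_assoc]
      _ = ∑ l ∈ S, (∑ j ∈ S, coeff (Finsupp.single j 1) (Ψ (X i)) *
            coeff (Finsupp.single l 1) (Ψ.symm (X j))) * cvec l := by
          rw [Finset.sum_comm]; exact Finset.sum_congr rfl fun l _ => by rw [Finset.sum_mul]
      _ = cvec i := by
          rw [Finset.sum_congr rfl fun l hl => by rw [hMB i hi l hl]]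
          simp [Finset.sum_ite_eq, hi]
  -- `F(X + c' U^{A₀}) = G₀(θ'')`
  have hlinsum : ∀ i ∈ S, homogeneousComponent 1 (Ψ (X i)) =
      ∑ j ∈ S, C (coeff (Finsupp.single j 1) (Ψ (X i))) * X j := by
    intro i hi
    rw [homogeneousComponent_one_eq_sum]
    refine (Finset.sum_subset (Finset.subset_univ S) fun j _ hj => ?_).symm
    rw [hlin i hi j hj, C_0, zero_mul]
  have htrans : aeval (fun j => X j + C (c' j) * monomial A₀ 1) (homogeneousComponent ν f) =
      aeval θ'' (zeroInitial S ν g) := by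
    rw [hSS, ← AlgHom.comp_apply, comp_aeval]
    refine aeval_congr_of_vars S hG₀supp fun i hi => ?_
    simp only [hθ''def, hi, if_true, hlinsum i hi, map_sum, map_mul, MvPolynomial.algHom_C,
      MvPolynomial.algebraMap_eq, aeval_X]
    rw [← hMc' i hi]
    simp only [mul_add, Finset.sum_add_distrib, map_sum, C_mul, Finset.sum_mul]
    congr 1
    exact Finset.sum_congr rfl fun j _ => by ring
  -- conclusion
  by_cases hreal : ∃ d ∈ f.support, blockDeg S d < ν ∧ coPart S d = (ν - blockDeg S d) • A₀
  · -- `A₀` is a solvable vertex of the `δ`-face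
    obtain ⟨d, hd, hb, hcp⟩ := hreal
    have hδm₀ : δ ≤ m₀ := by
      have h1 := delta_mul_le_coDeg hδ hd hb
      rw [← degree_coPart, hcp, map_nsmul, hA₀deg, smul_eq_mul, Nat.cast_mul, mul_comm] at h1
      have h2 : (0 : ℚ) < ((ν - blockDeg S d : ℕ) : ℚ) := by exact_mod_cast Nat.sub_pos_of_lt hb
      exact le_of_mul_le_mul_right (by simpa [mul_comm] using h1) h2
    have hδeq : (m₀ : ℚ) = δ := le_antisymm hm₀δ hδm₀
    refine hprep A₀ ⟨⟨d, hd, hb, hcp⟩, ?_⟩ (by rw [hδ, hA₀deg, hδeq]) ⟨c', ?_⟩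
    · -- exposedness by `L' = λ + (ν M* + 1)·𝟙`
      set B : ℕ := ν * Mstar + 1 with hB
      refine ⟨fun j => lam j + B, fun j => by positivity, fun e he heb => ?_⟩
      rw [weight_add_const, weight_add_const, hA₀deg, ← hMstar, degree_coPart]
      have hface := delta_mul_le_coDeg hδ he heb
      rw [← hδeq] at hface
      have hface' : m₀ * (ν - blockDeg S e) ≤ coDeg S e := by exact_mod_cast hface
      rcases hface'.eq_or_lt with heq | hlt
      · -- on the `δ`-face: use (E2)
        have hwe : weight w₀ e = ν * m₀ := by
          rw [weight_block, one_mul, ← heq]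
          have h3 : m₀ * blockDeg S e + m₀ * (ν - blockDeg S e) = m₀ * ν := by
            rw [← Nat.mul_add]; congr 1; omega
          rw [h3, Nat.mul_comm]
        have h4 := hE2 e he hwe
        rw [hWblock] at h4
        have h5 : (ν - blockDeg S e) * Mstar ≤ weight lam (coPart S e) := by
          have h3 : Mstar * blockDeg S e + Mstar * (ν - blockDeg S e) = Mstar * ν := by
            rw [← Nat.mul_add]; congr 1; omega
          have h6 : (ν - blockDeg S e) * Mstar = Mstar * (ν - blockDeg S e) := Nat.mul_comm _ _
          have h7 : ν * Mstar = Mstar * ν := Nat.mul_comm _ _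
          omega
        have e1 : (ν - blockDeg S e) * (Mstar + B * m₀) =
            (ν - blockDeg S e) * Mstar + B * (m₀ * (ν - blockDeg S e)) := by ring
        rw [e1, heq]
        refine ⟨Nat.add_le_add_right h5 _, fun hEq => ?_⟩
        have h8 : weight lam (coPart S e) = (ν - blockDeg S e) * Mstar := by omega
        refine hinj _ _ ?_ ?_ ?_
        · rw [degree_coPart, ← heq]
          have : m₀ * (ν - blockDeg S e) ≤ m₀ * ν := Nat.mul_le_mul_left _ (Nat.sub_le _ _)
          have : m₀ * ν = ν * m₀ := Nat.mul_comm _ _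
          omega
        · rw [map_nsmul, hA₀deg, smul_eq_mul]
          have : (ν - blockDeg S e) * m₀ ≤ ν * m₀ := Nat.mul_le_mul_right _ (Nat.sub_le _ _)
          omega
        · rw [map_nsmul, smul_eq_mul, h8, hMstar]
      · -- strictly above the `δ`-face: strict inequality
        have hj : ν - blockDeg S e ≤ ν := Nat.sub_le _ _
        have h9 : (ν - blockDeg S e) * Mstar ≤ ν * Mstar := Nat.mul_le_mul_right _ hj
        have h10 : B * (m₀ * (ν - blockDeg S e) + 1) ≤ B * coDeg S e := Nat.mul_le_mul_left _ hlt
        have e1 : (ν - blockDeg S e) * (Mstar + B * m₀) =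
            (ν - blockDeg S e) * Mstar + B * (m₀ * (ν - blockDeg S e)) := by ring
        have e2 : B * (m₀ * (ν - blockDeg S e) + 1) = B * (m₀ * (ν - blockDeg S e)) + B := by ring
        rw [e2] at h10
        have key : (ν - blockDeg S e) * (Mstar + B * m₀) <
            weight lam (coPart S e) + B * coDeg S e := by
          rw [e1]; omega
        exact ⟨key.le, fun hEq => absurd hEq key.ne⟩
    · -- solvability
      have hfam : (fun i : Fin n => if i ∈ S then X i + C (c' i) * monomial A₀ (1 : k) else X i) =
          fun j => X j + C (c' j) * monomial A₀ 1 := by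
        funext j
        by_cases hj : j ∈ S
        · simp [hj]
        · simp [hj, hc'S j hj]
      rw [hfam, hF4, hE1, ← htrans]
  · -- `A₀` not realised: `F(X + c'U^{A₀}) = F`, contradiction with `𝕎(F) ⊆ {w|_S = 0}`
    push Not at hreal
    have hpt : pointInitial S ν A₀ f = homogeneousComponent ν f := by
      rw [← hF4]
      ext d
      rw [pointInitial, coeff_sum_filter_monomial, zeroInitial, coeff_sum_filter_monomial]
      by_cases hd : d ∈ f.support
      · by_cases h1 : blockDeg S d = ν ∧ coPart S d = 0
        · rw [if_pos h1, if_pos ⟨h1.1.le, by rw [h1.2, h1.1, Nat.sub_self, zero_smul]⟩]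
        · rw [if_neg h1, if_neg]
          rintro ⟨hb, hcp⟩
          rcases hb.lt_or_eq with hlt | heq
          · exact hreal d hd hlt hcp
          · exact h1 ⟨heq, by rw [hcp, heq, Nat.sub_self, zero_smul]⟩
      · simp [notMem_support_iff.mp hd]
    have hinv : aeval (fun j => X j + C (c' j) * monomial A₀ 1) (homogeneousComponent ν f) =
        homogeneousComponent ν f := by rw [htrans, ← hE1, hpt]
    have hmem := mem_invarianceSpace_of_aeval_eq S hFS hA₀ne hA₀S hinv
    have hc'0 : ∀ j ∈ S, c' j = 0 := fun j hj =>
      apply_eq_zero_of_mem_invarianceSpace hord hν hτ hFS hδ hmem hj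
    have hc0 : cvec i₁ = 0 := by
      rw [← hMc' i₁ hi₁]
      exact Finset.sum_eq_zero fun j hj => by rw [hc'0 j hj, mul_zero]
    exact (mem_support_iff.mp hA₀i₁) hc0

end CaseB

/-! ## §8 The vertex theorem and the bound `b_{τ+1} ≤ ν·δ` on the centre exponents -/

section Main

variable {f : MvPolynomial (Fin n) k} {ν : ℕ} {S : Finset (Fin n)}

/-- `δ(f;u;y) < ∞` forces `ν > 0`. [folklore] -/
private theorem nu_pos_of_hironakaDelta_eq {δ : ℚ} (hδ : hironakaDelta S ν f = δ) : 0 < ν := by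
  rcases Nat.eq_zero_or_pos ν with h0 | h0
  · exfalso
    subst h0
    have htop := (hironakaDelta_eq_top_iff S 0 f).mpr fun d _ => Nat.zero_le _
    rw [htop] at hδ
    exact WithTop.top_ne_coe hδ
  · exact h0

/-- **Hironaka's vertex theorem, weighted-centre polynomial model (with `u`-changes).** Let
`ν = ord f`, `S` a block with `in_ν f ∈ k[X_S]` and `|S| = τ(in_ν f)` (so `(y,u) = (X_S, X_{Sᶜ})` is
strictly admissible), and assume `(f; y; u)` is `δ`-prepared, `δ = δ(f;u;y)`. Then for NO origin-fixing
automorphism `Ψ` of `k[x]` — changing `y` AND `u` — and no `c > δ` is `(Ψ; y^ν, u^{νc})` a centre for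
`f`: the `δ`-invariant cannot be raised by any polynomial change of coordinates. Modelled on
[CJS20 Thm. 8.16 = H3 Thm. (4.8)] ("Let v be a vertex of Δ(f,y,u) such that (f,y,u) is prepared at v.
Then v is a vertex of Δ(J,u)") together with the invariance of `δ(J,u)` [CJS20 p. 208, citing CJSc
Cor. B(3)]; statement and proof here are ours (cases (a)/(b): `caseA_false`, `caseB_false`).
[cite: CossartJannsenSaito2020, Thm. 8.16 (p. 121), Def. 8.15 (3) (p. 121), App. Def. 18.34 and the remark following
it (p. 208); Hironaka1967, Thm. (4.8)] -/
theorem not_isCentreFor_blockWeights_of_isDeltaPrepared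
    (hord : monomialOrd (fun _ => 1) f = ν)
    (hτ : S.card = hironakaTau k {homogeneousComponent ν f})
    (hFS : ∀ d ∈ (homogeneousComponent ν f).support, ∀ j ∉ S, d j = 0)
    (hprep : IsDeltaPrepared S ν f) {δ : ℚ} (hδ : hironakaDelta S ν f = δ) {c : ℚ} (hc : δ < c)
    (Ψ : MvPolynomial (Fin n) k ≃ₐ[k] MvPolynomial (Fin n) k) :
    ¬ IsCentreFor f Ψ (blockWeights S ν c) := by
  classical
  intro h
  have hν : 0 < ν := nu_pos_of_hironakaDelta_eq hδ
  have hδ1 : 1 < δ := one_lt_hironakaDelta hord hFS hδ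
  by_cases hpure : ∀ i ∈ S, ∀ d ∈ (Ψ (X i)).support, blockDeg S d = 0 → δ < d.degree
  · exact caseA_false hν hδ hδ1.le hc h hpure
  · push Not at hpure
    obtain ⟨i, hi, d, hd, hb, hdδ⟩ := hpure
    have hP : ∃ m, ∃ i ∈ S, ∃ d ∈ (Ψ (X i)).support, blockDeg S d = 0 ∧ d.degree = m :=
      ⟨d.degree, i, hi, d, hd, hb, rfl⟩
    obtain ⟨i₀, hi₀, A₁, hA₁, hA₁b, hA₁deg⟩ := Nat.find_spec hP
    have hmin : ∀ i ∈ S, ∀ d ∈ (Ψ (X i)).support, blockDeg S d = 0 → Nat.find hP ≤ d.degree :=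
      fun i hi d hd hb => Nat.find_min' hP ⟨i, hi, d, hd, hb, rfl⟩
    have hm₀δ : ((Nat.find hP : ℕ) : ℚ) ≤ δ :=
      le_trans (by exact_mod_cast hmin i hi d hd hb) hdδ
    exact caseB_false hord hν hτ hFS hprep hδ (hδ1.trans hc) h hm₀δ (hm₀δ.trans_lt hc) hmin hi₀ hA₁
      hA₁b hA₁deg

/-- **`b_{τ+1} ≤ ν·δ`.** Under the hypotheses of the vertex theorem (`δ`-prepared data on a block `S`
with `|S| = τ = τ(in_ν f)`), EVERY centre `(Ψ; γ)` for `f` with `γ ≤ 1/ν` has at least `τ + 1` weights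
`≥ 1/(ν·δ(f;u;y))`. With `firstStage_mem_admissibleInvariants` (the list `(ν^τ, (νδ)^{n−τ})` is
attained) this pins the `(τ+1)`-th exponent of the lex-maximal admissible centre at `ν·δ(f;u;y)`.
(Ours, in the model.) [cite: CossartJannsenSaito2020, Thm. 8.16 (p. 121); AbramovichTemkinWlodarczyk2024, Thm. 5.3.1 and Lemma 5.2.10
(pp. 1577–1578); AbramovichQuekSchober2025, Thm. 3.5] -/
theorem succ_card_le_card_of_isCentreFor_of_isDeltaPrepared
    (hord : monomialOrd (fun _ => 1) f = ν)
    (hτ : S.card = hironakaTau k {homogeneousComponent ν f})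
    (hFS : ∀ d ∈ (homogeneousComponent ν f).support, ∀ j ∉ S, d j = 0)
    (hprep : IsDeltaPrepared S ν f) {δ : ℚ} (hδ : hironakaDelta S ν f = δ)
    {Ψ : MvPolynomial (Fin n) k ≃ₐ[k] MvPolynomial (Fin n) k} {γ : Fin n → ℚ}
    (h : IsCentreFor f Ψ γ) (hle : ∀ i, γ i ≤ (ν : ℚ)⁻¹) :
    S.card + 1 ≤ (Finset.univ.filter fun i => ((ν : ℚ) * δ)⁻¹ ≤ γ i).card := by
  classical
  have hδ1 : 1 < δ := one_lt_hironakaDelta hord hFS hδ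
  by_contra hlt
  push Not at hlt
  obtain ⟨Ψ', c, hδc, h'⟩ :=
    exists_isCentreFor_blockWeights_of_card_le hord hτ h hle hδ1.le (Nat.lt_succ_iff.mp hlt)
  exact not_isCentreFor_blockWeights_of_isDeltaPrepared hord hτ hFS hprep hδ hδc Ψ' h'

/-- The same bound read on the sorted exponent list `exps γ` (`WeightedBlowupInvNoIncrease.exps`):
at least `τ + 1` entries of `exps γ` are `≤ ν·δ(f;u;y)`, i.e. its `(τ+1)`-th entry is `≤ ν·δ`.
(Ours, in the model.) [cite: CossartJannsenSaito2020, Thm. 8.16 (p. 121); AbramovichTemkinWlodarczyk2024, Thm. 5.3.1 (p. 1578);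
AbramovichQuekSchober2025, Thm. 3.5 (the invariant as the exponent list of the maximal centre)] -/
theorem succ_card_le_countP_exps_of_isDeltaPrepared
    (hord : monomialOrd (fun _ => 1) f = ν)
    (hτ : S.card = hironakaTau k {homogeneousComponent ν f})
    (hFS : ∀ d ∈ (homogeneousComponent ν f).support, ∀ j ∉ S, d j = 0)
    (hprep : IsDeltaPrepared S ν f) {δ : ℚ} (hδ : hironakaDelta S ν f = δ)
    {Ψ : MvPolynomial (Fin n) k ≃ₐ[k] MvPolynomial (Fin n) k} {γ : Fin n → ℚ}
    (h : IsCentreFor f Ψ γ) (hle : ∀ i, γ i ≤ (ν : ℚ)⁻¹) :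
    S.card + 1 ≤ (exps γ).countP (fun x => decide (x ≤ (ν : ℚ) * δ)) := by
  classical
  have hδ1 : 1 < δ := one_lt_hironakaDelta hord hFS hδ
  have hν : 0 < ν := nu_pos_of_hironakaDelta_eq hδ
  have hpos' : (0 : ℚ) < (ν : ℚ) * δ := by
    have : (0 : ℚ) < ν := by exact_mod_cast hν
    positivity
  have hpos : (0 : ℚ) < ((ν : ℚ) * δ)⁻¹ := inv_pos.mpr hpos'
  rw [countP_exps]
  refine (succ_card_le_card_of_isCentreFor_of_isDeltaPrepared hord hτ hFS hprep hδ h hle).trans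
    (Finset.card_le_card fun i hi => ?_)
  simp only [Finset.mem_filter, Finset.mem_univ, true_and] at hi ⊢
  exact ⟨(hpos.trans_le hi).ne', inv_le_of_inv_le₀ hpos' hi⟩

/-- The inverse of an origin-fixing automorphism fixes the origin. [folklore] -/
private theorem constantCoeff_symm_X_eq_zero {Ψ : MvPolynomial (Fin n) k ≃ₐ[k] MvPolynomial (Fin n) k}
    (hΨ : ∀ i, constantCoeff (Ψ (X i)) = 0) (i : Fin n) : constantCoeff (Ψ.symm (X i)) = 0 := by
  classical
  have hdom1 : ∀ i, ((fun _ => 1 : Fin n → ℕ) i : ℕ∞) ≤ monomialOrd (fun _ => 1) (Ψ (X i)) :=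
    fun i => one_le_monomialOrd_one_of_constantCoeff_eq_zero _ (hΨ i)
  have h1 := monomialOrd_ringEquiv_symm_X (fun _ => 1)
    (Ψ : MvPolynomial (Fin n) k ≃+* MvPolynomial (Fin n) k) hdom1 i
  have h2 : ((1 : ℕ) : ℕ∞) ≤ monomialOrd (fun _ => (1 : ℕ)) (Ψ.symm (X i)) := by
    have : (Ψ : MvPolynomial (Fin n) k ≃+* MvPolynomial (Fin n) k).symm (X i) = Ψ.symm (X i) := rfl
    rw [this] at h1
    rw [h1]
  rw [le_monomialOrd_iff] at h2
  rw [constantCoeff_eq]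
  by_contra hne
  have := h2 0 (mem_support_iff.mpr hne)
  simp at this

/-- **`δ` cannot be raised (with `u`-changes).** If `(f; X_S; X_{Sᶜ})` is `δ`-prepared with
`δ = δ(f; u; y)`, then for EVERY origin-fixing automorphism `Ψ` of `k[x]` the `δ`-invariant of
`Ψ⁻¹ f` for the same split `(X_S; X_{Sᶜ})` — i.e. `δ` computed in the coordinates `z = Ψ(x)`,
`y` and `u` both changed — is `≤ δ`. Immediate from `not_isCentreFor_blockWeights_of_isDeltaPrepared`
and `isCentreFor_blockWeights_iff`. Models [CJS20 Thm. 8.16 = H3 Thm. (4.8)] with the invariance of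
`δ(J, u)` [CJS20 p. 208, citing CJSc Cor. B(3)]; statement and proof ours, in the model.
[cite: CossartJannsenSaito2020, Thm. 8.16 (p. 121), Cor. 8.17 (p. 121), App. Def. 18.34 and the remark following it (p. 208); Hironaka1967, Thm. (4.8)] -/
theorem hironakaDelta_symm_le_of_isDeltaPrepared
    (hord : monomialOrd (fun _ => 1) f = ν)
    (hτ : S.card = hironakaTau k {homogeneousComponent ν f})
    (hFS : ∀ d ∈ (homogeneousComponent ν f).support, ∀ j ∉ S, d j = 0)
    (hprep : IsDeltaPrepared S ν f) {δ : ℚ} (hδ : hironakaDelta S ν f = δ)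
    {Ψ : MvPolynomial (Fin n) k ≃ₐ[k] MvPolynomial (Fin n) k} (hΨ : ∀ i, constantCoeff (Ψ (X i)) = 0) :
    hironakaDelta S ν (Ψ.symm f) ≤ (δ : WithTop ℚ) := by
  classical
  have hν : 0 < ν := nu_pos_of_hironakaDelta_eq hδ
  have hδ1 : 1 < δ := one_lt_hironakaDelta hord hFS hδ
  by_contra hlt
  push Not at hlt
  -- a rational `c` with `δ < c ≤ δ(Ψ.symm f)`
  obtain ⟨c, hδc, hcle⟩ : ∃ c : ℚ, δ < c ∧ (c : WithTop ℚ) ≤ hironakaDelta S ν (Ψ.symm f) := by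
    by_cases htop : hironakaDelta S ν (Ψ.symm f) = ⊤
    · exact ⟨δ + 1, by linarith, by rw [htop]; exact le_top⟩
    · obtain ⟨δ', hδ'⟩ := WithTop.ne_top_iff_exists.mp htop
      rw [← hδ'] at hlt
      exact ⟨δ', WithTop.coe_lt_coe.mp hlt, by rw [← hδ']⟩
  have hcpos : 0 < c := (one_pos.trans hδ1).trans hδc
  exact not_isCentreFor_blockWeights_of_isDeltaPrepared hord hτ hFS hprep hδ hδc Ψ
    ((isCentreFor_blockWeights_iff f Ψ S hν hcpos).mpr ⟨hΨ, hcle⟩)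

/-- **Invariance of the prepared `δ`.** If both `(f; X_S; X_{Sᶜ})` and `(Ψ⁻¹ f; X_S; X_{Sᶜ})`
(`Ψ` origin-fixing) satisfy the standing hypotheses and are `δ`-prepared, their `δ`-invariants agree:
the prepared value `δ(f; u; y)` does not depend on the (polynomial) choice of `(y, u)`. (Ours, in the
model; two applications of `hironakaDelta_symm_le_of_isDeltaPrepared`.)
[cite: CossartJannsenSaito2020, App. Def. 18.34 and the remark following it (p. 208) ("δ(J, u) is an invariant of the singularity …, see [CJSc, Corollary B(3)]"), Thm. 8.16 (p. 121); Hironaka1967, Thm. (4.8)] -/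
theorem hironakaDelta_symm_eq_of_isDeltaPrepared
    (hord : monomialOrd (fun _ => 1) f = ν)
    (hτ : S.card = hironakaTau k {homogeneousComponent ν f})
    (hFS : ∀ d ∈ (homogeneousComponent ν f).support, ∀ j ∉ S, d j = 0)
    (hprep : IsDeltaPrepared S ν f) {δ : ℚ} (hδ : hironakaDelta S ν f = δ)
    {Ψ : MvPolynomial (Fin n) k ≃ₐ[k] MvPolynomial (Fin n) k} (hΨ : ∀ i, constantCoeff (Ψ (X i)) = 0)
    (hτ' : S.card = hironakaTau k {homogeneousComponent ν (Ψ.symm f)})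
    (hFS' : ∀ d ∈ (homogeneousComponent ν (Ψ.symm f)).support, ∀ j ∉ S, d j = 0)
    (hprep' : IsDeltaPrepared S ν (Ψ.symm f)) {δ' : ℚ} (hδ' : hironakaDelta S ν (Ψ.symm f) = δ') :
    δ' = δ := by
  have h1 : (δ' : WithTop ℚ) ≤ δ := hδ' ▸ hironakaDelta_symm_le_of_isDeltaPrepared hord hτ hFS hprep hδ hΨ
  have hord' : monomialOrd (fun _ => 1) (Ψ.symm f) = ν := by rw [monomialOrd_one_symm_eq Ψ hΨ f, hord]
  have h2 := hironakaDelta_symm_le_of_isDeltaPrepared hord' hτ' hFS' hprep' hδ' (Ψ := Ψ.symm)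
    (constantCoeff_symm_X_eq_zero hΨ)
  rw [AlgEquiv.symm_symm, AlgEquiv.apply_symm_apply, hδ] at h2
  exact le_antisymm (by exact_mod_cast h1) (by exact_mod_cast h2)

end Main

/-! ## §9 The count at stage 1: `τ(in_δ f) ≤ |S| + #{j ∉ S : γ_j = 1/(νδ)}` -/

section Count

variable {f : MvPolynomial (Fin n) k} {ν : ℕ} {S : Finset (Fin n)}

/-- **The `δ`-initial form** `in_δ(f) = in_0(f) + Σ_{|B| < ν, |A| = δ(ν − |B|)} c_{A,B} Y^B U^A`
of `f` with respect to `(y, u) = (X_S, X_{Sᶜ})`, `ν = n_(u)(f)`: the initial form along the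
`δ`-face `E_{L_0}`, `L_0 = |·|` — in the weighted-centre language, the part of `f` of value exactly
`1` for the block centre `(y^ν, u^{νδ})`.
[cite: CossartJannsenSaito2020, Def. 8.2 (4) (p. 118) ("in_{E_L}(g) = in_0(g) + Σ … ; when E_L is the δ-face … we write in_δ(g) for in_{E_L}(g)"), Def. 8.1 (3) (p. 117) (the δ-face E_{L_0})] -/
def deltaInitial (S : Finset (Fin n)) (ν : ℕ) (δ : ℚ) (f : MvPolynomial (Fin n) k) :
    MvPolynomial (Fin n) k :=
  ∑ d ∈ f.support with (blockDeg S d ≤ ν ∧ (coDeg S d : ℚ) = δ * ((ν - blockDeg S d : ℕ) : ℚ)),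
    monomial d (coeff d f)

/-- The `u`-linear part of a coordinate function `P = z_j` as a linear functional on `k^n`:
`ℓ_P(c) = Σ_{l ∉ S} (∂P/∂X_l)(0)·c_l` — the class of `z_j` in `gr¹` modulo the `y`-coordinates.
Plumbing for the subspaces `T ⊆ gr¹` of [CJS20 Thm. 8.16 (∗)] attached to a competitor centre.
[cite: CossartJannsenSaito2020, Thm. 8.16, condition (∗) (p. 121) (subspaces T ⊆ gr¹ and k[T]); CossartPiltant2008, §1 (k[T] = Sym(T) ⊆ gr_𝔪 R)] -/
def uLinearForm (S : Finset (Fin n)) (P : MvPolynomial (Fin n) k) : Module.Dual k (Fin n → k) :=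
  ∑ l ∈ Finset.univ.filter (fun l => l ∉ S),
    coeff (Finsupp.single l 1) P • (LinearMap.proj l : Module.Dual k (Fin n → k))

/-- `ℓ_P(c) = Σ_{l ∉ S} P_{e_l} c_l`. [folklore] -/
private theorem uLinearForm_apply (P : MvPolynomial (Fin n) k) (c : Fin n → k) :
    uLinearForm S P c = ∑ l ∈ Finset.univ.filter (fun l => l ∉ S), coeff (Finsupp.single l 1) P * c l := by
  simp [uLinearForm, LinearMap.sum_apply]

/-- `ℓ_P(e_i) = P_{e_i}` for `i ∉ S`, `0` for `i ∈ S`. [folklore] -/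
private theorem uLinearForm_apply_single (P : MvPolynomial (Fin n) k) (i : Fin n) :
    uLinearForm S P (Pi.single i 1) = if i ∉ S then coeff (Finsupp.single i 1) P else 0 := by
  classical
  rw [uLinearForm_apply]
  by_cases hi : i ∉ S
  · rw [if_pos hi, Finset.sum_eq_single_of_mem i (Finset.mem_filter.mpr ⟨Finset.mem_univ _, hi⟩)
      (fun l _ hli => by simp [hli])]
    simp
  · rw [if_neg hi]
    exact Finset.sum_eq_zero fun l hl => by
      have hli : l ≠ i := by rintro rfl; exact (Finset.mem_filter.mp hl).2 |> hi
      simp [hli]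

/-- The polynomial of `ℓ_P` is the `u`-linear part `Σ_{l ∉ S} P_{e_l} X_l` of `P`.
[cite: CossartPiltant2008, §1 (linear forms T ↦ k[T] = Sym(T)); CossartJannsenSaito2020, Thm. 8.16 (∗) (p. 121)] -/
theorem linearFormPoly_uLinearForm (P : MvPolynomial (Fin n) k) :
    linearFormPoly k (uLinearForm S P) =
      ∑ l ∈ Finset.univ.filter (fun l => l ∉ S), C (coeff (Finsupp.single l 1) P) * X l := by
  classical
  rw [linearFormPoly, Finset.sum_filter]
  refine Finset.sum_congr rfl fun i _ => ?_
  rw [uLinearForm_apply_single]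
  split_ifs <;> simp

/-- Coefficients of a linear combination of variables. [folklore] -/
private theorem coeff_sum_C_mul_X (T : Finset (Fin n)) (a : Fin n → k) (d : Fin n →₀ ℕ) :
    coeff d (∑ l ∈ T, C (a l) * X l) =
      if h : ∃ l ∈ T, d = Finsupp.single l 1 then a h.choose else 0 := by
  classical
  rw [coeff_sum]
  simp_rw [coeff_C_mul, coeff_X]
  split_ifs with h
  · obtain ⟨hl, hd⟩ := h.choose_spec
    rw [Finset.sum_eq_single_of_mem _ hl]
    · rw [if_pos hd.symm, mul_one]
    · intro l' _ hne
      rw [if_neg, mul_zero]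
      intro he
      apply hne
      exact Finsupp.single_left_injective one_ne_zero (he.trans hd)
  · push Not at h
    exact Finset.sum_eq_zero fun l hl => by
      rw [if_neg (fun he => h l hl he.symm), mul_zero]

/-- For integer block weights `w = (p on S, q off S)` with `p = δq`: `w(Y^B U^A) = νp` iff
`|B| ≤ ν` and `|A| = δ(ν − |B|)`, i.e. iff `Y^B U^A` is a monomial of the `δ`-face. [folklore] -/
private theorem weight_block_eq_iff {p q : ℕ} (hp : 0 < p) (hq : 0 < q) {δ : ℚ} (hpq : (p : ℚ) = δ * q)
    (d : Fin n →₀ ℕ) :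
    weight (fun i => if i ∈ S then p else q) d = ν * p ↔
      blockDeg S d ≤ ν ∧ (coDeg S d : ℚ) = δ * ((ν - blockDeg S d : ℕ) : ℚ) := by
  rw [weight_block]
  have hqq : (q : ℚ) ≠ 0 := by exact_mod_cast hq.ne'
  constructor
  · intro h
    have hb : blockDeg S d ≤ ν := by
      have h1 : p * blockDeg S d ≤ p * ν := by rw [Nat.mul_comm p ν]; omega
      exact Nat.le_of_mul_le_mul_left h1 hp
    refine ⟨hb, ?_⟩
    have h2 : q * coDeg S d = p * (ν - blockDeg S d) := by
      rw [Nat.mul_sub, Nat.mul_comm p ν]; omega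
    have h3 : (q : ℚ) * coDeg S d = p * ((ν - blockDeg S d : ℕ) : ℚ) := by exact_mod_cast h2
    rw [hpq] at h3
    have : (q : ℚ) * (coDeg S d : ℚ) = q * (δ * ((ν - blockDeg S d : ℕ) : ℚ)) := by rw [h3]; ring
    exact mul_left_cancel₀ hqq this
  · rintro ⟨hb, hc⟩
    have h3 : (q : ℚ) * coDeg S d = p * ((ν - blockDeg S d : ℕ) : ℚ) := by rw [hc, hpq]; ring
    have h2 : q * coDeg S d = p * (ν - blockDeg S d) := by exact_mod_cast h3
    rw [Nat.mul_sub] at h2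
    have h4 : p * blockDeg S d ≤ p * ν := Nat.mul_le_mul_left p hb
    rw [Nat.mul_comm ν p]; omega

/-- `in_δ(f)` is the weight-`νp` component of `f` for the integer block weights `(p on S, q off S)`,
`δ = p/q` (the weighted-centre reading of the `δ`-face). (Ours, in the model.)
[cite: CossartJannsenSaito2020, Def. 8.2 (4) (p. 118), Def. 8.1 (3) (p. 117)] -/
theorem deltaInitial_eq_weightedHomogeneousComponent {p q : ℕ} (hp : 0 < p) (hq : 0 < q) {δ : ℚ}
    (hpq : (p : ℚ) = δ * q) (f : MvPolynomial (Fin n) k) :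
    deltaInitial S ν δ f = weightedHomogeneousComponent (fun i => if i ∈ S then p else q) (ν * p) f := by
  classical
  ext d
  rw [deltaInitial, coeff_sum_filter_monomial, coeff_weightedHomogeneousComponent]
  by_cases hc : weight (fun i => if i ∈ S then p else q) d = ν * p
  · rw [if_pos hc, if_pos ((weight_block_eq_iff hp hq hpq d).mp hc)]
  · rw [if_neg hc, if_neg (mt (weight_block_eq_iff hp hq hpq d).mpr hc)]

/-- For the block weights `(p on S, q off S)` with `q < p`, the weight-`q` part of a polynomial is
its `u`-linear part: `in_w(z_j) = ℓ_j(u)` for a `u`-coordinate `z_j` of a competitor. (Ours,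
elementary.) [cite: CossartJannsenSaito2020, Thm. 8.16 (∗) (p. 121); CossartPiltant2008, §1] -/
theorem weightedHomogeneousComponent_low_eq {p q : ℕ} (hqp : q < p) (hq : 0 < q)
    (P : MvPolynomial (Fin n) k) :
    weightedHomogeneousComponent (fun i => if i ∈ S then p else q) q P =
      linearFormPoly k (uLinearForm S P) := by
  classical
  have key : ∀ d : Fin n →₀ ℕ, weight (fun i => if i ∈ S then p else q) d = q ↔
      ∃ l ∈ Finset.univ.filter (fun l => l ∉ S), d = Finsupp.single l 1 := by
    intro d
    rw [weight_block]
    constructor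
    · intro h
      have hb : blockDeg S d = 0 := by
        rcases Nat.eq_zero_or_pos (blockDeg S d) with h0 | h0
        · exact h0
        · exfalso
          have : p ≤ p * blockDeg S d := Nat.le_mul_of_pos_right p h0
          omega
      rw [hb, mul_zero, zero_add] at h
      have hc : coDeg S d = 1 := Nat.eq_of_mul_eq_mul_left hq (by rw [h, mul_one])
      have hdeg : d.degree = 1 := by rw [degree_eq_blockDeg_add_coDeg S, hb, hc]
      obtain ⟨l, rfl⟩ := eq_single_of_degree_eq_one hdeg
      refine ⟨l, Finset.mem_filter.mpr ⟨Finset.mem_univ _, fun hl => ?_⟩, rfl⟩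
      rw [blockDeg_single, if_pos hl] at hb
      exact one_ne_zero hb
    · rintro ⟨l, hl, rfl⟩
      have hlS : l ∉ S := (Finset.mem_filter.mp hl).2
      have hb : blockDeg S (Finsupp.single l 1) = 0 := by rw [blockDeg_single, if_neg hlS]
      have hdeg : (Finsupp.single l 1 : Fin n →₀ ℕ).degree = 1 := by simp
      rw [degree_eq_blockDeg_add_coDeg S, hb, zero_add] at hdeg
      rw [hb, hdeg]; ring
  ext d
  rw [coeff_weightedHomogeneousComponent, linearFormPoly_uLinearForm, coeff_sum_C_mul_X]
  by_cases h : ∃ l ∈ Finset.univ.filter (fun l => l ∉ S), d = Finsupp.single l 1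
  · rw [dif_pos h, if_pos ((key d).mpr h)]
    have := h.choose_spec.2
    conv_lhs => rw [this]
  · rw [dif_neg h, if_neg (mt (key d).mp h)]

/-- The pure-`u` part of degree exactly `δ` of `P`: `Φ = Σ_{|A| = δ} P_{A,0} U^A` (zero unless
`δ ∈ ℕ`) — for a `y'`-coordinate `z_i = Ψ(X_i)` of a competitor this is the candidate "solution"
`λ_i(U)` of a coordinate change `Y_i ↦ Y_i + λ_i(U)` at a vertex `v` with `|v| = δ`.
[cite: CossartJannsenSaito2020, Def. 8.13 (pp. 120–121) ("solvable at v … λ_1, …, λ_r ∈ k[U] such that in_v(f_i) = F_i(Y + λ)"), Thm. 8.22 (a) (p. 124)] -/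
def uHomogeneousPart (S : Finset (Fin n)) (δ : ℚ) (P : MvPolynomial (Fin n) k) :
    MvPolynomial (Fin n) k :=
  ∑ d ∈ P.support with (blockDeg S d = 0 ∧ (d.degree : ℚ) = δ), monomial d (coeff d P)

/-- No pure-`u` monomial of degree `δ` ⇒ `Φ = 0`. [folklore] -/
private theorem uHomogeneousPart_eq_zero_of_forall_ne {δ : ℚ} {P : MvPolynomial (Fin n) k}
    (hne : ∀ d ∈ P.support, blockDeg S d = 0 → (d.degree : ℚ) ≠ δ) :
    uHomogeneousPart S δ P = 0 :=
  Finset.sum_eq_zero fun d hd => by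
    obtain ⟨hd, hb, hdeg⟩ := Finset.mem_filter.mp hd
    exact (hne d hd hb hdeg).elim

/-- For the block weights `(p on S, q off S)` with `q < p = δq`, the weight-`p` part of a polynomial
is its `S`-linear part plus its pure-`u` part of degree `δ`: `in_w(z_i) = Σ_{l ∈ S} (z_i)_{e_l} X_l + Φ_i`
for a `y'`-coordinate `z_i` of a competitor. (Ours, elementary.)
[cite: CossartJannsenSaito2020, Def. 8.13 (pp. 120–121), Thm. 8.16 (∗) (p. 121)] -/
theorem weightedHomogeneousComponent_high_eq {p q : ℕ} (hqp : q < p) (hq : 0 < q) {δ : ℚ}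
    (hpq : (p : ℚ) = δ * q) (P : MvPolynomial (Fin n) k) :
    weightedHomogeneousComponent (fun i => if i ∈ S then p else q) p P =
      (∑ l ∈ S, C (coeff (Finsupp.single l 1) P) * X l) + uHomogeneousPart S δ P := by
  classical
  have hqq : (q : ℚ) ≠ 0 := by exact_mod_cast hq.ne'
  have key : ∀ d : Fin n →₀ ℕ, weight (fun i => if i ∈ S then p else q) d = p ↔
      (∃ l ∈ S, d = Finsupp.single l 1) ∨ (blockDeg S d = 0 ∧ (d.degree : ℚ) = δ) := by
    intro d
    rw [weight_block]
    constructor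
    · intro h
      rcases Nat.eq_zero_or_pos (blockDeg S d) with h0 | h0
      · right
        refine ⟨h0, ?_⟩
        rw [h0, mul_zero, zero_add] at h
        rw [degree_eq_blockDeg_add_coDeg S, h0, zero_add]
        have h1 : (q : ℚ) * coDeg S d = δ * q := by rw [← hpq]; exact_mod_cast h
        have : (q : ℚ) * (coDeg S d : ℚ) = q * δ := by rw [h1, mul_comm]
        exact mul_left_cancel₀ hqq this
      · left
        have h1 : p ≤ p * blockDeg S d := Nat.le_mul_of_pos_right p h0
        have hc : coDeg S d = 0 := by
          rcases Nat.eq_zero_or_pos (coDeg S d) with hc | hc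
          · exact hc
          · exfalso; have : q ≤ q * coDeg S d := Nat.le_mul_of_pos_right q hc; omega
        have hb : blockDeg S d = 1 := by
          have h2 : p * blockDeg S d = p * 1 := by rw [mul_one]; omega
          exact Nat.eq_of_mul_eq_mul_left (by omega) h2
        have hdeg : d.degree = 1 := by rw [degree_eq_blockDeg_add_coDeg S, hb, hc]
        obtain ⟨l, rfl⟩ := eq_single_of_degree_eq_one hdeg
        refine ⟨l, ?_, rfl⟩
        by_contra hl
        rw [blockDeg_single, if_neg hl] at hb
        exact zero_ne_one hb
    · rintro (⟨l, hl, rfl⟩ | ⟨hb, hdeg⟩)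
      · have hb : blockDeg S (Finsupp.single l 1) = 1 := by rw [blockDeg_single, if_pos hl]
        have hdeg : (Finsupp.single l 1 : Fin n →₀ ℕ).degree = 1 := by simp
        rw [degree_eq_blockDeg_add_coDeg S, hb] at hdeg
        have hc : coDeg S (Finsupp.single l 1) = 0 := by omega
        rw [hb, hc]; ring
      · rw [degree_eq_blockDeg_add_coDeg S, hb, zero_add] at hdeg
        have h1 : (q : ℚ) * coDeg S d = p := by rw [hdeg, hpq, mul_comm]
        have h2 : q * coDeg S d = p := by exact_mod_cast h1
        rw [hb, mul_zero, zero_add, h2]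
  ext d
  rw [coeff_weightedHomogeneousComponent, coeff_add, coeff_sum_C_mul_X, uHomogeneousPart,
    coeff_sum_filter_monomial]
  by_cases h1 : ∃ l ∈ S, d = Finsupp.single l 1
  · have h2 : ¬ (blockDeg S d = 0 ∧ (d.degree : ℚ) = δ) := by
      obtain ⟨l, hl, rfl⟩ := h1
      rw [blockDeg_single, if_pos hl]
      simp
    rw [dif_pos h1, if_neg h2, if_pos ((key d).mpr (Or.inl h1)), add_zero]
    have := h1.choose_spec.2
    conv_lhs => rw [this]
  · rw [dif_neg h1, zero_add]
    by_cases h2 : blockDeg S d = 0 ∧ (d.degree : ℚ) = δ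
    · rw [if_pos h2, if_pos ((key d).mpr (Or.inr h2))]
    · rw [if_neg h2, if_neg]
      intro hw
      rcases (key d).mp hw with h | h
      · exact h1 h
      · exact h2 h

/-- **`in_δ(f)` read through a competitor centre.** Let `(f; X_S; X_{Sᶜ})` be `δ`-prepared,
`δ = δ(f;u;y) = p/q`, and let `(Ψ; γ)` be a centre for `f` in the prefix class: `γ_i = 1/ν` on `S`,
`γ_j ≤ 1/(νδ)` off `S`. With `w = (p on S, q off S)`, `z = Ψ(X)`, `g = Ψ⁻¹ f`:
(1) `in_δ(f) = (in_w g)(in_w z_1, …, in_w z_n)` (Lemma G, `weightedHomogeneousComponent_map_of_le_monomialOrd`);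
(2) `in_w g ∈ k[X_S, X_j : γ_j = 1/(νδ)]` (admissibility of `γ ≤` the block weights, strict off these);
(3) the `y'`-block `z_S` has no `u`-linear terms (`coeff_single_eq_zero_of_isCentreFor`) and
(4) no pure-`u` monomials of degree `< δ` (case (b) of the vertex theorem, `caseB_false` with `c = δ`).
(Ours, in the model.) [cite: CossartJannsenSaito2020, Thm. 8.16 (p. 121), Def. 8.2 (4) (p. 118), Thm. 8.22 (a) (p. 124); Hironaka1967, Thm. (4.8)] -/
theorem deltaInitial_eq_aeval_of_isCentreFor (hord : monomialOrd (fun _ => 1) f = ν)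
    (hτ : S.card = hironakaTau k {homogeneousComponent ν f})
    (hFS : ∀ d ∈ (homogeneousComponent ν f).support, ∀ j ∉ S, d j = 0)
    (hprep : IsDeltaPrepared S ν f) {δ : ℚ} (hδ : hironakaDelta S ν f = δ)
    {p q : ℕ} (hq : 0 < q) (hpq : (p : ℚ) = δ * q)
    {Ψ : MvPolynomial (Fin n) k ≃ₐ[k] MvPolynomial (Fin n) k} {γ : Fin n → ℚ}
    (h : IsCentreFor f Ψ γ) (hγS : ∀ i ∈ S, γ i = (ν : ℚ)⁻¹)
    (hγle : ∀ j ∉ S, γ j ≤ ((ν : ℚ) * δ)⁻¹) :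
    (deltaInitial S ν δ f =
      aeval (fun i => weightedHomogeneousComponent (fun j => if j ∈ S then p else q)
          (if i ∈ S then p else q) (Ψ (X i)))
        (weightedHomogeneousComponent (fun i => if i ∈ S then p else q) (ν * p) (Ψ.symm f))) ∧
    (∀ d ∈ (weightedHomogeneousComponent (fun i => if i ∈ S then p else q) (ν * p) (Ψ.symm f)).support,
      ∀ j ∉ S, γ j ≠ ((ν : ℚ) * δ)⁻¹ → d j = 0) ∧
    (∀ i ∈ S, ∀ j ∉ S, coeff (Finsupp.single j 1) (Ψ (X i)) = 0) ∧
    (∀ i ∈ S, ∀ d ∈ (Ψ (X i)).support, blockDeg S d = 0 → δ ≤ d.degree) := by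
  classical
  have hΨ := h.1
  have hadm := h.2.2
  set g := Ψ.symm f with hg
  have hfg : Ψ g = f := Ψ.apply_symm_apply f
  have hν : 0 < ν := nu_pos_of_hironakaDelta_eq hδ
  have hνq : (0 : ℚ) < ν := by exact_mod_cast hν
  have hδ1 : 1 < δ := one_lt_hironakaDelta hord hFS hδ
  have hδpos : 0 < δ := one_pos.trans hδ1
  have hqq : (0 : ℚ) < q := by exact_mod_cast hq
  have hp : 0 < p := by
    have : (0 : ℚ) < p := by rw [hpq]; positivity
    exact_mod_cast this
  have hqp : q < p := by
    have : (q : ℚ) < p := by rw [hpq]; nlinarith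
    exact_mod_cast this
  set w : Fin n → ℕ := fun i => if i ∈ S then p else q with hw
  -- the centre dominates the block centre `(y^ν, u^{νδ})`
  have hle : ∀ i, γ i ≤ blockWeights S ν δ i := by
    intro i
    by_cases hi : i ∈ S
    · simp [blockWeights, hi, hγS i hi]
    · simp only [blockWeights, hi, if_false]; exact hγle i hi
  have h' : IsCentreFor f Ψ (blockWeights S ν δ) := h.mono hle
  have hlin : ∀ i ∈ S, ∀ j ∉ S, coeff (Finsupp.single j 1) (Ψ (X i)) = 0 := fun i hi j hj =>
    coeff_single_eq_zero_of_isCentreFor hord hν hτ hFS hδ hδ1 h' hi hj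
  -- (4): no pure-`u` monomials of degree `< δ` in the `y'`-block (case (b))
  have hpure : ∀ i ∈ S, ∀ d ∈ (Ψ (X i)).support, blockDeg S d = 0 → δ ≤ d.degree := by
    by_contra hne
    push Not at hne
    obtain ⟨i, hi, d, hd, hb, hdδ⟩ := hne
    have hP : ∃ m, ∃ i ∈ S, ∃ d ∈ (Ψ (X i)).support, blockDeg S d = 0 ∧ d.degree = m :=
      ⟨d.degree, i, hi, d, hd, hb, rfl⟩
    obtain ⟨i₀, hi₀, A₁, hA₁, hA₁b, hA₁deg⟩ := Nat.find_spec hP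
    have hmin : ∀ i ∈ S, ∀ d ∈ (Ψ (X i)).support, blockDeg S d = 0 → Nat.find hP ≤ d.degree :=
      fun i hi d hd hb => Nat.find_min' hP ⟨i, hi, d, hd, hb, rfl⟩
    have hlt : ((Nat.find hP : ℕ) : ℚ) < δ := lt_of_le_of_lt (by exact_mod_cast hmin i hi d hd hb) hdδ
    exact caseB_false hord hν hτ hFS hprep hδ hδ1 h' hlt.le hlt hmin hi₀ hA₁ hA₁b hA₁deg
  -- domination of the integer weights
  have hdom : ∀ i, (w i : ℕ∞) ≤ monomialOrd w (Ψ (X i)) := by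
    refine blockWeights_le_monomialOrd hqp.le hΨ fun i hi d hd hb => ?_
    have h1 : δ ≤ (d.degree : ℚ) := hpure i hi d hd hb
    have : (p : ℚ) ≤ q * d.degree := by rw [hpq, mul_comm]; exact mul_le_mul_of_nonneg_left h1 hqq.le
    exact_mod_cast this
  have hwγ : ∀ i, (w i : ℚ) = ((ν * p : ℕ) : ℚ) * blockWeights S ν δ i := by
    intro i
    have hνq' : (ν : ℚ) ≠ 0 := hνq.ne'
    by_cases hi : i ∈ S
    · simp only [hw, blockWeights, hi, if_true, Nat.cast_mul]
      field_simp
    · simp only [hw, blockWeights, hi, if_false, Nat.cast_mul, hpq]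
      have : (δ : ℚ) ≠ 0 := hδpos.ne'
      field_simp
  have hN : ((ν * p : ℕ) : ℕ∞) ≤ monomialOrd w g :=
    (isAdmissibleFor_iff_le_monomialOrd (blockWeights S ν δ) w (Nat.mul_pos hν hp) hwγ g).mp h'.2.2
  have hS := weightedHomogeneousComponent_map_of_le_monomialOrd w
    (Ψ : MvPolynomial (Fin n) k →ₐ[k] MvPolynomial (Fin n) k) hdom g hN
  simp only [AlgEquiv.coe_toAlgHom, hfg] at hS
  refine ⟨?_, ?_, hlin, hpure⟩
  · -- (1)
    rw [deltaInitial_eq_weightedHomogeneousComponent hp hq hpq]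
    exact hS
  · -- (2)
    intro d hd j hj hγj
    rw [mem_support_iff, coeff_weightedHomogeneousComponent] at hd
    have hwd : weight w d = ν * p := by by_contra hne; exact hd (if_neg hne)
    rw [if_pos hwd] at hd
    have hdg : d ∈ g.support := mem_support_iff.mpr hd
    have hγj' : γ j < blockWeights S ν δ j := lt_of_le_of_ne (hle j) (by
      simp only [blockWeights, hj, if_false]; exact hγj)
    by_contra hdj
    have hdj' : 0 < d j := Nat.pos_of_ne_zero hdj
    -- `v_γ(d) < v_W(d) = 1`
    have h1 : (1 : ℚ) ≤ monomialValuation γ d := hadm d hdg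
    have h2 : monomialValuation γ d < monomialValuation (blockWeights S ν δ) d := by
      rw [monomialValuation_eq_sum_univ, monomialValuation_eq_sum_univ]
      exact Finset.sum_lt_sum (fun i _ => mul_le_mul_of_nonneg_left (hle i) (Nat.cast_nonneg _))
        ⟨j, Finset.mem_univ _, mul_lt_mul_of_pos_left hγj' (by exact_mod_cast hdj')⟩
    have h3 : monomialValuation (blockWeights S ν δ) d = 1 := by
      have hNq : ((ν * p : ℕ) : ℚ) ≠ 0 := by exact_mod_cast (Nat.mul_pos hν hp).ne'
      have h4 : ((ν * p : ℕ) : ℚ) * monomialValuation (blockWeights S ν δ) d = (weight w d : ℚ) := by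
        rw [monomialValuation_eq_sum_univ, Finset.mul_sum, Finsupp.weight_apply,
          Finsupp.sum_fintype _ _ (fun _ => by simp)]
        push_cast
        exact Finset.sum_congr rfl fun i _ => by rw [smul_eq_mul, Nat.cast_mul, hwγ i]; push_cast; ring
      rw [hwd] at h4
      have : ((ν * p : ℕ) : ℚ) * monomialValuation (blockWeights S ν δ) d = ((ν * p : ℕ) : ℚ) * 1 := by
        rw [h4, mul_one]
      exact mul_left_cancel₀ hNq this
    linarith

/-- The linear form a competitor `Ψ` attaches to the coordinate `i`: the coordinate function `X_i`
for `i ∈ S` (the `y`-block is rigid in `gr¹` by `coeff_single_eq_zero_of_isCentreFor`), the `u`-linear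
part `ℓ_i` of `z_i = Ψ(X_i)` for `i ∉ S`.
[cite: CossartJannsenSaito2020, Thm. 8.16, condition (∗) (p. 121); AbramovichTemkinWlodarczyk2024, §5.1 (p. 1577) (centres (x_1^{a_1}, …, x_k^{a_k}) in a system of coordinates)] -/
def competitorForm (S : Finset (Fin n)) (Ψ : MvPolynomial (Fin n) k ≃ₐ[k] MvPolynomial (Fin n) k)
    (i : Fin n) : Module.Dual k (Fin n → k) :=
  if i ∈ S then LinearMap.proj i else uLinearForm S (Ψ (X i))

/-- **`T(Ψ, γ)`**: the space of linear forms `⟨X_i (i ∈ S), ℓ_j (j ∉ S, γ_j = 1/(νδ))⟩ ⊆ gr¹`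
spanned by the initial forms of the competitor's coordinates of value `≥ 1/(νδ)`.
[cite: CossartJannsenSaito2020, Thm. 8.16, condition (∗) (p. 121) (subspaces T ⊆ gr¹_𝔪 and k[T]); AbramovichTemkinWlodarczyk2024, Thm. 5.3.1 (p. 1578); CossartPiltant2008, §1] -/
def competitorSpan (S : Finset (Fin n)) (ν : ℕ) (δ : ℚ)
    (Ψ : MvPolynomial (Fin n) k ≃ₐ[k] MvPolynomial (Fin n) k) (γ : Fin n → ℚ) :
    Submodule k (Module.Dual k (Fin n → k)) :=
  Submodule.span k (Set.range fun i :
    ↥(S ∪ Finset.univ.filter (fun j => j ∉ S ∧ γ j = ((ν : ℚ) * δ)⁻¹)) =>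
      competitorForm S Ψ (i : Fin n))

/-- `dim T(Ψ, γ) ≤ |S| + #{j ∉ S : γ_j = 1/(νδ)}`. (Elementary.)
[cite: CossartJannsenSaito2020, Thm. 8.16 (∗) (p. 121); AbramovichTemkinWlodarczyk2024, Thm. 5.3.1 (p. 1578)] -/
theorem finrank_competitorSpan_le (S : Finset (Fin n)) (ν : ℕ) (δ : ℚ)
    (Ψ : MvPolynomial (Fin n) k ≃ₐ[k] MvPolynomial (Fin n) k) (γ : Fin n → ℚ) :
    Module.finrank k (competitorSpan S ν δ Ψ γ) ≤
      S.card + (Finset.univ.filter (fun j => j ∉ S ∧ γ j = ((ν : ℚ) * δ)⁻¹)).card := by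
  classical
  refine (finrank_range_le_card (R := k) _).trans ?_
  rw [Fintype.card_coe]
  exact Finset.card_union_le _ _

/-- For `i ∈ S` the attached form is `X_i`. [folklore] -/
private theorem linearFormPoly_competitorForm_of_mem {Ψ : MvPolynomial (Fin n) k ≃ₐ[k] MvPolynomial (Fin n) k}
    {i : Fin n} (hi : i ∈ S) : linearFormPoly k (competitorForm S Ψ i) = X i := by
  rw [competitorForm, if_pos hi, linearFormPoly_proj]

/-- For `i ∉ S` the attached form is `ℓ_i`. [folklore] -/
private theorem linearFormPoly_competitorForm_of_not_mem
    {Ψ : MvPolynomial (Fin n) k ≃ₐ[k] MvPolynomial (Fin n) k} {i : Fin n} (hi : i ∉ S) :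
    linearFormPoly k (competitorForm S Ψ i) = linearFormPoly k (uLinearForm S (Ψ (X i))) := by
  rw [competitorForm, if_neg hi]

/-- The attached forms lie in `k[T(Ψ, γ)]`. [folklore] -/
private theorem linearFormPoly_competitorForm_mem {δ : ℚ}
    {Ψ : MvPolynomial (Fin n) k ≃ₐ[k] MvPolynomial (Fin n) k} {γ : Fin n → ℚ} {i : Fin n}
    (hi : i ∈ S ∪ Finset.univ.filter (fun j => j ∉ S ∧ γ j = ((ν : ℚ) * δ)⁻¹)) :
    linearFormPoly k (competitorForm S Ψ i) ∈ linearFormsSubalgebra k (competitorSpan S ν δ Ψ γ) :=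
  Algebra.subset_adjoin ⟨competitorForm S Ψ i, Submodule.subset_span ⟨⟨i, hi⟩, rfl⟩, rfl⟩

/-- `X_i ∈ k[T(Ψ, γ)]` for `i ∈ S`. [folklore] -/
private theorem X_mem_linearFormsSubalgebra_competitorSpan {δ : ℚ}
    {Ψ : MvPolynomial (Fin n) k ≃ₐ[k] MvPolynomial (Fin n) k} {γ : Fin n → ℚ} {i : Fin n}
    (hi : i ∈ S) : (X i : MvPolynomial (Fin n) k) ∈ linearFormsSubalgebra k (competitorSpan S ν δ Ψ γ) := by
  rw [← linearFormPoly_competitorForm_of_mem (Ψ := Ψ) hi]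
  exact linearFormPoly_competitorForm_mem (Finset.mem_union_left _ hi)

/-- `ℓ_j ∈ k[T(Ψ, γ)]` for `j ∉ S` with `γ_j = 1/(νδ)`. [folklore] -/
private theorem uLinearForm_mem_linearFormsSubalgebra_competitorSpan {δ : ℚ}
    {Ψ : MvPolynomial (Fin n) k ≃ₐ[k] MvPolynomial (Fin n) k} {γ : Fin n → ℚ} {j : Fin n}
    (hj : j ∉ S) (hγj : γ j = ((ν : ℚ) * δ)⁻¹) :
    linearFormPoly k (uLinearForm S (Ψ (X j))) ∈ linearFormsSubalgebra k (competitorSpan S ν δ Ψ γ) := by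
  rw [← linearFormPoly_competitorForm_of_not_mem hj]
  exact linearFormPoly_competitorForm_mem
    (Finset.mem_union_right _ (Finset.mem_filter.mpr ⟨Finset.mem_univ _, hj, hγj⟩))

/-- A positive rational as `p/q` with its canonical numerator and denominator. [folklore] -/
private theorem exists_eq_mul_den {δ : ℚ} (hδ : 0 < δ) : ∃ p q : ℕ, 0 < q ∧ (p : ℚ) = δ * q := by
  obtain ⟨p, hp⟩ := Int.eq_ofNat_of_zero_le (Rat.num_nonneg.mpr hδ.le)
  refine ⟨p, δ.den, δ.den_pos, ?_⟩
  rw [Rat.mul_den_eq_num δ, hp]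
  simp

/-- **Structure of `in_δ(f)` under a competitor centre.** Let `(f; X_S; X_{Sᶜ})` be `δ`-prepared
and `(Ψ; γ)` a centre for `f` with `γ = 1/ν` on `S`, `γ ≤ 1/(νδ)` off `S`. If the pure-`u` degree-`δ`
parts `Φ_i` of the `y'`-coordinates `z_i = Ψ(X_i)`, `i ∈ S`, lie in `k[T(Ψ, γ)]` (automatic when
`δ ∉ ℕ`; for `τ = 1` see `uHomogeneousPart_mem_linearFormsSubalgebra_of_tau_eq_one`), then
`in_δ(f) ∈ k[T(Ψ, γ)]`, `T(Ψ, γ) = ⟨X_S, ℓ_j : γ_j = 1/(νδ)⟩`. (Ours, in the model: items (1)–(4) of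
`deltaInitial_eq_aeval_of_isCentreFor` and `in_w z_i = Σ_S (z_i)_{e_l} X_l + Φ_i`, `in_w z_j = ℓ_j`.)
[cite: CossartJannsenSaito2020, Thm. 8.16 (p. 121), Def. 8.2 (4) (p. 118), Def. 8.13 (pp. 120–121); AbramovichTemkinWlodarczyk2024, Thm. 5.3.1 (p. 1578); AbramovichQuekSchober2025, Thm. 3.5] -/
theorem deltaInitial_mem_linearFormsSubalgebra_of_isCentreFor (hord : monomialOrd (fun _ => 1) f = ν)
    (hτ : S.card = hironakaTau k {homogeneousComponent ν f})
    (hFS : ∀ d ∈ (homogeneousComponent ν f).support, ∀ j ∉ S, d j = 0)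
    (hprep : IsDeltaPrepared S ν f) {δ : ℚ} (hδ : hironakaDelta S ν f = δ)
    {Ψ : MvPolynomial (Fin n) k ≃ₐ[k] MvPolynomial (Fin n) k} {γ : Fin n → ℚ}
    (h : IsCentreFor f Ψ γ) (hγS : ∀ i ∈ S, γ i = (ν : ℚ)⁻¹)
    (hγle : ∀ j ∉ S, γ j ≤ ((ν : ℚ) * δ)⁻¹)
    (hΦ : ∀ i ∈ S, uHomogeneousPart S δ (Ψ (X i)) ∈ linearFormsSubalgebra k (competitorSpan S ν δ Ψ γ)) :
    deltaInitial S ν δ f ∈ linearFormsSubalgebra k (competitorSpan S ν δ Ψ γ) := by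
  classical
  have hδ1 : 1 < δ := one_lt_hironakaDelta hord hFS hδ
  have hδpos : 0 < δ := one_pos.trans hδ1
  obtain ⟨p, q, hqpos, hpq⟩ := exists_eq_mul_den hδpos
  have hqq : (0 : ℚ) < q := by exact_mod_cast hqpos
  have hqp : q < p := by
    have : (q : ℚ) < p := by rw [hpq]; nlinarith
    exact_mod_cast this
  obtain ⟨h1, h2, -, -⟩ := deltaInitial_eq_aeval_of_isCentreFor hord hτ hFS hprep hδ hqpos hpq h hγS hγle
  set M := Finset.univ.filter (fun j => j ∉ S ∧ γ j = ((ν : ℚ) * δ)⁻¹) with hM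
  set θ : Fin n → MvPolynomial (Fin n) k := fun i => weightedHomogeneousComponent
    (fun j => if j ∈ S then p else q) (if i ∈ S then p else q) (Ψ (X i)) with hθ
  set Hc := weightedHomogeneousComponent (fun i => if i ∈ S then p else q) (ν * p) (Ψ.symm f)
    with hHc
  rw [h1]
  have hvars : (↑Hc.vars : Set (Fin n)) ⊆ ↑(S ∪ M) := by
    intro j hj
    rw [Finset.mem_coe, mem_vars_iff_mem_support] at hj
    obtain ⟨d, hd, hjd⟩ := hj
    rw [Finset.mem_coe, Finset.mem_union]
    by_contra hjSM
    push Not at hjSM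
    have hjS : j ∉ S := hjSM.1
    have hγj : γ j ≠ ((ν : ℚ) * δ)⁻¹ := fun hγ =>
      hjSM.2 (Finset.mem_filter.mpr ⟨Finset.mem_univ _, hjS, hγ⟩)
    exact (Finsupp.mem_support_iff.mp hjd) (h2 d hd j hjS hγj)
  have hmem : Hc ∈ Algebra.adjoin k (X '' (↑(S ∪ M) : Set (Fin n))) := mem_supported.mpr hvars
  have hmap : aeval θ Hc ∈ (Algebra.adjoin k (X '' (↑(S ∪ M) : Set (Fin n)))).map (aeval θ) :=
    Subalgebra.mem_map.mpr ⟨Hc, hmem, rfl⟩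
  rw [AlgHom.map_adjoin] at hmap
  refine Algebra.adjoin_le ?_ hmap
  rintro _ ⟨_, ⟨i, hi, rfl⟩, rfl⟩
  rw [SetLike.mem_coe, aeval_X]
  rcases Finset.mem_union.mp (Finset.mem_coe.mp hi) with hiS | hiM
  · have hθi : θ i = (∑ l ∈ S, C (coeff (Finsupp.single l 1) (Ψ (X i))) * X l) +
        uHomogeneousPart S δ (Ψ (X i)) := by
      simp only [hθ, if_pos hiS]
      exact weightedHomogeneousComponent_high_eq hqp hqpos hpq _
    rw [hθi]
    refine add_mem (sum_mem fun l hl => ?_) (hΦ i hiS)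
    rw [← smul_eq_C_mul]
    exact Subalgebra.smul_mem _ (X_mem_linearFormsSubalgebra_competitorSpan hl) _
  · obtain ⟨-, hiS, hγi⟩ := Finset.mem_filter.mp hiM
    have hθi : θ i = linearFormPoly k (uLinearForm S (Ψ (X i))) := by
      simp only [hθ, if_neg hiS]
      exact weightedHomogeneousComponent_low_eq hqp hqpos _
    rw [hθi]
    exact uLinearForm_mem_linearFormsSubalgebra_competitorSpan hiS hγi

/-- **The count.** Under the hypotheses of `deltaInitial_mem_linearFormsSubalgebra_of_isCentreFor`:
`τ(in_δ f) ≤ |S| + #{j ∉ S : γ_j = 1/(νδ)}` — a competitor centre in the prefix class `(1/ν)^τ`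
has at least `τ(in_δ f) − τ` further weights EQUAL to `1/(νδ)`; with
`succ_card_le_card_of_isCentreFor_of_isDeltaPrepared` (all further weights are `≥ 1/(νδ)`) this pins
the entries `τ+1, …, τ(in_δ f)` of the exponent list of every such centre to `νδ`. (Ours, in the model.)
[cite: CossartJannsenSaito2020, Thm. 8.16 (p. 121), Def. 8.2 (4) (p. 118); AbramovichTemkinWlodarczyk2024, Thm. 5.3.1 (p. 1578), Lemma 5.2.10 (p. 1577); AbramovichQuekSchober2025, Thm. 3.5] -/
theorem hironakaTau_deltaInitial_le_of_isCentreFor (hord : monomialOrd (fun _ => 1) f = ν)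
    (hτ : S.card = hironakaTau k {homogeneousComponent ν f})
    (hFS : ∀ d ∈ (homogeneousComponent ν f).support, ∀ j ∉ S, d j = 0)
    (hprep : IsDeltaPrepared S ν f) {δ : ℚ} (hδ : hironakaDelta S ν f = δ)
    {Ψ : MvPolynomial (Fin n) k ≃ₐ[k] MvPolynomial (Fin n) k} {γ : Fin n → ℚ}
    (h : IsCentreFor f Ψ γ) (hγS : ∀ i ∈ S, γ i = (ν : ℚ)⁻¹)
    (hγle : ∀ j ∉ S, γ j ≤ ((ν : ℚ) * δ)⁻¹)
    (hΦ : ∀ i ∈ S, uHomogeneousPart S δ (Ψ (X i)) ∈ linearFormsSubalgebra k (competitorSpan S ν δ Ψ γ)) :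
    hironakaTau k {deltaInitial S ν δ f} ≤
      S.card + (Finset.univ.filter (fun j => j ∉ S ∧ γ j = ((ν : ℚ) * δ)⁻¹)).card := by
  refine (hironakaTau_le_finrank_of_subset k ?_).trans (finrank_competitorSpan_le S ν δ Ψ γ)
  rintro _ rfl
  exact deltaInitial_mem_linearFormsSubalgebra_of_isCentreFor hord hτ hFS hprep hδ h hγS hγle hΦ

/-- **The count, untwisted competitors.** If the `y'`-coordinates `z_i` (`i ∈ S`) of the competitor
contain no pure-`u` monomial of degree exactly `δ`, then `τ(in_δ f) ≤ |S| + #{j ∉ S : γ_j = 1/(νδ)}`.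
(Ours, in the model.) [cite: CossartJannsenSaito2020, Thm. 8.16 (p. 121), Def. 8.2 (4) (p. 118); AbramovichTemkinWlodarczyk2024, Thm. 5.3.1 (p. 1578); AbramovichQuekSchober2025, Thm. 3.5] -/
theorem hironakaTau_deltaInitial_le_of_forall_degree_ne (hord : monomialOrd (fun _ => 1) f = ν)
    (hτ : S.card = hironakaTau k {homogeneousComponent ν f})
    (hFS : ∀ d ∈ (homogeneousComponent ν f).support, ∀ j ∉ S, d j = 0)
    (hprep : IsDeltaPrepared S ν f) {δ : ℚ} (hδ : hironakaDelta S ν f = δ)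
    {Ψ : MvPolynomial (Fin n) k ≃ₐ[k] MvPolynomial (Fin n) k} {γ : Fin n → ℚ}
    (h : IsCentreFor f Ψ γ) (hγS : ∀ i ∈ S, γ i = (ν : ℚ)⁻¹)
    (hγle : ∀ j ∉ S, γ j ≤ ((ν : ℚ) * δ)⁻¹)
    (hne : ∀ i ∈ S, ∀ d ∈ (Ψ (X i)).support, blockDeg S d = 0 → (d.degree : ℚ) ≠ δ) :
    hironakaTau k {deltaInitial S ν δ f} ≤
      S.card + (Finset.univ.filter (fun j => j ∉ S ∧ γ j = ((ν : ℚ) * δ)⁻¹)).card :=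
  hironakaTau_deltaInitial_le_of_isCentreFor hord hτ hFS hprep hδ h hγS hγle fun i hi => by
    rw [uHomogeneousPart_eq_zero_of_forall_ne (hne i hi)]
    exact zero_mem _

/-- **The count for non-integral `δ`** — unconditional in the competitor: if `δ(f;u;y) ∉ ℕ` and
`(f; X_S; X_{Sᶜ})` is `δ`-prepared, every centre `(Ψ; γ)` for `f` with `γ = 1/ν` on `S` and
`γ ≤ 1/(νδ)` off `S` has at least `τ(in_δ f) − |S|` weights equal to `1/(νδ)` off `S`. (Ours, in the
model; by Thm. 8.22 (a) non-integral vertices admit no solution, so no twist can occur.)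
[cite: CossartJannsenSaito2020, Thm. 8.16 (p. 121), Thm. 8.22 (a) (p. 124), Def. 8.2 (4) (p. 118); AbramovichTemkinWlodarczyk2024, Thm. 5.3.1 (p. 1578); AbramovichQuekSchober2025, Thm. 3.5] -/
theorem hironakaTau_deltaInitial_le_of_forall_natCast_ne (hord : monomialOrd (fun _ => 1) f = ν)
    (hτ : S.card = hironakaTau k {homogeneousComponent ν f})
    (hFS : ∀ d ∈ (homogeneousComponent ν f).support, ∀ j ∉ S, d j = 0)
    (hprep : IsDeltaPrepared S ν f) {δ : ℚ} (hδ : hironakaDelta S ν f = δ)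
    (hδint : ∀ m : ℕ, (m : ℚ) ≠ δ)
    {Ψ : MvPolynomial (Fin n) k ≃ₐ[k] MvPolynomial (Fin n) k} {γ : Fin n → ℚ}
    (h : IsCentreFor f Ψ γ) (hγS : ∀ i ∈ S, γ i = (ν : ℚ)⁻¹)
    (hγle : ∀ j ∉ S, γ j ≤ ((ν : ℚ) * δ)⁻¹) :
    hironakaTau k {deltaInitial S ν δ f} ≤
      S.card + (Finset.univ.filter (fun j => j ∉ S ∧ γ j = ((ν : ℚ) * δ)⁻¹)).card :=
  hironakaTau_deltaInitial_le_of_forall_degree_ne hord hτ hFS hprep hδ h hγS hγle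
    fun _ _ d _ _ => hδint d.degree

/-! ### The twisted case for `τ = 1` (Tschirnhaus-normalised `δ`-face): the twist `Φ` is a polynomial in the `ℓ_j` -/

/-- The weight for the indicator of `i₀` is the `X_{i₀}`-degree. [folklore] -/
private theorem weight_pi_single (i₀ : Fin n) (d : Fin n →₀ ℕ) :
    weight (Pi.single i₀ 1 : Fin n → ℕ) d = d i₀ := by
  classical
  rw [Finsupp.weight_apply, Finsupp.sum_fintype _ _ (fun _ => by simp)]
  rw [Finset.sum_eq_single_of_mem i₀ (Finset.mem_univ _)
    (fun j _ hj => by simp [hj])]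
  simp

/-- Taking a weighted homogeneous component commutes with multiplication by a weight-`0` factor. [folklore] -/
private theorem weightedHomogeneousComponent_mul_of_isWeightedHomogeneous_zero {w : Fin n → ℕ}
    {U : MvPolynomial (Fin n) k} (hU : IsWeightedHomogeneous w U 0) (P : MvPolynomial (Fin n) k)
    (m : ℕ) :
    weightedHomogeneousComponent w m (P * U) = weightedHomogeneousComponent w m P * U := by
  classical
  ext d
  rw [coeff_weightedHomogeneousComponent, coeff_mul, coeff_mul]
  have key : ∀ x ∈ Finset.antidiagonal d,
      coeff x.1 (weightedHomogeneousComponent w m P) * coeff x.2 U =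
        if weight w d = m then coeff x.1 P * coeff x.2 U else 0 := by
    intro x hx
    rw [coeff_weightedHomogeneousComponent]
    by_cases hU0 : coeff x.2 U = 0
    · simp [hU0]
    · have h2 : weight w x.2 = 0 := hU hU0
      have hd : weight w d = weight w x.1 := by
        rw [← Finset.mem_antidiagonal.mp hx, map_add, h2, add_zero]
      rw [hd]
      split_ifs <;> simp
  rw [Finset.sum_congr rfl key]
  by_cases hW : weight w d = m <;> simp [hW]

/-- Binomial theorem, graded form: the `X_{i₀}`-degree-`m` part of `(a X_{i₀} + Φ)^b` for `Φ` free
of `X_{i₀}` is `C(b, m) (a X_{i₀})^m Φ^{b−m}`. [folklore] -/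
private theorem weightedHomogeneousComponent_C_mul_X_add_pow {i₀ : Fin n} {Φ : MvPolynomial (Fin n) k}
    (hΦ : IsWeightedHomogeneous (Pi.single i₀ 1 : Fin n → ℕ) Φ 0) (a : k) (b m : ℕ) :
    weightedHomogeneousComponent (Pi.single i₀ 1 : Fin n → ℕ) m ((C a * X i₀ + Φ) ^ b) =
      if m ≤ b then (C a * X i₀) ^ m * (Φ ^ (b - m) * ((b.choose m : ℕ) : MvPolynomial (Fin n) k))
      else 0 := by
  classical
  have hX : IsWeightedHomogeneous (Pi.single i₀ 1 : Fin n → ℕ)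
      (C a * X i₀ : MvPolynomial (Fin n) k) 1 := by
    have := (isWeightedHomogeneous_X k (Pi.single i₀ 1 : Fin n → ℕ) i₀).C_mul a
    simpa using this
  rw [add_pow, map_sum]
  have hterm : ∀ r ∈ Finset.range (b + 1),
      weightedHomogeneousComponent (Pi.single i₀ 1 : Fin n → ℕ) m
        ((C a * X i₀) ^ r * Φ ^ (b - r) * ((b.choose r : ℕ) : MvPolynomial (Fin n) k)) =
      if r = m then (C a * X i₀) ^ m * (Φ ^ (b - m) * ((b.choose m : ℕ) : MvPolynomial (Fin n) k))
      else 0 := by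
    intro r _
    have hrest : IsWeightedHomogeneous (Pi.single i₀ 1 : Fin n → ℕ)
        (Φ ^ (b - r) * ((b.choose r : ℕ) : MvPolynomial (Fin n) k)) 0 := by
      have h1 := (hΦ.pow (b - r)).mul
        (isWeightedHomogeneous_C (Pi.single i₀ 1 : Fin n → ℕ) ((b.choose r : ℕ) : k))
      simpa using h1
    rw [mul_assoc, weightedHomogeneousComponent_mul_of_isWeightedHomogeneous_zero hrest,
      weightedHomogeneousComponent_of_mem (hX.pow r)]
    simp only [smul_eq_mul, mul_one]
    by_cases hrm : r = m
    · subst hrm; simp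
    · rw [if_neg (Ne.symm hrm), if_neg hrm, zero_mul]
  rw [Finset.sum_congr rfl hterm, Finset.sum_ite_eq' (Finset.range (b + 1)) m]
  simp only [Finset.mem_range, Nat.lt_succ_iff]

/-- **The twist is a polynomial in the competitor's forms (`τ = 1`).** Let `S = {i₀}`,
`(f; X_{i₀}; X_{≠ i₀})` `δ`-prepared, `ν` invertible in `k`, and assume `f` has no monomial
`X_{i₀}^{ν−1} U^A` with `|A| = δ` (Tschirnhaus normalisation of the `δ`-face, available as `ν ∈ kˣ`).
Then for every centre `(Ψ; γ)` for `f` with `γ_{i₀} = 1/ν`, `γ_j ≤ 1/(νδ)` (`j ≠ i₀`), the pure-`u`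
degree-`δ` part `Φ` of `z_{i₀} = Ψ(X_{i₀})` lies in `k[T(Ψ, γ)]`: comparing the `X_{i₀}`-degree
`ν − 1` and `ν` parts of `in_δ(f) = H(a X_{i₀} + Φ, ℓ(u))` (`deltaInitial_eq_aeval_of_isCentreFor`)
gives `(a X_{i₀})^{ν−1}·(ν h Φ + H_{ν−1}(ℓ(u))) = 0` and `h a^ν = f_{ν e_{i₀}} ≠ 0`, whence
`Φ = −(ν h)⁻¹ H_{ν−1}(ℓ(u))`. (Ours, in the model; the solution `λ = c U^v` of Thm. 8.22 (a) is what
a twist not of this form would produce.)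
[cite: CossartJannsenSaito2020, Thm. 8.16 (p. 121), Def. 8.13 (pp. 120–121), Thm. 8.22 (a) (p. 124); Hironaka1967, Thm. (4.8)] -/
theorem uHomogeneousPart_mem_linearFormsSubalgebra_of_tau_eq_one (i₀ : Fin n) (hS : S = {i₀})
    (hord : monomialOrd (fun _ => 1) f = ν)
    (hτ : S.card = hironakaTau k {homogeneousComponent ν f})
    (hFS : ∀ d ∈ (homogeneousComponent ν f).support, ∀ j ∉ S, d j = 0)
    (hprep : IsDeltaPrepared S ν f) {δ : ℚ} (hδ : hironakaDelta S ν f = δ)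
    (hνk : (ν : k) ≠ 0) (hN0 : ∀ d ∈ f.support, d i₀ + 1 = ν → (coDeg S d : ℚ) ≠ δ)
    {Ψ : MvPolynomial (Fin n) k ≃ₐ[k] MvPolynomial (Fin n) k} {γ : Fin n → ℚ}
    (h : IsCentreFor f Ψ γ) (hγS : ∀ i ∈ S, γ i = (ν : ℚ)⁻¹)
    (hγle : ∀ j ∉ S, γ j ≤ ((ν : ℚ) * δ)⁻¹) :
    uHomogeneousPart S δ (Ψ (X i₀)) ∈ linearFormsSubalgebra k (competitorSpan S ν δ Ψ γ) := by
  classical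
  have hν : 0 < ν := nu_pos_of_hironakaDelta_eq hδ
  obtain ⟨m, rfl⟩ := Nat.exists_eq_add_one_of_ne_zero hν.ne'
  have hmemS : ∀ j, j ∈ S ↔ j = i₀ := fun j => by rw [hS, Finset.mem_singleton]
  have hi₀S : i₀ ∈ S := (hmemS i₀).mpr rfl
  have hbD : ∀ d : Fin n →₀ ℕ, blockDeg S d = d i₀ := fun d => by
    rw [blockDeg_eq_sum_univ, hS, Finset.sum_singleton]
  have hcD0 : ∀ d : Fin n →₀ ℕ, coDeg S d = 0 → ∀ i, i ≠ i₀ → d i = 0 := by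
    intro d hc i hi
    rw [coDeg_eq_sum_univ, Finset.sum_eq_zero_iff] at hc
    exact hc i (Finset.mem_filter.mpr ⟨Finset.mem_univ _, fun h' => hi ((hmemS i).mp h')⟩)
  have hδ1 : 1 < δ := one_lt_hironakaDelta hord hFS hδ
  have hδpos : 0 < δ := one_pos.trans hδ1
  obtain ⟨p, q, hqpos, hpq⟩ := exists_eq_mul_den hδpos
  have hqq : (0 : ℚ) < q := by exact_mod_cast hqpos
  have hqp : q < p := by
    have : (q : ℚ) < p := by rw [hpq]; nlinarith
    exact_mod_cast this
  have hppos : 0 < p := lt_of_le_of_lt (Nat.zero_le _) hqp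
  obtain ⟨h1, h2, -, -⟩ :=
    deltaInitial_eq_aeval_of_isCentreFor hord hτ hFS hprep hδ hqpos hpq h hγS hγle
  set A := linearFormsSubalgebra k (competitorSpan S (m + 1) δ Ψ γ) with hA
  set Φ := uHomogeneousPart S δ (Ψ (X i₀)) with hΦdef
  set a : k := coeff (Finsupp.single i₀ 1) (Ψ (X i₀)) with ha
  set L : Fin n → MvPolynomial (Fin n) k := fun j => linearFormPoly k (uLinearForm S (Ψ (X j)))
    with hL
  set Hc := weightedHomogeneousComponent (fun i => if i ∈ S then p else q) ((m + 1) * p) (Ψ.symm f)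
    with hHc
  set θ : Fin n → MvPolynomial (Fin n) k := fun i => weightedHomogeneousComponent
    (fun j => if j ∈ S then p else q) (if i ∈ S then p else q) (Ψ (X i)) with hθ
  have hθ₀ : θ i₀ = C a * X i₀ + Φ := by
    simp only [hθ, if_pos hi₀S]
    rw [weightedHomogeneousComponent_high_eq hqp hqpos hpq, hS, Finset.sum_singleton, ← hS, ← ha,
      ← hΦdef]
  have hθj : ∀ j, j ≠ i₀ → θ j = L j := fun j hj => by
    have hjS : j ∉ S := fun h' => hj ((hmemS j).mp h')
    simp only [hθ, hL, if_neg hjS]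
    exact weightedHomogeneousComponent_low_eq hqp hqpos _
  -- the `X_{i₀}`-grading
  set w' : Fin n → ℕ := Pi.single i₀ 1 with hw'
  have hLhom : ∀ j, IsWeightedHomogeneous w' (L j) 0 := by
    intro j
    simp only [hL]
    rw [linearFormPoly_uLinearForm]
    refine IsWeightedHomogeneous.sum _ _ 0 fun l hl => ?_
    have hl : l ≠ i₀ := fun h' => (Finset.mem_filter.mp hl).2 (h' ▸ hi₀S)
    have := (isWeightedHomogeneous_X k w' l).C_mul (coeff (Finsupp.single l 1) (Ψ (X j)))
    simpa [hw', Pi.single_apply, hl] using this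
  have hΦhom : IsWeightedHomogeneous w' Φ 0 := by
    intro d hd
    rw [hΦdef, uHomogeneousPart, coeff_sum_filter_monomial] at hd
    have hPd : blockDeg S d = 0 ∧ (d.degree : ℚ) = δ := by
      by_contra h'; exact hd (if_neg h')
    rw [hw', weight_pi_single, ← hbD d, hPd.1]
  set U : (Fin n →₀ ℕ) → MvPolynomial (Fin n) k :=
    fun d => ∏ i ∈ Finset.univ.erase i₀, L i ^ d i with hU
  have hUhom : ∀ d, IsWeightedHomogeneous w' (U d) 0 := by
    intro d
    have := IsWeightedHomogeneous.prod (Finset.univ.erase i₀) (fun i => L i ^ d i) (fun _ => 0)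
      fun i _ => by simpa using (hLhom i).pow (d i)
    simpa using this
  have hU1 : ∀ d : Fin n →₀ ℕ, (∀ i, i ≠ i₀ → d i = 0) → U d = 1 := fun d hd =>
    Finset.prod_eq_one fun i hi => by rw [hd i (Finset.ne_of_mem_erase hi), pow_zero]
  have hUmem : ∀ d ∈ Hc.support, U d ∈ A := by
    intro d hd
    refine prod_mem fun i hi => ?_
    by_cases hdi : d i = 0
    · rw [hdi, pow_zero]; exact one_mem _
    · have hi : i ≠ i₀ := Finset.ne_of_mem_erase hi
      have hiS : i ∉ S := fun h' => hi ((hmemS i).mp h')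
      have hγi : γ i = (((m + 1 : ℕ) : ℚ) * δ)⁻¹ := by
        by_contra hne; exact hdi (h2 d hd i hiS hne)
      exact pow_mem (uLinearForm_mem_linearFormsSubalgebra_competitorSpan hiS hγi) _
  -- expansion of `aeval θ Hc` as a polynomial in `a X_{i₀} + Φ` over the `ℓ_j`
  have hexp : aeval θ Hc =
      ∑ d ∈ Hc.support, C (coeff d Hc) * ((C a * X i₀ + Φ) ^ (d i₀) * U d) := by
    rw [MvPolynomial.aeval_def, MvPolynomial.eval₂_eq']
    refine Finset.sum_congr rfl fun d _ => ?_
    rw [MvPolynomial.algebraMap_eq, ← Finset.mul_prod_erase Finset.univ (fun i => θ i ^ d i)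
      (Finset.mem_univ i₀), hθ₀]
    congr 2
    exact Finset.prod_congr rfl fun i hi => by rw [hθj i (Finset.ne_of_mem_erase hi)]
  have hcomp : ∀ t, weightedHomogeneousComponent w' t (aeval θ Hc) =
      ∑ d ∈ Hc.support, C (coeff d Hc) * ((if t ≤ d i₀ then (C a * X i₀) ^ t *
        (Φ ^ (d i₀ - t) * (((d i₀).choose t : ℕ) : MvPolynomial (Fin n) k)) else 0) * U d) := by
    intro t
    rw [hexp, map_sum]
    refine Finset.sum_congr rfl fun d _ => ?_
    rw [weightedHomogeneousComponent_C_mul,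
      weightedHomogeneousComponent_mul_of_isWeightedHomogeneous_zero (hUhom d),
      hw', weightedHomogeneousComponent_C_mul_X_add_pow hΦhom]
  -- the support of `Hc`
  have hHcw : ∀ d ∈ Hc.support, p * d i₀ + q * coDeg S d = (m + 1) * p := by
    intro d hd
    rw [mem_support_iff, hHc, coeff_weightedHomogeneousComponent] at hd
    have : weight (fun i => if i ∈ S then p else q) d = (m + 1) * p := by
      by_contra hne; exact hd (if_neg hne)
    rwa [weight_block, hbD] at this
  have hbν : ∀ d ∈ Hc.support, d i₀ ≤ m + 1 := by
    intro d hd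
    have := hHcw d hd
    have h1 : p * d i₀ ≤ p * (m + 1) := by rw [Nat.mul_comm p (m + 1)]; omega
    exact Nat.le_of_mul_le_mul_left h1 hppos
  have hdeq : ∀ d ∈ Hc.support, d i₀ = m + 1 → d = Finsupp.single i₀ (m + 1) := by
    intro d hd hdν
    have := hHcw d hd
    rw [hdν, Nat.mul_comm p (m + 1)] at this
    have hc0 : coDeg S d = 0 := by
      have h0 : q * coDeg S d = 0 := by omega
      rcases Nat.mul_eq_zero.mp h0 with h | h
      · omega
      · exact h
    ext i
    by_cases hi : i = i₀
    · subst hi; simp [hdν]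
    · rw [Finsupp.single_apply, if_neg (Ne.symm hi)]
      exact hcD0 d hc0 i hi
  -- the `X_{i₀}`-degree-`m` and `-(m+1)` parts of `in_δ f`
  have hFν1 : weightedHomogeneousComponent w' m (deltaInitial S (m + 1) δ f) = 0 := by
    ext d
    rw [coeff_weightedHomogeneousComponent, coeff_zero, hw', weight_pi_single]
    split_ifs with hd
    · rw [deltaInitial, coeff_sum_filter_monomial]
      split_ifs with hP
      · by_contra hne
        have hdf : d ∈ f.support := mem_support_iff.mpr hne
        obtain ⟨_, hc⟩ := hP
        rw [hbD, hd, show m + 1 - m = 1 by omega, Nat.cast_one, mul_one] at hc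
        exact hN0 d hdf (by rw [hd]) hc
      · rfl
    · rfl
  have hFν : weightedHomogeneousComponent w' (m + 1) (deltaInitial S (m + 1) δ f) =
      monomial (Finsupp.single i₀ (m + 1)) (coeff (Finsupp.single i₀ (m + 1)) f) := by
    ext d
    rw [coeff_weightedHomogeneousComponent, coeff_monomial, hw', weight_pi_single, deltaInitial,
      coeff_sum_filter_monomial]
    by_cases hd : d i₀ = m + 1
    · rw [if_pos hd]
      by_cases hP : blockDeg S d ≤ m + 1 ∧ (coDeg S d : ℚ) = δ * ((m + 1 - blockDeg S d : ℕ) : ℚ)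
      · rw [if_pos hP]
        obtain ⟨_, hc⟩ := hP
        rw [hbD, hd, Nat.sub_self, Nat.cast_zero, mul_zero] at hc
        have hc0 : coDeg S d = 0 := by exact_mod_cast hc
        have hdeq' : d = Finsupp.single i₀ (m + 1) := by
          ext i
          by_cases hi : i = i₀
          · subst hi; simp [hd]
          · rw [Finsupp.single_apply, if_neg (Ne.symm hi)]
            exact hcD0 d hc0 i hi
        rw [if_pos hdeq'.symm, hdeq']
      · rw [if_neg hP, if_neg]
        rintro rfl
        apply hP
        refine ⟨by rw [hbD, hd], ?_⟩
        rw [hbD, hd, Nat.sub_self, Nat.cast_zero, mul_zero, coDeg_eq_sum_univ]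
        push_cast
        refine Finset.sum_eq_zero fun i hi => ?_
        have hi' : i ≠ i₀ := fun h' => (Finset.mem_filter.mp hi).2 (h' ▸ hi₀S)
        simp [Ne.symm hi']
    · rw [if_neg hd, if_neg]
      rintro rfl
      exact hd (by simp)
  -- `c = f_{ν e_{i₀}} ≠ 0`
  have hc : coeff (Finsupp.single i₀ (m + 1)) f ≠ 0 := by
    have hf0 : f ≠ 0 := by
      intro hf
      rw [hf, (monomialOrd_eq_top_iff (fun _ : Fin n => (1 : ℕ)) (0 : MvPolynomial (Fin n) k)).mpr rfl]
        at hord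
      exact ENat.top_ne_coe _ hord
    obtain ⟨d, hd, hdw⟩ := exists_weight_eq_monomialOrd (fun _ => (1 : ℕ)) hf0
    rw [hord] at hdw
    have hdeg : d.degree = m + 1 := by
      rw [Finsupp.degree_eq_weight_one]; exact_mod_cast hdw
    have hdF : d ∈ (homogeneousComponent (m + 1) f).support := by
      rw [mem_support_iff, coeff_homogeneousComponent, if_pos hdeg]; exact mem_support_iff.mp hd
    have hd' : d = Finsupp.single i₀ (m + 1) := by
      have hothers : ∀ i, i ≠ i₀ → d i = 0 := fun i hi =>
        hFS d hdF i (fun h' => hi ((hmemS i).mp h'))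
      ext i
      by_cases hi : i = i₀
      · subst hi
        rw [Finsupp.single_eq_same]
        have hc0 : coDeg S d = 0 := by
          rw [coDeg_eq_sum_univ]
          exact Finset.sum_eq_zero fun j hj => hothers j
            (fun h' => (Finset.mem_filter.mp hj).2 (h' ▸ hi₀S))
        have : d.degree = d i := by rw [degree_eq_blockDeg_add_coDeg S, hbD, hc0, add_zero]
        rw [← this, hdeg]
      · rw [Finsupp.single_apply, if_neg (Ne.symm hi)]; exact hothers i hi
    rw [← hd']; exact mem_support_iff.mp hd
  -- degree `m + 1`: `c = h a^{m+1}`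
  have hEν : monomial (Finsupp.single i₀ (m + 1)) (coeff (Finsupp.single i₀ (m + 1)) f) =
      C (coeff (Finsupp.single i₀ (m + 1)) Hc) * (C a * X i₀) ^ (m + 1) := by
    rw [← hFν, h1, hcomp (m + 1), Finset.sum_eq_single (Finsupp.single i₀ (m + 1))]
    · rw [hU1 (Finsupp.single i₀ (m + 1)) (fun i hi => by simp [Ne.symm hi])]
      simp
    · intro d hd hne
      have hlt : ¬ m + 1 ≤ d i₀ := fun hle => hne (hdeq d hd (le_antisymm (hbν d hd) hle))
      rw [if_neg hlt, zero_mul, mul_zero]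
    · intro hns
      rw [notMem_support_iff.mp hns, C_0, zero_mul]
  have hca : coeff (Finsupp.single i₀ (m + 1)) f =
      coeff (Finsupp.single i₀ (m + 1)) Hc * a ^ (m + 1) := by
    have := congr_arg (coeff (Finsupp.single i₀ (m + 1))) hEν
    rw [coeff_monomial, if_pos rfl] at this
    rw [this, mul_pow, ← C_pow, coeff_C_mul, coeff_C_mul, X_pow_eq_monomial, coeff_monomial, if_pos rfl,
      mul_one]
  have hcν0 : coeff (Finsupp.single i₀ (m + 1)) Hc ≠ 0 := fun h0 => hc (by rw [hca, h0, zero_mul])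
  have ha0 : a ≠ 0 := fun h0 => hc (by rw [hca, h0, zero_pow (Nat.succ_ne_zero m), mul_zero])
  -- degree `m`: `0 = (a X)^m · (h (m+1) Φ + R)`
  have hE : ∑ d ∈ Hc.support, C (coeff d Hc) * ((if m ≤ d i₀ then (C a * X i₀) ^ m *
      (Φ ^ (d i₀ - m) * (((d i₀).choose m : ℕ) : MvPolynomial (Fin n) k)) else 0) * U d) = 0 := by
    rw [← hcomp m, ← h1, hFν1]
  have hterm : ∀ d ∈ Hc.support, C (coeff d Hc) * ((if m ≤ d i₀ then (C a * X i₀) ^ m *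
      (Φ ^ (d i₀ - m) * (((d i₀).choose m : ℕ) : MvPolynomial (Fin n) k)) else 0) * U d) =
      (C a * X i₀) ^ m * (C (coeff d Hc) * U d *
        ((if d i₀ = m + 1 then ((m + 1 : ℕ) : MvPolynomial (Fin n) k) * Φ else 0) +
          (if d i₀ + 1 = m + 1 then 1 else 0))) := by
    intro d hd
    rcases Nat.lt_or_ge (d i₀) m with hlt | hge
    · have h1' : ¬ m ≤ d i₀ := not_le.mpr hlt
      have h2' : d i₀ ≠ m + 1 := by omega
      have h3' : d i₀ ≠ m := by omega
      rw [if_neg h1', if_neg h2', if_neg (by omega), zero_mul, mul_zero, add_zero, mul_zero, mul_zero]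
    · rw [if_pos hge]
      have hcases : d i₀ = m ∨ d i₀ = m + 1 := by have := hbν d hd; omega
      rcases hcases with hdm | hdm
      · rw [hdm, if_neg (by omega), if_pos rfl, Nat.sub_self, pow_zero, Nat.choose_self]
        push_cast; ring
      · rw [hdm, if_pos rfl, if_neg (by omega), show m + 1 - m = 1 by omega, pow_one,
          Nat.choose_succ_self_right]
        push_cast; ring
  have hX0 : (C a * X i₀ : MvPolynomial (Fin n) k) ^ m ≠ 0 :=
    pow_ne_zero _ (mul_ne_zero (by rwa [Ne, C_eq_zero]) (X_ne_zero i₀))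
  have hQ : ∑ d ∈ Hc.support, C (coeff d Hc) * U d *
      ((if d i₀ = m + 1 then ((m + 1 : ℕ) : MvPolynomial (Fin n) k) * Φ else 0) +
        (if d i₀ + 1 = m + 1 then 1 else 0)) = 0 := by
    apply mul_right_injective₀ hX0
    calc (C a * X i₀) ^ m * ∑ d ∈ Hc.support, C (coeff d Hc) * U d *
          ((if d i₀ = m + 1 then ((m + 1 : ℕ) : MvPolynomial (Fin n) k) * Φ else 0) +
            (if d i₀ + 1 = m + 1 then 1 else 0))
        = ∑ d ∈ Hc.support, (C a * X i₀) ^ m * (C (coeff d Hc) * U d *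
          ((if d i₀ = m + 1 then ((m + 1 : ℕ) : MvPolynomial (Fin n) k) * Φ else 0) +
            (if d i₀ + 1 = m + 1 then 1 else 0))) := Finset.mul_sum _ _ _
      _ = ∑ d ∈ Hc.support, C (coeff d Hc) * ((if m ≤ d i₀ then (C a * X i₀) ^ m *
          (Φ ^ (d i₀ - m) * (((d i₀).choose m : ℕ) : MvPolynomial (Fin n) k)) else 0) * U d) :=
          Finset.sum_congr rfl fun d hd => (hterm d hd).symm
      _ = 0 := hE
      _ = (C a * X i₀) ^ m * 0 := (mul_zero _).symm
  -- `Q = C (h (m+1)) Φ + R`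
  set R := ∑ d ∈ Hc.support with d i₀ + 1 = m + 1, C (coeff d Hc) * U d with hR
  have hsplit : ∑ d ∈ Hc.support, C (coeff d Hc) * U d *
      ((if d i₀ = m + 1 then ((m + 1 : ℕ) : MvPolynomial (Fin n) k) * Φ else 0) +
        (if d i₀ + 1 = m + 1 then 1 else 0)) =
      C (coeff (Finsupp.single i₀ (m + 1)) Hc * ((m + 1 : ℕ) : k)) * Φ + R := by
    rw [Finset.sum_congr rfl fun d _ => mul_add _ _ _, Finset.sum_add_distrib]
    refine congrArg₂ (· + ·) ?_ ?_
    · rw [Finset.sum_eq_single (Finsupp.single i₀ (m + 1))]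
      · rw [if_pos (by simp), hU1 (Finsupp.single i₀ (m + 1)) (fun i hi => by simp [Ne.symm hi]),
          C_mul, map_natCast]
        ring
      · intro d hd hne
        rw [if_neg (fun h' => hne (hdeq d hd h')), mul_zero]
      · intro hns
        rw [notMem_support_iff.mp hns, C_0, zero_mul, zero_mul]
    · rw [hR, Finset.sum_filter]
      exact Finset.sum_congr rfl fun d _ => by split_ifs <;> simp
  have hRmem : R ∈ A := sum_mem fun d hd => by
    rw [← smul_eq_C_mul]
    exact Subalgebra.smul_mem _ (hUmem d (Finset.mem_filter.mp hd).1) _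
  have hmk : coeff (Finsupp.single i₀ (m + 1)) Hc * ((m + 1 : ℕ) : k) ≠ 0 := mul_ne_zero hcν0 hνk
  have hΦeq : Φ = C ((coeff (Finsupp.single i₀ (m + 1)) Hc * ((m + 1 : ℕ) : k))⁻¹) * (-R) := by
    have h0 : C (coeff (Finsupp.single i₀ (m + 1)) Hc * ((m + 1 : ℕ) : k)) * Φ + R = 0 := by
      rw [← hsplit]; exact hQ
    have h0' : C (coeff (Finsupp.single i₀ (m + 1)) Hc * ((m + 1 : ℕ) : k)) * Φ = -R :=
      eq_neg_of_add_eq_zero_left h0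
    rw [← h0', ← mul_assoc, ← C_mul, inv_mul_cancel₀ hmk, C_1, one_mul]
  rw [hΦeq, ← smul_eq_C_mul]
  exact Subalgebra.smul_mem _ (neg_mem hRmem) _

/-- **The count for `τ = 1` (twisted competitors included).** For `S = {i₀}`, `ν ∈ kˣ` and `f`
without monomials `X_{i₀}^{ν−1} U^A`, `|A| = δ`, `δ`-prepared: every centre `(Ψ; γ)` for `f` with
`γ_{i₀} = 1/ν` and `γ_j ≤ 1/(νδ)` (`j ≠ i₀`) has at least `τ(in_δ f) − 1` weights equal to `1/(νδ)`.
(Ours, in the model.) [cite: CossartJannsenSaito2020, Thm. 8.16 (p. 121), Def. 8.2 (4) (p. 118), Def. 8.13 (pp. 120–121); AbramovichTemkinWlodarczyk2024, Thm. 5.3.1 (p. 1578); AbramovichQuekSchober2025, Thm. 3.5] -/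
theorem hironakaTau_deltaInitial_le_of_tau_eq_one (i₀ : Fin n) (hS : S = {i₀})
    (hord : monomialOrd (fun _ => 1) f = ν)
    (hτ : S.card = hironakaTau k {homogeneousComponent ν f})
    (hFS : ∀ d ∈ (homogeneousComponent ν f).support, ∀ j ∉ S, d j = 0)
    (hprep : IsDeltaPrepared S ν f) {δ : ℚ} (hδ : hironakaDelta S ν f = δ)
    (hνk : (ν : k) ≠ 0) (hN0 : ∀ d ∈ f.support, d i₀ + 1 = ν → (coDeg S d : ℚ) ≠ δ)
    {Ψ : MvPolynomial (Fin n) k ≃ₐ[k] MvPolynomial (Fin n) k} {γ : Fin n → ℚ}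
    (h : IsCentreFor f Ψ γ) (hγS : ∀ i ∈ S, γ i = (ν : ℚ)⁻¹)
    (hγle : ∀ j ∉ S, γ j ≤ ((ν : ℚ) * δ)⁻¹) :
    hironakaTau k {deltaInitial S ν δ f} ≤
      S.card + (Finset.univ.filter (fun j => j ∉ S ∧ γ j = ((ν : ℚ) * δ)⁻¹)).card :=
  hironakaTau_deltaInitial_le_of_isCentreFor hord hτ hFS hprep hδ h hγS hγle fun i hi => by
    have : i = i₀ := by rw [hS, Finset.mem_singleton] at hi; exact hi
    subst this
    exact uHomogeneousPart_mem_linearFormsSubalgebra_of_tau_eq_one i hS hord hτ hFS hprep hδ hνk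
      hN0 h hγS hγle

end Count

/-! ## Infrastructure for §10: coefficient extraction along `k[X_S]`, Taylor slices, chain rule -/

section CoeffAlong

variable (S : Finset (Fin n))

/-- The `S`-part `d|_S` of an exponent. [folklore] -/
private def sPart (d : Fin n →₀ ℕ) : Fin n →₀ ℕ := d.filter fun i => i ∈ S

/-- The `u`-part `d|_{Sᶜ}` of an exponent. [folklore] -/
private def uPart (d : Fin n →₀ ℕ) : Fin n →₀ ℕ := d.filter fun i => i ∉ S

/-- `d = d|_S + d|_{Sᶜ}`. [folklore] -/
private theorem sPart_add_uPart (d : Fin n →₀ ℕ) : sPart S d + uPart S d = d := by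
  simp only [sPart, uPart]
  exact Finsupp.filter_add_filter_not d (fun i => i ∈ S)

/-- Coefficient extraction along `k[X_S]`: the `k`-linear map
`Σ_d c_d X^d ↦ Σ_{d : d|_S = B} c_d X^{d|_{Sᶜ}}`, i.e. the `X_S^B`-coefficient of a polynomial read in
`k[X_{Sᶜ}][X_S]`. [folklore] -/
private def coeffAlong (B : Fin n →₀ ℕ) : MvPolynomial (Fin n) k →ₗ[k] MvPolynomial (Fin n) k :=
  Finsupp.lsum k (fun d : Fin n →₀ ℕ =>
      if sPart S d = B then (monomial (uPart S d) : k →ₗ[k] MvPolynomial (Fin n) k) else 0)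
    ∘ₗ (AddMonoidAlgebra.coeffLinearEquiv k).toLinearMap

/-- `coeffAlong` on a monomial. [folklore] -/
private theorem coeffAlong_monomial (B d : Fin n →₀ ℕ) (c : k) :
    coeffAlong (k := k) S B (monomial d c) = if sPart S d = B then monomial (uPart S d) c else 0 := by
  have : coeffAlong (k := k) S B (monomial d c) =
      (if sPart S d = B then (monomial (uPart S d) : k →ₗ[k] MvPolynomial (Fin n) k) else 0) c :=
    sum_monomial_eq (LinearMap.map_zero _)
  rw [this]
  split_ifs <;> simp

/-- For `D ∈ k[X_S]` and `Φ ∈ k[X_{Sᶜ}]` the `X_S^B`-coefficient of `D · Φ` is `D_B · Φ`. [folklore] -/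
private theorem coeffAlong_mul_of_supported {D Φ : MvPolynomial (Fin n) k}
    (hD : ∀ d ∈ D.support, uPart S d = 0) (hΦ : ∀ d ∈ Φ.support, sPart S d = 0) (B : Fin n →₀ ℕ) :
    coeffAlong S B (D * Φ) = coeff B D • Φ := by
  classical
  conv_lhs => rw [D.as_sum, Φ.as_sum, Finset.sum_mul_sum]
  simp_rw [map_sum]
  have key : ∀ d₁ ∈ D.support, ∀ d₂ ∈ Φ.support,
      coeffAlong (k := k) S B (monomial d₁ (coeff d₁ D) * monomial d₂ (coeff d₂ Φ)) =
        if d₁ = B then monomial d₂ (coeff d₁ D * coeff d₂ Φ) else 0 := by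
    intro d₁ hd₁ d₂ hd₂
    rw [monomial_mul, coeffAlong_monomial]
    have h1 : sPart S (d₁ + d₂) = d₁ := by
      have := sPart_add_uPart S d₁
      rw [hD d₁ hd₁, add_zero] at this
      simp only [sPart, Finsupp.filter_add] at this ⊢
      rw [this]; simpa [sPart] using hΦ d₂ hd₂
    have h2 : uPart S (d₁ + d₂) = d₂ := by
      have := sPart_add_uPart S d₂
      rw [hΦ d₂ hd₂, zero_add] at this
      simp only [uPart, Finsupp.filter_add] at this ⊢
      rw [this]
      have h0 := hD d₁ hd₁
      simp only [uPart] at h0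
      rw [h0, zero_add]
    rw [h1, h2]
  rw [Finset.sum_congr rfl fun d₁ hd₁ => Finset.sum_congr rfl fun d₂ hd₂ => key d₁ hd₁ d₂ hd₂,
    Finset.sum_comm]
  simp_rw [Finset.sum_ite_eq' D.support]
  by_cases hB : B ∈ D.support
  · simp_rw [if_pos hB]
    conv_rhs => rw [Φ.as_sum, Finset.smul_sum]
    refine Finset.sum_congr rfl fun d₂ _ => ?_
    rw [smul_monomial, smul_eq_mul]
  · simp_rw [if_neg hB]
    rw [Finset.sum_const_zero, notMem_support_iff.mp hB, zero_smul]

end CoeffAlong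

/-! ### Step 2 infrastructure: top and next-to-top slices of `∏ (A_i + B_i)^{e_i}` -/

section TopNext

variable (w : Fin n → ℕ)

/-- `Bdd w c E R`: every monomial of `R` has `w`-weight at most `E − c` (bookkeeping of Taylor
remainders). [folklore] -/
private def Bdd (c E : ℕ) (R : MvPolynomial (Fin n) k) : Prop :=
  ∀ d ∈ R.support, weight w d + c ≤ E

variable {w}

/-- `0` is bounded. [folklore] -/
private theorem bdd_zero (c E : ℕ) : Bdd (k := k) w c E 0 := fun d hd => by simp at hd

/-- Weakening the bound. [folklore] -/
private theorem Bdd.mono {c c' E : ℕ} {R : MvPolynomial (Fin n) k} (h : Bdd w c E R) (hc : c' ≤ c) :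
    Bdd w c' E R := fun d hd => le_trans (Nat.add_le_add_left hc _) (h d hd)

/-- Sums of bounded polynomials. [folklore] -/
private theorem Bdd.add {c E : ℕ} {Q R : MvPolynomial (Fin n) k} (hQ : Bdd w c E Q) (hR : Bdd w c E R) :
    Bdd w c E (Q + R) := fun d hd => by
  classical
  rcases Finset.mem_union.mp (support_add hd) with h | h
  · exact hQ d h
  · exact hR d h

/-- Finite sums of bounded polynomials. [folklore] -/
private theorem Bdd.sum {ι : Type*} {c E : ℕ} (s : Finset ι) {Q : ι → MvPolynomial (Fin n) k}
    (h : ∀ i ∈ s, Bdd w c E (Q i)) : Bdd w c E (∑ i ∈ s, Q i) := by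
  classical
  induction s using Finset.induction_on with
  | empty => rw [Finset.sum_empty]; exact bdd_zero c E
  | insert a s ha ih =>
    rw [Finset.sum_insert ha]
    exact (h a (Finset.mem_insert_self _ _)).add (ih fun i hi => h i (Finset.mem_insert_of_mem hi))

/-- Products of bounded polynomials (bounds add). [folklore] -/
private theorem Bdd.mul {c₁ c₂ E₁ E₂ : ℕ} {Q R : MvPolynomial (Fin n) k} (hQ : Bdd w c₁ E₁ Q)
    (hR : Bdd w c₂ E₂ R) : Bdd w (c₁ + c₂) (E₁ + E₂) (Q * R) := fun d hd => by
  classical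
  obtain ⟨a, ha, b, hb, rfl⟩ := Finset.mem_add.mp (support_mul Q R hd)
  have h1 := hQ a ha
  have h2 := hR b hb
  rw [map_add]
  omega

/-- Natural multiples of a bounded polynomial. [folklore] -/
private theorem Bdd.nsmul {c E : ℕ} {Q : MvPolynomial (Fin n) k} (hQ : Bdd w c E Q) (m : ℕ) :
    Bdd w c E (m • Q) := fun d hd => hQ d (support_smul hd)

/-- A weighted-homogeneous polynomial of weight `t ≤ E − c` is bounded. [folklore] -/
private theorem Bdd.of_isWeightedHomogeneous {t c E : ℕ} {T : MvPolynomial (Fin n) k}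
    (hT : IsWeightedHomogeneous w T t) (h : t + c ≤ E) : Bdd w c E T := fun d hd => by
  rw [hT (mem_support_iff.mp hd)]; exact h

/-- Powers of a bounded polynomial. [folklore] -/
private theorem Bdd.pow {E : ℕ} {Q : MvPolynomial (Fin n) k} (hQ : Bdd w 0 E Q) (m : ℕ) :
    Bdd w 0 (m * E) (Q ^ m) := by
  induction m with
  | zero =>
    rw [pow_zero, Nat.zero_mul]
    exact Bdd.of_isWeightedHomogeneous (isWeightedHomogeneous_one k w) le_rfl
  | succ m ih =>
    rw [pow_succ, Nat.succ_mul]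
    exact ih.mul hQ

/-- A polynomial of weight `≤ E − c` has no weighted component of weight `m > E − c`. [folklore] -/
private theorem Bdd.weightedHomogeneousComponent_eq_zero {c E m : ℕ} {R : MvPolynomial (Fin n) k}
    (hR : Bdd w c E R) (hm : E < m + c) : weightedHomogeneousComponent w m R = 0 := by
  apply weightedHomogeneousComponent_eq_zero'
  intro d hd h
  have := hR d hd; rw [h] at this; omega

/-- First-order binomial expansion with graded remainder: for `A` of weight `1` and `B` of weight
`0`, `(A + B)^e = A^e + e·B·A^{e−1} + R` with `R` of weight `≤ e − 2`. [folklore] -/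
private theorem add_pow_decomp {A B : MvPolynomial (Fin n) k} (hA : IsWeightedHomogeneous w A 1)
    (hB : IsWeightedHomogeneous w B 0) (e : ℕ) :
    ∃ R, Bdd w 2 e R ∧ (A + B) ^ e = A ^ e + e • (B * A ^ (e - 1)) + R := by
  rcases Nat.eq_zero_or_pos e with rfl | he
  · exact ⟨0, bdd_zero 2 0, by simp⟩
  obtain ⟨m, rfl⟩ := Nat.exists_eq_add_one_of_ne_zero he.ne'
  refine ⟨∑ j ∈ Finset.range m,
    A ^ j * B ^ (m + 1 - j) * (((m + 1).choose j : ℕ) : MvPolynomial (Fin n) k), ?_, ?_⟩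
  · refine Bdd.sum _ fun j hj => ?_
    have hj := Finset.mem_range.mp hj
    have h1 : IsWeightedHomogeneous w
        (A ^ j * B ^ (m + 1 - j) * (((m + 1).choose j : ℕ) : MvPolynomial (Fin n) k))
        (j • 1 + (m + 1 - j) • 0 + 0) := by
      refine ((hA.pow j).mul (hB.pow _)).mul ?_
      rw [← map_natCast C]
      exact isWeightedHomogeneous_C w _
    simp only [smul_eq_mul, mul_one, mul_zero, add_zero] at h1
    exact Bdd.of_isWeightedHomogeneous h1 (by omega)
  · rw [add_pow, Finset.sum_range_succ, Finset.sum_range_succ, Nat.choose_self,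
      Nat.choose_succ_self_right, Nat.add_sub_cancel, show m + 1 - m = 1 by omega, pow_one,
      Nat.sub_self, pow_zero, mul_one, Nat.cast_one, mul_one]
    have : A ^ m * B * ((m + 1 : ℕ) : MvPolynomial (Fin n) k) = (m + 1) • (B * A ^ m) := by
      rw [nsmul_eq_mul]; push_cast; ring
    rw [this]; ring

/-- First-order Taylor expansion of `Π_i (A_i + B_i)^{e_i}` in the weight-`0` perturbations `B_i`
(`A_i` of weight `1`), with a remainder of weight `≤ Σ e − 2`. [folklore] -/
private theorem prod_add_pow_decomp (A B : Fin n → MvPolynomial (Fin n) k) (e : Fin n → ℕ)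
    (s : Finset (Fin n)) (hA : ∀ i ∈ s, IsWeightedHomogeneous w (A i) 1)
    (hB : ∀ i ∈ s, IsWeightedHomogeneous w (B i) 0) :
    ∃ R, Bdd w 2 (∑ i ∈ s, e i) R ∧
      ∏ i ∈ s, (A i + B i) ^ e i = ∏ i ∈ s, A i ^ e i
        + ∑ i ∈ s, e i • (B i * A i ^ (e i - 1) * ∏ j ∈ s.erase i, A j ^ e j) + R := by
  classical
  induction s using Finset.induction_on with
  | empty => exact ⟨0, bdd_zero _ _, by simp⟩
  | insert a s ha ih =>
    obtain ⟨Rs, hRs, hPs⟩ := ih (fun i hi => hA i (Finset.mem_insert_of_mem hi))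
      (fun i hi => hB i (Finset.mem_insert_of_mem hi))
    obtain ⟨Ra, hRa, hPa⟩ := add_pow_decomp (hA a (Finset.mem_insert_self _ _))
      (hB a (Finset.mem_insert_self _ _)) (e a)
    -- names
    set Ta := A a ^ e a with hTa
    set Na := e a • (B a * A a ^ (e a - 1)) with hNa
    set Ts := ∏ i ∈ s, A i ^ e i with hTs
    set Ns := ∑ i ∈ s, e i • (B i * A i ^ (e i - 1) * ∏ j ∈ s.erase i, A j ^ e j) with hNs
    set Es := ∑ i ∈ s, e i with hEs
    -- weight bookkeeping
    have hTa' : IsWeightedHomogeneous w Ta (e a) := by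
      simpa using (hA a (Finset.mem_insert_self _ _)).pow (e a)
    have hTs' : IsWeightedHomogeneous w Ts Es := by
      have := IsWeightedHomogeneous.prod s (fun i => A i ^ e i) (fun i => e i • 1)
        (fun i hi => (hA i (Finset.mem_insert_of_mem hi)).pow (e i))
      simpa using this
    have hNa' : Bdd w 1 (e a) Na := by
      rcases Nat.eq_zero_or_pos (e a) with h0 | hpos
      · rw [hNa, h0, zero_smul]; exact bdd_zero _ _
      · refine Bdd.nsmul (Bdd.of_isWeightedHomogeneous (t := 0 + (e a - 1) • 1) ?_ (by simp; omega)) _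
        exact (hB a (Finset.mem_insert_self _ _)).mul ((hA a (Finset.mem_insert_self _ _)).pow _)
    have hNs' : Bdd w 1 Es Ns := by
      refine Bdd.sum _ fun i hi => ?_
      rcases Nat.eq_zero_or_pos (e i) with h0 | hpos
      · rw [h0, zero_smul]; exact bdd_zero _ _
      · refine Bdd.nsmul (Bdd.of_isWeightedHomogeneous
          (t := 0 + (e i - 1) • 1 + ∑ j ∈ s.erase i, e j • 1) ?_ ?_) _
        · exact ((hB i (Finset.mem_insert_of_mem hi)).mul
            ((hA i (Finset.mem_insert_of_mem hi)).pow _)).mul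
            (IsWeightedHomogeneous.prod (s.erase i) (fun j => A j ^ e j) (fun j => e j • 1)
              fun j hj => (hA j (Finset.mem_insert_of_mem (Finset.mem_of_mem_erase hj))).pow _)
        · simp only [smul_eq_mul, mul_one, zero_add]
          have := Finset.sum_erase_add s e hi
          omega
    have hRs' : Bdd w 2 Es Rs := hRs
    have hTaB : Bdd w 0 (e a) Ta := Bdd.of_isWeightedHomogeneous hTa' le_rfl
    have hTsB : Bdd w 0 Es Ts := Bdd.of_isWeightedHomogeneous hTs' le_rfl
    refine ⟨Ta * Rs + Na * Ns + Na * Rs + Ra * Ts + Ra * Ns + Ra * Rs, ?_, ?_⟩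
    · rw [Finset.sum_insert ha]
      refine ((((Bdd.add ?_ ?_).add ?_).add ?_).add ?_).add ?_
      · exact hTaB.mul hRs'
      · exact hNa'.mul hNs'
      · exact (hNa'.mul hRs').mono (by norm_num)
      · exact hRa.mul hTsB
      · exact (hRa.mul hNs').mono (by norm_num)
      · exact (hRa.mul hRs').mono (by norm_num)
    · rw [Finset.prod_insert ha, Finset.prod_insert ha, hPa, hPs, Finset.sum_insert ha,
        Finset.erase_insert ha]
      have hmid : ∑ i ∈ s, e i • (B i * A i ^ (e i - 1) * ∏ j ∈ (insert a s).erase i, A j ^ e j)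
          = Ta * Ns := by
        rw [hNs, Finset.mul_sum]
        refine Finset.sum_congr rfl fun i hi => ?_
        rw [Finset.erase_insert_of_ne (by rintro rfl; exact ha hi),
          Finset.prod_insert (fun h => ha (Finset.mem_of_mem_erase h)), mul_smul_comm, ← hTa]
        congr 1; ring
      rw [hmid, ← hTs, ← hTa, show e a • (B a * A a ^ (e a - 1) * Ts) = Na * Ts by
        rw [hNa, smul_mul_assoc]]
      ring

/-- Natural multiples of weighted-homogeneous polynomials. [folklore] -/
private theorem isWeightedHomogeneous_nsmul {t : ℕ} {Q : MvPolynomial (Fin n) k}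
    (hQ : IsWeightedHomogeneous w Q t) (m : ℕ) : IsWeightedHomogeneous w (m • Q) t := by
  rw [nsmul_eq_mul, ← map_natCast C, ← zero_add t]
  exact (isWeightedHomogeneous_C w _).mul hQ

/-- The first-order Taylor term of `Π_i (A_i + B_i)^{e_i}` is homogeneous of weight `Σ e − 1`. [folklore] -/
private theorem isWeightedHomogeneous_next (A B : Fin n → MvPolynomial (Fin n) k) (e : Fin n → ℕ)
    (s : Finset (Fin n)) (hA : ∀ i ∈ s, IsWeightedHomogeneous w (A i) 1)
    (hB : ∀ i ∈ s, IsWeightedHomogeneous w (B i) 0) {m : ℕ} (hm : m + 1 = ∑ i ∈ s, e i) :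
    IsWeightedHomogeneous w
      (∑ i ∈ s, e i • (B i * A i ^ (e i - 1) * ∏ j ∈ s.erase i, A j ^ e j)) m := by
  classical
  refine IsWeightedHomogeneous.sum _ _ _ fun i hi => ?_
  rcases Nat.eq_zero_or_pos (e i) with h0 | hpos
  · rw [h0, zero_smul]; exact isWeightedHomogeneous_zero k w m
  · have h := ((hB i hi).mul ((hA i hi).pow (e i - 1))).mul
      (IsWeightedHomogeneous.prod (s.erase i) (fun j => A j ^ e j) (fun j => e j • 1)
        fun j hj => (hA j (Finset.mem_of_mem_erase hj)).pow _)
    have ht : 0 + (e i - 1) • 1 + ∑ j ∈ s.erase i, e j • 1 = m := by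
      simp only [smul_eq_mul, mul_one, zero_add]
      have := Finset.sum_erase_add s e hi
      omega
    rw [ht] at h
    exact isWeightedHomogeneous_nsmul h _

/-- Top weight component of `Π_i (A_i + B_i)^{e_i}` (`A_i` of weight `1`, `B_i` of weight `0`):
`Π_i A_i^{e_i}`. [folklore] -/
private theorem weightedHomogeneousComponent_prod_top (A B : Fin n → MvPolynomial (Fin n) k)
    (e : Fin n → ℕ) (s : Finset (Fin n)) (hA : ∀ i ∈ s, IsWeightedHomogeneous w (A i) 1)
    (hB : ∀ i ∈ s, IsWeightedHomogeneous w (B i) 0) :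
    weightedHomogeneousComponent w (∑ i ∈ s, e i) (∏ i ∈ s, (A i + B i) ^ e i)
      = ∏ i ∈ s, A i ^ e i := by
  classical
  obtain ⟨R, hR, hP⟩ := prod_add_pow_decomp A B e s hA hB
  have hT : IsWeightedHomogeneous w (∏ i ∈ s, A i ^ e i) (∑ i ∈ s, e i) := by
    have := IsWeightedHomogeneous.prod s (fun i => A i ^ e i) (fun i => e i • 1)
      (fun i hi => (hA i hi).pow (e i))
    simpa using this
  rw [hP, map_add, map_add, hT.weightedHomogeneousComponent_same,
    hR.weightedHomogeneousComponent_eq_zero (by omega), add_zero]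
  rcases Nat.eq_zero_or_pos (∑ i ∈ s, e i) with h0 | hpos
  · -- all exponents vanish: the next slice is literally zero
    have : ∑ i ∈ s, e i • (B i * A i ^ (e i - 1) * ∏ j ∈ s.erase i, A j ^ e j) = 0 := by
      refine Finset.sum_eq_zero fun i hi => ?_
      have : e i = 0 := by
        have := Finset.sum_eq_zero_iff.mp h0 i hi; exact this
      rw [this, zero_smul]
    rw [this, map_zero, add_zero]
  · obtain ⟨m, hm⟩ := Nat.exists_eq_add_one_of_ne_zero hpos.ne'
    rw [(isWeightedHomogeneous_next A B e s hA hB hm.symm).weightedHomogeneousComponent_ne _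
      (by omega), add_zero]

/-- Next-to-top weight component of `Π_i (A_i + B_i)^{e_i}`: the first-order Taylor term
`Σ_i e_i · B_i A_i^{e_i − 1} Π_{j ≠ i} A_j^{e_j}`. [folklore] -/
private theorem weightedHomogeneousComponent_prod_next (A B : Fin n → MvPolynomial (Fin n) k)
    (e : Fin n → ℕ) (s : Finset (Fin n)) (hA : ∀ i ∈ s, IsWeightedHomogeneous w (A i) 1)
    (hB : ∀ i ∈ s, IsWeightedHomogeneous w (B i) 0) {m : ℕ} (hm : m + 1 = ∑ i ∈ s, e i) :
    weightedHomogeneousComponent w m (∏ i ∈ s, (A i + B i) ^ e i)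
      = ∑ i ∈ s, e i • (B i * A i ^ (e i - 1) * ∏ j ∈ s.erase i, A j ^ e j) := by
  classical
  obtain ⟨R, hR, hP⟩ := prod_add_pow_decomp A B e s hA hB
  have hT : IsWeightedHomogeneous w (∏ i ∈ s, A i ^ e i) (∑ i ∈ s, e i) := by
    have := IsWeightedHomogeneous.prod s (fun i => A i ^ e i) (fun i => e i • 1)
      (fun i hi => (hA i hi).pow (e i))
    simpa using this
  rw [hP, map_add, map_add, hT.weightedHomogeneousComponent_ne _ (by omega),
    (isWeightedHomogeneous_next A B e s hA hB hm).weightedHomogeneousComponent_same,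
    hR.weightedHomogeneousComponent_eq_zero (by omega), zero_add, add_zero]

/-- `Π_i (A_i + B_i)^{e_i}` has no component above the top weight `Σ e`. [folklore] -/
private theorem weightedHomogeneousComponent_prod_eq_zero_of_lt (A B : Fin n → MvPolynomial (Fin n) k)
    (e : Fin n → ℕ) (s : Finset (Fin n)) (hA : ∀ i ∈ s, IsWeightedHomogeneous w (A i) 1)
    (hB : ∀ i ∈ s, IsWeightedHomogeneous w (B i) 0) {m : ℕ} (hm : ∑ i ∈ s, e i < m) :
    weightedHomogeneousComponent w m (∏ i ∈ s, (A i + B i) ^ e i) = 0 := by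
  classical
  have : Bdd w 0 (∑ i ∈ s, e i * 1) (∏ i ∈ s, (A i + B i) ^ e i) := by
    induction s using Finset.induction_on with
    | empty =>
      simp only [Finset.prod_empty, Finset.sum_empty]
      exact Bdd.of_isWeightedHomogeneous (isWeightedHomogeneous_one k w) le_rfl
    | insert a t ha ih =>
      rw [Finset.prod_insert ha, Finset.sum_insert ha]
      exact (Bdd.pow ((Bdd.of_isWeightedHomogeneous (hA a (Finset.mem_insert_self _ _)) le_rfl).add
        (Bdd.of_isWeightedHomogeneous (hB a (Finset.mem_insert_self _ _)) zero_le_one)) _).mul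
        (ih (fun i hi => hA i (Finset.mem_insert_of_mem hi))
          (fun i hi => hB i (Finset.mem_insert_of_mem hi))
          (lt_of_le_of_lt (Finset.sum_le_sum_of_subset_of_nonneg (Finset.subset_insert a t)
            (fun _ _ _ => Nat.zero_le _)) hm))
  simp only [mul_one] at this
  exact this.weightedHomogeneousComponent_eq_zero (by omega)

end TopNext

/-! ### Step 4/5 infrastructure: chain rule for `pderiv ∘ aeval`, dual functionals -/

section Chain

/-- Chain rule for `pderiv` through `aeval`: `∂_l (H(L)) = Σ_i (∂_i H)(L) · ∂_l L_i`. [folklore] -/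
private theorem pderiv_aeval_eq_sum (L : Fin n → MvPolynomial (Fin n) k) (H : MvPolynomial (Fin n) k)
    (l : Fin n) :
    pderiv l (aeval L H) = ∑ i, aeval L (pderiv i H) * pderiv l (L i) := by
  classical
  induction H using MvPolynomial.induction_on with
  | C a => simp
  | add p q hp hq => simp only [map_add, hp, hq, add_mul, Finset.sum_add_distrib]
  | mul_X p i hp =>
    have key : ∀ x, aeval L (pderiv x (p * X i)) * pderiv l (L x) =
        L i * (aeval L (pderiv x p) * pderiv l (L x)) +
          (if i = x then aeval L p * pderiv l (L x) else 0) := by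
      intro x
      rw [Derivation.leibniz, smul_eq_mul, smul_eq_mul, pderiv_X, Pi.single_apply, map_add,
        map_mul, map_mul, aeval_X]
      split_ifs with h1
      · simp; ring
      · simp; ring
    rw [Finset.sum_congr rfl fun x _ => key x, Finset.sum_add_distrib, Finset.sum_ite_eq,
      if_pos (Finset.mem_univ _), ← Finset.mul_sum, ← hp, map_mul, aeval_X, Derivation.leibniz,
      smul_eq_mul, smul_eq_mul]
    ring

/-- Dual functionals to a linearly independent finite family over a field. [folklore] -/
private theorem exists_dual_eq_ite {ι V : Type*} [Fintype ι] [DecidableEq ι] [AddCommGroup V] [Module k V]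
    {D : ι → V} (hD : LinearIndependent k D) (i₁ : ι) :
    ∃ g : V →ₗ[k] k, ∀ i, g (D i) = if i = i₁ then 1 else 0 := by
  obtain ⟨g, hg⟩ := LinearMap.exists_extend ((Finsupp.lapply i₁).comp hD.repr)
  refine ⟨g, fun i => ?_⟩
  have hmem : D i ∈ Submodule.span k (Set.range D) := Submodule.subset_span ⟨i, rfl⟩
  have := LinearMap.congr_fun hg ⟨D i, hmem⟩
  simp only [LinearMap.coe_comp, Submodule.coe_subtype, Function.comp_apply] at this
  rw [this, hD.repr_eq_single i ⟨D i, hmem⟩ rfl, Finsupp.lapply_apply, Finsupp.single_apply]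

/-- A finite family whose span contains a linearly independent family indexed by the same finite
type is itself linearly independent (dimension count). [folklore] -/
private theorem linearIndependent_of_span_le {ι V : Type*} [Fintype ι] [AddCommGroup V] [Module k V]
    {D F : ι → V} (hF : LinearIndependent k F)
    (hle : ∀ l, F l ∈ Submodule.span k (Set.range D)) : LinearIndependent k D := by
  rw [linearIndependent_iff_card_eq_finrank_span]
  refine le_antisymm ?_ (finrank_range_le_card D)
  have h1 : Submodule.span k (Set.range F) ≤ Submodule.span k (Set.range D) :=
    Submodule.span_le.mpr (by rintro _ ⟨l, rfl⟩; exact hle l)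
  haveI : Module.Finite k (Submodule.span k (Set.range D)) :=
    FiniteDimensional.span_of_finite k (Set.finite_range D)
  calc Fintype.card ι = Module.finrank k (Submodule.span k (Set.range F)) :=
        (finrank_span_eq_card hF).symm
    _ ≤ Module.finrank k (Submodule.span k (Set.range D)) := Submodule.finrank_mono h1

end Chain

/-! ## 10. The twisted count for general `τ`

[CJS20 Thm. 8.16 / Def. 8.13 setting; ours, in the model]  For `|S| = τ ≥ 1` arbitrary we compare
the `X_S`-degree-`ν` and `-(ν-1)` slices of the identity `in_δ f = (in_w Ψ⁻¹f)(in_w z)` of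
`deltaInitial_eq_aeval_of_isCentreFor`.  The degree-`ν` slice gives `in_ν f = H_ν(Lin)` (the
initial form transported by the linear part of the `y'`-block); the degree-`(ν-1)` slice is the
first-order Taylor term `Σ_i Φ_i · (∂_i H_ν)(Lin)` plus a polynomial over `k[X_S] ⊗ k[T(Ψ,γ)]`,
and it vanishes when `f` has no `δ`-face monomial of `y`-degree `ν - 1` (Tschirnhaus-normalised
face).  If the partials `∂_l in_ν f` (`l ∈ S`) are linearly independent — automatic for `τ = 1`,
`ν ∈ kˣ` — coefficient extraction along `k[X_S]` with dual functionals shows every twist `Φ_i`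
lies in `k[T(Ψ,γ)]`, whence the count of §9 for every centre of the class. -/

section CountGeneral

variable {f : MvPolynomial (Fin n) k} {ν : ℕ} {S : Finset (Fin n)}

/-- The `X_S`-degree-`(ν−1)` slice of `in_δ(f)` vanishes when the `δ`-face of `f` carries no
monomial of `y`-degree `ν − 1` (hypothesis (N0): the face is Tschirnhaus-normalised). (Ours, elementary.)
[cite: CossartJannsenSaito2020, Def. 8.2 (4) (p. 118)] -/
theorem weightedHomogeneousComponent_indicator_deltaInitial_eq_zero {m : ℕ} {δ : ℚ}
    (hN0 : ∀ d ∈ f.support, blockDeg S d + 1 = m + 1 → (coDeg S d : ℚ) ≠ δ) :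
    weightedHomogeneousComponent (fun i => if i ∈ S then 1 else 0) m
      (deltaInitial S (m + 1) δ f) = 0 := by
  classical
  ext d
  rw [coeff_weightedHomogeneousComponent, coeff_zero, weight_block, one_mul, zero_mul, add_zero]
  split_ifs with hd
  · rw [deltaInitial, coeff_sum_filter_monomial]
    split_ifs with hP
    · by_contra hne
      obtain ⟨_, hc⟩ := hP
      rw [hd, show m + 1 - m = 1 by omega, Nat.cast_one, mul_one] at hc
      exact hN0 d (mem_support_iff.mpr hne) (by rw [hd]) hc
    · rfl
  · rfl

/-- The `X_S`-degree-`ν` slice of `in_δ(f)` is `in_ν(f)` (when `in_ν f ∈ k[X_S]`). (Ours, elementary.)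
[cite: CossartJannsenSaito2020, Def. 8.2 (4) (p. 118), Def. 7.2/Thm. 8.7 (p. 119: `in_𝔪(f) ∈ k[Y]`)] -/
theorem weightedHomogeneousComponent_indicator_deltaInitial_eq {m : ℕ} {δ : ℚ}
    (hFS : ∀ d ∈ (homogeneousComponent (m + 1) f).support, ∀ j ∉ S, d j = 0) :
    weightedHomogeneousComponent (fun i => if i ∈ S then 1 else 0) (m + 1)
      (deltaInitial S (m + 1) δ f) = homogeneousComponent (m + 1) f := by
  classical
  ext d
  rw [coeff_weightedHomogeneousComponent, weight_block, one_mul, zero_mul, add_zero,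
    coeff_homogeneousComponent, deltaInitial, coeff_sum_filter_monomial]
  by_cases hc : coeff d f = 0
  · simp [hc]
  by_cases hgood : blockDeg S d = m + 1 ∧ coDeg S d = 0
  · obtain ⟨hb, hco⟩ := hgood
    have hdeg : d.degree = m + 1 := by rw [degree_eq_blockDeg_add_coDeg S, hb, hco, add_zero]
    rw [if_pos hb, if_pos ⟨hb.le, by rw [hb, hco, Nat.sub_self, Nat.cast_zero, mul_zero]⟩,
      if_pos hdeg]
  · have hdeg : d.degree ≠ m + 1 := by
      intro hdeg
      have hdF : d ∈ (homogeneousComponent (m + 1) f).support := by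
        rw [mem_support_iff, coeff_homogeneousComponent, if_pos hdeg]; exact hc
      have hco : coDeg S d = 0 := by
        rw [coDeg_eq_sum_univ]
        exact Finset.sum_eq_zero fun j hj => hFS d hdF j (Finset.mem_filter.mp hj).2
      apply hgood
      refine ⟨?_, hco⟩
      have := degree_eq_blockDeg_add_coDeg S d
      rw [hdeg, hco, add_zero] at this
      exact this.symm
    rw [if_neg hdeg]
    split_ifs with h1 h2
    · exfalso
      obtain ⟨_, h2⟩ := h2
      rw [h1, Nat.sub_self, Nat.cast_zero, mul_zero] at h2
      exact hgood ⟨h1, by exact_mod_cast h2⟩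
    · rfl
    · rfl

/-- An exponent of `y`-degree `0` has zero `S`-part. [folklore] -/
private theorem sPart_eq_zero_of_blockDeg_eq_zero {d : Fin n →₀ ℕ} (h : blockDeg S d = 0) :
    sPart S d = 0 := by
  classical
  rw [blockDeg_eq_sum_univ, Finset.sum_eq_zero_iff] at h
  ext i
  by_cases hi : i ∈ S
  · have := h i hi
    simp [sPart, hi, this]
  · simp [sPart, hi]

/-- An exponent of `u`-degree `0` has zero `u`-part. [folklore] -/
private theorem uPart_eq_zero_of_coDeg_eq_zero {d : Fin n →₀ ℕ} (h : coDeg S d = 0) :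
    uPart S d = 0 := by
  classical
  rw [coDeg_eq_sum_univ, Finset.sum_eq_zero_iff] at h
  ext i
  by_cases hi : i ∈ S
  · simp [uPart, hi]
  · have := h i (Finset.mem_filter.mpr ⟨Finset.mem_univ _, hi⟩)
    simp [uPart, hi, this]

/-- A polynomial of `X_S`-degree `0` lies in `k[X_{Sᶜ}]` (exponentwise). [folklore] -/
private theorem sPart_eq_zero_of_isWeightedHomogeneous {P : MvPolynomial (Fin n) k}
    (hP : IsWeightedHomogeneous (fun i => if i ∈ S then 1 else 0) P 0) :
    ∀ d ∈ P.support, sPart S d = 0 := fun d hd => by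
  apply sPart_eq_zero_of_blockDeg_eq_zero
  have := hP (mem_support_iff.mp hd)
  rw [weight_block] at this
  omega

/-- A polynomial of `X_{Sᶜ}`-degree `0` lies in `k[X_S]` (exponentwise). [folklore] -/
private theorem uPart_eq_zero_of_isWeightedHomogeneous {P : MvPolynomial (Fin n) k}
    (hP : IsWeightedHomogeneous (fun i => if i ∈ S then 0 else 1) P 0) :
    ∀ d ∈ P.support, uPart S d = 0 := fun d hd => by
  apply uPart_eq_zero_of_coDeg_eq_zero
  have := hP (mem_support_iff.mp hd)
  rw [weight_block] at this
  omega

/-- Evaluating an `S`-supported monomial: `(c X^d)(L) = c Π_{i ∈ S} L_i^{d_i}`. [folklore] -/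
private theorem aeval_monomial_of_supported (Lin : Fin n → MvPolynomial (Fin n) k) {d : Fin n →₀ ℕ}
    (hd : ∀ j ∉ S, d j = 0) (c : k) :
    aeval Lin (monomial d c) = C c * ∏ i ∈ S, Lin i ^ d i := by
  classical
  rw [aeval_monomial, algebraMap_eq, Finsupp.prod_fintype _ _ (fun i => by rw [pow_zero])]
  congr 1
  rw [← Finset.prod_filter_mul_prod_filter_not Finset.univ (· ∈ S)]
  have h1 : Finset.univ.filter (· ∈ S) = S := by ext i; simp
  rw [h1, Finset.prod_eq_one (s := Finset.univ.filter (· ∉ S)) fun j hj => by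
    rw [hd j (Finset.mem_filter.mp hj).2, pow_zero], mul_one]

/-- One first-order Taylor term: `c · d_i Φ_i L^{d − e_i} = Φ_i · (∂_i (c X^d))(L)`. [folklore] -/
private theorem taylor_term_eq (Lin Φ : Fin n → MvPolynomial (Fin n) k) {d : Fin n →₀ ℕ}
    (hd : ∀ j ∉ S, d j = 0) (c : k) {i : Fin n} (hi : i ∈ S) :
    C c * (d i • (Φ i * Lin i ^ (d i - 1) * ∏ j ∈ S.erase i, Lin j ^ d j))
      = Φ i * aeval Lin (pderiv i (monomial d c)) := by
  classical
  have hd' : ∀ j ∉ S, (d - Finsupp.single i 1 : Fin n →₀ ℕ) j = 0 := fun j hj => by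
    rw [Finsupp.tsub_apply, hd j hj, Nat.zero_sub]
  rw [pderiv_monomial, aeval_monomial_of_supported Lin hd', ← Finset.mul_prod_erase S _ hi]
  have hP : ∏ j ∈ S.erase i, Lin j ^ (d - Finsupp.single i 1 : Fin n →₀ ℕ) j =
      ∏ j ∈ S.erase i, Lin j ^ d j :=
    Finset.prod_congr rfl fun j hj => by
      rw [Finsupp.tsub_apply, Finsupp.single_eq_of_ne (Finset.ne_of_mem_erase hj), Nat.sub_zero]
  rw [hP, Finsupp.tsub_apply, Finsupp.single_eq_same, map_mul, map_natCast, nsmul_eq_mul]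
  ring

/-- The first-order Taylor terms, summed: `Σ_d c_d N_d = Σ_{i ∈ S} Φ_i · (∂_i H)(L)`. [folklore] -/
private theorem sum_taylor_terms_eq (Lin Φ : Fin n → MvPolynomial (Fin n) k) (T : Finset (Fin n →₀ ℕ))
    (c : (Fin n →₀ ℕ) → k) (hT : ∀ d ∈ T, ∀ j ∉ S, d j = 0) :
    ∑ d ∈ T, C (c d) * ∑ i ∈ S, d i • (Φ i * Lin i ^ (d i - 1) * ∏ j ∈ S.erase i, Lin j ^ d j)
      = ∑ i ∈ S, Φ i * aeval Lin (pderiv i (∑ d ∈ T, monomial d (c d))) := by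
  classical
  have h1 : ∀ i ∈ S, Φ i * aeval Lin (pderiv i (∑ d ∈ T, monomial d (c d))) =
      ∑ d ∈ T, Φ i * aeval Lin (pderiv i (monomial d (c d))) := fun i _ => by
    rw [map_sum, map_sum, Finset.mul_sum]
  rw [Finset.sum_congr rfl h1, Finset.sum_comm]
  refine Finset.sum_congr rfl fun d hd => ?_
  rw [Finset.mul_sum]
  exact Finset.sum_congr rfl fun i hi => taylor_term_eq Lin Φ (hT d hd) (c d) hi

/-- **The twists are polynomials in the competitor's forms (general `τ`).** Let `ν = ord f`,
`in_ν f ∈ k[X_S]`, `|S| = τ(in_ν f)`, `(f; X_S; X_{Sᶜ})` `δ`-prepared with `δ = δ(f;u;y)`; assume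
(N0) `f` has no monomial `y^B U^A` with `|B| = ν − 1`, `|A| = δ` (the `δ`-face is Tschirnhaus-normalised)
and (IND) the partials `∂_l in_ν f`, `l ∈ S`, are linearly independent over `k` (automatic for
`τ = 1`, `ν ∈ kˣ`: `linearIndependent_pderiv_of_tau_eq_one`; in characteristic `p` it excludes e.g.
`in_ν f = y₁^p y₂²`). Then for every centre `(Ψ; γ)` for `f` with `γ = 1/ν` on `S` and `γ ≤ 1/(νδ)`
off `S`, every pure-`u` degree-`δ` part `Φ_i` of `z_i = Ψ(X_i)` (`i ∈ S`) lies in `k[T(Ψ, γ)]`.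
Proof: grade `in_δ(f) = H(Lin + Φ, ℓ(u))` (`deltaInitial_eq_aeval_of_isCentreFor`) by `X_S`-degree;
the degree-`ν` slice is `in_ν f = H_ν(Lin)`, the degree-`(ν−1)` slice reads
`0 = Σ_{i ∈ S} Φ_i · (∂_i H_ν)(Lin) + (polynomial over k[X_S] ⊗ k[T])`; by the chain rule the
`(∂_i H_ν)(Lin)` span the `∂_l in_ν f`, hence are independent, and coefficient extraction along
`k[X_S]` against dual functionals isolates each `Φ_i` in `k[T(Ψ, γ)]`. (Ours, in the model; the
solutions `λ_B = c U^A` of Thm. 8.22 (a) are what a twist not of this form would produce.)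
[cite: CossartJannsenSaito2020, Thm. 8.16 (p. 121), Def. 8.13 (pp. 120–121), Thm. 8.22 (a) (p. 124); Hironaka1967, Thm. (4.8)] -/
theorem uHomogeneousPart_mem_linearFormsSubalgebra_of_linearIndependent
    (hord : monomialOrd (fun _ => 1) f = ν)
    (hτ : S.card = hironakaTau k {homogeneousComponent ν f})
    (hFS : ∀ d ∈ (homogeneousComponent ν f).support, ∀ j ∉ S, d j = 0)
    (hprep : IsDeltaPrepared S ν f) {δ : ℚ} (hδ : hironakaDelta S ν f = δ)
    (hN0 : ∀ d ∈ f.support, blockDeg S d + 1 = ν → (coDeg S d : ℚ) ≠ δ)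
    (hind : LinearIndependent k fun l : ↥S => pderiv (l : Fin n) (homogeneousComponent ν f))
    {Ψ : MvPolynomial (Fin n) k ≃ₐ[k] MvPolynomial (Fin n) k} {γ : Fin n → ℚ}
    (h : IsCentreFor f Ψ γ) (hγS : ∀ i ∈ S, γ i = (ν : ℚ)⁻¹)
    (hγle : ∀ j ∉ S, γ j ≤ ((ν : ℚ) * δ)⁻¹) :
    ∀ i ∈ S, uHomogeneousPart S δ (Ψ (X i)) ∈
      linearFormsSubalgebra k (competitorSpan S ν δ Ψ γ) := by
  classical
  have hν : 0 < ν := nu_pos_of_hironakaDelta_eq hδ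
  obtain ⟨m, rfl⟩ := Nat.exists_eq_add_one_of_ne_zero hν.ne'
  have hδ1 : 1 < δ := one_lt_hironakaDelta hord hFS hδ
  have hδpos : 0 < δ := one_pos.trans hδ1
  obtain ⟨p, q, hqpos, hpq⟩ := exists_eq_mul_den hδpos
  have hqq : (0 : ℚ) < q := by exact_mod_cast hqpos
  have hqp : q < p := by
    have : (q : ℚ) < p := by rw [hpq]; nlinarith
    exact_mod_cast this
  have hppos : 0 < p := lt_of_le_of_lt (Nat.zero_le _) hqp
  obtain ⟨h1, h2, -, -⟩ :=
    deltaInitial_eq_aeval_of_isCentreFor hord hτ hFS hprep hδ hqpos hpq h hγS hγle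
  set A := linearFormsSubalgebra k (competitorSpan S (m + 1) δ Ψ γ) with hA
  set Φ : Fin n → MvPolynomial (Fin n) k := fun i => uHomogeneousPart S δ (Ψ (X i)) with hΦdef
  set Lin : Fin n → MvPolynomial (Fin n) k := fun i =>
    if i ∈ S then ∑ l ∈ S, C (coeff (Finsupp.single l 1) (Ψ (X i))) * X l else 0 with hLin
  set L : Fin n → MvPolynomial (Fin n) k := fun j => linearFormPoly k (uLinearForm S (Ψ (X j)))
    with hL
  set Hc := weightedHomogeneousComponent (fun i => if i ∈ S then p else q) ((m + 1) * p) (Ψ.symm f)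
    with hHc
  set θ : Fin n → MvPolynomial (Fin n) k := fun i => weightedHomogeneousComponent
    (fun j => if j ∈ S then p else q) (if i ∈ S then p else q) (Ψ (X i)) with hθ
  have hθS : ∀ i ∈ S, θ i = Lin i + Φ i := fun i hi => by
    simp only [hθ, hLin, if_pos hi]
    rw [weightedHomogeneousComponent_high_eq hqp hqpos hpq]
  have hθj : ∀ j, j ∉ S → θ j = L j := fun j hjS => by
    simp only [hθ, hL, if_neg hjS]
    exact weightedHomogeneousComponent_low_eq hqp hqpos _
  -- the two gradings: `w'` = `X_S`-degree, `w''` = `u`-degree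
  set w' : Fin n → ℕ := fun i => if i ∈ S then 1 else 0 with hw'
  set w'' : Fin n → ℕ := fun i => if i ∈ S then 0 else 1 with hw''
  have hLinhom : ∀ i, IsWeightedHomogeneous w' (Lin i) 1 := by
    intro i
    simp only [hLin]
    split_ifs with hi
    · refine IsWeightedHomogeneous.sum _ _ 1 fun l hl => ?_
      have := (isWeightedHomogeneous_X k w' l).C_mul (coeff (Finsupp.single l 1) (Ψ (X i)))
      simpa [hw', hl] using this
    · exact isWeightedHomogeneous_zero k w' 1
  have hLinU : ∀ Q : MvPolynomial (Fin n) k, IsWeightedHomogeneous w'' (aeval Lin Q) 0 := by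
    have hgen : ∀ i, IsWeightedHomogeneous w'' (Lin i) 0 := by
      intro i
      simp only [hLin]
      split_ifs with hi
      · refine IsWeightedHomogeneous.sum _ _ 0 fun l hl => ?_
        have := (isWeightedHomogeneous_X k w'' l).C_mul (coeff (Finsupp.single l 1) (Ψ (X i)))
        simpa [hw'', hl] using this
      · exact isWeightedHomogeneous_zero k w'' 0
    intro Q
    induction Q using MvPolynomial.induction_on with
    | C a => rw [aeval_C, algebraMap_eq]; exact isWeightedHomogeneous_C w'' a
    | add p' q' hp hq => rw [map_add]; exact hp.add hq
    | mul_X p' i hp => rw [map_mul, aeval_X, ← add_zero (0 : ℕ)]; exact hp.mul (hgen i)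
  have hΦhom : ∀ i, IsWeightedHomogeneous w' (Φ i) 0 := by
    intro i d hd
    simp only [hΦdef, uHomogeneousPart, coeff_sum_filter_monomial] at hd
    have hPd : blockDeg S d = 0 ∧ (d.degree : ℚ) = δ := by
      by_contra h'; exact hd (if_neg h')
    rw [hw', weight_block, hPd.1]; simp
  have hLhom : ∀ j, IsWeightedHomogeneous w' (L j) 0 := by
    intro j
    simp only [hL]
    rw [linearFormPoly_uLinearForm]
    refine IsWeightedHomogeneous.sum _ _ 0 fun l hl => ?_
    have hl : l ∉ S := (Finset.mem_filter.mp hl).2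
    have := (isWeightedHomogeneous_X k w' l).C_mul (coeff (Finsupp.single l 1) (Ψ (X j)))
    simpa [hw', hl] using this
  set U : (Fin n →₀ ℕ) → MvPolynomial (Fin n) k :=
    fun d => ∏ j ∈ Finset.univ.filter (· ∉ S), L j ^ d j with hU
  have hUhom : ∀ d, IsWeightedHomogeneous w' (U d) 0 := by
    intro d
    have := IsWeightedHomogeneous.prod (Finset.univ.filter (· ∉ S)) (fun j => L j ^ d j)
      (fun _ => 0) fun j _ => by simpa using (hLhom j).pow (d j)
    simpa using this
  have hU1 : ∀ d : Fin n →₀ ℕ, coDeg S d = 0 → U d = 1 := fun d hd => by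
    rw [coDeg_eq_sum_univ, Finset.sum_eq_zero_iff] at hd
    exact Finset.prod_eq_one fun j hj => by rw [hd j hj, pow_zero]
  have hUmem : ∀ d ∈ Hc.support, U d ∈ A := by
    intro d hd
    refine prod_mem fun j hj => ?_
    have hjS : j ∉ S := (Finset.mem_filter.mp hj).2
    by_cases hdj : d j = 0
    · rw [hdj, pow_zero]; exact one_mem _
    · have hγj : γ j = (((m + 1 : ℕ) : ℚ) * δ)⁻¹ := by
        by_contra hne; exact hdj (h2 d hd j hjS hne)
      exact pow_mem (uLinearForm_mem_linearFormsSubalgebra_competitorSpan hjS hγj) _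
  -- expansion of `aeval θ Hc`
  have hSfilter : Finset.univ.filter (· ∈ S) = S := by ext i; simp
  have hexp : aeval θ Hc =
      ∑ d ∈ Hc.support, C (coeff d Hc) * ((∏ i ∈ S, (Lin i + Φ i) ^ d i) * U d) := by
    rw [MvPolynomial.aeval_def, MvPolynomial.eval₂_eq']
    refine Finset.sum_congr rfl fun d _ => ?_
    rw [MvPolynomial.algebraMap_eq,
      ← Finset.prod_filter_mul_prod_filter_not Finset.univ (· ∈ S), hSfilter]
    congr 2
    · exact Finset.prod_congr rfl fun i hi => by rw [hθS i hi]
    · exact Finset.prod_congr rfl fun j hj => by rw [hθj j (Finset.mem_filter.mp hj).2]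
  have hcomp : ∀ t, weightedHomogeneousComponent w' t (aeval θ Hc) =
      ∑ d ∈ Hc.support, C (coeff d Hc) *
        (weightedHomogeneousComponent w' t (∏ i ∈ S, (Lin i + Φ i) ^ d i) * U d) := by
    intro t
    rw [hexp, map_sum]
    refine Finset.sum_congr rfl fun d _ => ?_
    rw [weightedHomogeneousComponent_C_mul,
      weightedHomogeneousComponent_mul_of_isWeightedHomogeneous_zero (hUhom d)]
  -- the support of `Hc`
  have hHcw : ∀ d ∈ Hc.support, p * blockDeg S d + q * coDeg S d = (m + 1) * p := by
    intro d hd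
    rw [mem_support_iff, hHc, coeff_weightedHomogeneousComponent] at hd
    have : weight (fun i => if i ∈ S then p else q) d = (m + 1) * p := by
      by_contra hne; exact hd (if_neg hne)
    rwa [weight_block] at this
  have hbν : ∀ d ∈ Hc.support, blockDeg S d ≤ m + 1 := by
    intro d hd
    have := hHcw d hd
    have h1 : p * blockDeg S d ≤ p * (m + 1) := by rw [Nat.mul_comm p (m + 1)]; omega
    exact Nat.le_of_mul_le_mul_left h1 hppos
  have hco0 : ∀ d ∈ Hc.support, blockDeg S d = m + 1 → coDeg S d = 0 := by
    intro d hd hb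
    have := hHcw d hd
    rw [hb, Nat.mul_comm p (m + 1)] at this
    have h0 : q * coDeg S d = 0 := by omega
    rcases Nat.mul_eq_zero.mp h0 with h | h
    · omega
    · exact h
  have hsuppS : ∀ d ∈ Hc.support, blockDeg S d = m + 1 → ∀ j ∉ S, d j = 0 := by
    intro d hd hb j hj
    have := hco0 d hd hb
    rw [coDeg_eq_sum_univ, Finset.sum_eq_zero_iff] at this
    exact this j (Finset.mem_filter.mpr ⟨Finset.mem_univ _, hj⟩)
  have hbS : ∀ d : Fin n →₀ ℕ, ∑ i ∈ S, d i = blockDeg S d := fun d =>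
    (blockDeg_eq_sum_univ S d).symm
  -- `H_ν` and the transported initial form
  set T := Hc.support.filter (fun d => blockDeg S d = m + 1) with hT
  set Hν := ∑ d ∈ T, monomial d (coeff d Hc) with hHν
  have hTsupp : ∀ d ∈ T, ∀ j ∉ S, d j = 0 := fun d hd =>
    hsuppS d (Finset.mem_filter.mp hd).1 (Finset.mem_filter.mp hd).2
  have haevalHν : aeval Lin Hν = ∑ d ∈ T, C (coeff d Hc) * ∏ i ∈ S, Lin i ^ d i := by
    rw [hHν, map_sum]
    exact Finset.sum_congr rfl fun d hd => aeval_monomial_of_supported Lin (hTsupp d hd) _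
  -- degree `m + 1`: `in_ν f = H_ν(Lin)`
  have hF : homogeneousComponent (m + 1) f = aeval Lin Hν := by
    rw [← weightedHomogeneousComponent_indicator_deltaInitial_eq hFS, h1, hcomp (m + 1),
      haevalHν, hT, Finset.sum_filter]
    refine Finset.sum_congr rfl fun d hd => ?_
    by_cases hb : blockDeg S d = m + 1
    · rw [if_pos hb, ← hb, ← hbS d,
        weightedHomogeneousComponent_prod_top Lin Φ (⇑d) S (fun i _ => hLinhom i)
          (fun i _ => hΦhom i), hU1 d (hco0 d hd hb), mul_one]
    · rw [if_neg hb, weightedHomogeneousComponent_prod_eq_zero_of_lt Lin Φ (⇑d) S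
        (fun i _ => hLinhom i) (fun i _ => hΦhom i) (by rw [hbS]; have := hbν d hd; omega),
        zero_mul, mul_zero]
  -- degree `m`: `0 = Σ_i Φ_i (∂_i H_ν)(Lin) + Rest`
  set D : Fin n → MvPolynomial (Fin n) k := fun i => aeval Lin (pderiv i Hν) with hD
  set Rest := ∑ d ∈ Hc.support.filter (fun d => blockDeg S d = m),
    C (coeff d Hc) * ((∏ i ∈ S, Lin i ^ d i) * U d) with hRest
  have hslice : ∑ i ∈ S, D i * Φ i + Rest = 0 := by
    have hE := hcomp m
    rw [← h1, weightedHomogeneousComponent_indicator_deltaInitial_eq_zero hN0] at hE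
    -- split the sum according to `blockDeg S d ∈ {m + 1, m, < m}`
    have hterm : ∀ d ∈ Hc.support, C (coeff d Hc) *
        (weightedHomogeneousComponent w' m (∏ i ∈ S, (Lin i + Φ i) ^ d i) * U d) =
        (if blockDeg S d = m + 1 then C (coeff d Hc) *
          ∑ i ∈ S, d i • (Φ i * Lin i ^ (d i - 1) * ∏ j ∈ S.erase i, Lin j ^ d j) else 0) +
        (if blockDeg S d = m then C (coeff d Hc) * ((∏ i ∈ S, Lin i ^ d i) * U d) else 0) := by
      intro d hd
      by_cases hb : blockDeg S d = m + 1
      · rw [if_pos hb, if_neg (by omega),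
          weightedHomogeneousComponent_prod_next Lin Φ (⇑d) S (fun i _ => hLinhom i)
            (fun i _ => hΦhom i) (by rw [hbS, hb]), hU1 d (hco0 d hd hb), mul_one, add_zero]
      · by_cases hb' : blockDeg S d = m
        · rw [if_neg hb, if_pos hb', zero_add, ← hb', ← hbS d,
            weightedHomogeneousComponent_prod_top Lin Φ (⇑d) S (fun i _ => hLinhom i)
              (fun i _ => hΦhom i)]
        · rw [if_neg hb, if_neg hb', add_zero,
            weightedHomogeneousComponent_prod_eq_zero_of_lt Lin Φ (⇑d) S (fun i _ => hLinhom i)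
              (fun i _ => hΦhom i) (by rw [hbS]; have := hbν d hd; omega), zero_mul, mul_zero]
    rw [Finset.sum_congr rfl hterm, Finset.sum_add_distrib, ← Finset.sum_filter,
      ← Finset.sum_filter] at hE
    rw [hE]
    congr 1
    have key := sum_taylor_terms_eq Lin Φ T (fun d => coeff d Hc) hTsupp
    rw [← hT, key]
    exact Finset.sum_congr rfl fun i _ => mul_comm _ _
  -- linear independence of the `D_i`, `i ∈ S`
  have hDind : LinearIndependent k fun i : ↥S => D i := by
    refine linearIndependent_of_span_le (F := fun l : ↥S =>
      pderiv (l : Fin n) (homogeneousComponent (m + 1) f)) hind fun l => ?_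
    have hchain : pderiv (l : Fin n) (homogeneousComponent (m + 1) f) =
        ∑ i ∈ S, coeff (Finsupp.single (l : Fin n) 1) (Ψ (X i)) • D i := by
      rw [hF, pderiv_aeval_eq_sum, ← Finset.sum_filter_add_sum_filter_not Finset.univ (· ∈ S),
        hSfilter, Finset.sum_eq_zero (s := Finset.univ.filter (· ∉ S)) fun j hj => by
          simp only [hLin, if_neg (Finset.mem_filter.mp hj).2, map_zero, mul_zero], add_zero]
      refine Finset.sum_congr rfl fun i hi => ?_
      simp only [hD, hLin, if_pos hi, map_sum, pderiv_C_mul, pderiv_X, Pi.single_apply]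
      rw [Finset.sum_eq_single (l : Fin n) (fun l' _ hl' => by rw [if_neg hl', mul_zero])
        (fun hl => absurd l.2 hl), if_pos rfl, mul_one, smul_eq_C_mul, mul_comm]
    rw [hchain]
    refine Submodule.sum_mem _ fun i hi => Submodule.smul_mem _ _ ?_
    exact Submodule.subset_span ⟨⟨i, hi⟩, rfl⟩
  -- extraction
  intro i₁ hi₁
  obtain ⟨g, hg⟩ := exists_dual_eq_ite hDind ⟨i₁, hi₁⟩
  set FIN := S.biUnion fun i => (D i).support with hFIN
  set Eg : MvPolynomial (Fin n) k →ₗ[k] MvPolynomial (Fin n) k :=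
    ∑ B ∈ FIN, g (monomial B 1) • coeffAlong S B with hEg
  have hEg_apply : ∀ P, Eg P = ∑ B ∈ FIN, g (monomial B 1) • coeffAlong S B P := fun P => by
    simp only [hEg, LinearMap.sum_apply, LinearMap.smul_apply]
  have hDsupp : ∀ i, ∀ d ∈ (D i).support, uPart S d = 0 := fun i =>
    uPart_eq_zero_of_isWeightedHomogeneous (hLinU _)
  have hΦsupp : ∀ i, ∀ d ∈ (Φ i).support, sPart S d = 0 := fun i =>
    sPart_eq_zero_of_isWeightedHomogeneous (hΦhom i)
  have hEgD : ∀ i ∈ S, Eg (D i * Φ i) = g (D i) • Φ i := by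
    intro i hi
    rw [hEg_apply]
    simp_rw [coeffAlong_mul_of_supported S (hDsupp i) (hΦsupp i), smul_smul]
    rw [← Finset.sum_smul]
    congr 1
    have hDi : D i = ∑ B ∈ FIN, coeff B (D i) • (monomial B (1 : k)) := by
      conv_lhs => rw [(D i).as_sum]
      rw [Finset.sum_subset (Finset.subset_biUnion_of_mem (fun i => (D i).support) hi)]
      · exact Finset.sum_congr rfl fun B _ => by rw [smul_monomial, smul_eq_mul, mul_one]
      · intro B _ hB
        rw [notMem_support_iff.mp hB, monomial_zero]
    conv_rhs => rw [hDi, map_sum]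
    refine Finset.sum_congr rfl fun B _ => ?_
    rw [map_smul, smul_eq_mul, mul_comm]
  have hEgRest : Eg Rest ∈ A := by
    rw [hEg_apply]
    refine Subalgebra.sum_mem _ fun B _ => Subalgebra.smul_mem _ ?_ _
    rw [hRest, map_sum]
    refine Subalgebra.sum_mem _ fun d hd => ?_
    have hd' : d ∈ Hc.support := (Finset.mem_filter.mp hd).1
    rw [← mul_assoc, coeffAlong_mul_of_supported S ?_ (sPart_eq_zero_of_isWeightedHomogeneous
      (hUhom d))]
    · exact Subalgebra.smul_mem _ (hUmem d hd') _
    · apply uPart_eq_zero_of_isWeightedHomogeneous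
      rw [← zero_add (0 : ℕ)]
      refine (isWeightedHomogeneous_C w'' _).mul ?_
      have := IsWeightedHomogeneous.prod S (fun i => Lin i ^ d i) (fun _ => 0)
        fun i _ => by simpa using ((hLinU (X i)).pow (d i))
      simpa [aeval_X] using this
  have hg' : ∀ i ∈ S, g (D i) = if i = i₁ then 1 else 0 := fun i hi => by
    have := hg ⟨i, hi⟩
    simp only [Subtype.mk.injEq] at this
    exact this
  have hfinal : Φ i₁ + Eg Rest = 0 := by
    have := congr_arg Eg hslice
    rw [map_zero, map_add, map_sum, Finset.sum_congr rfl hEgD] at this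
    rw [← this]
    congr 1
    rw [Finset.sum_eq_single i₁ (fun i hi hne => by rw [hg' i hi, if_neg hne, zero_smul])
      (fun h' => absurd hi₁ h'), hg' i₁ hi₁, if_pos rfl, one_smul]
  have : Φ i₁ = -Eg Rest := eq_neg_of_add_eq_zero_left hfinal
  rw [show uHomogeneousPart S δ (Ψ (X i₁)) = Φ i₁ from rfl, this]
  exact neg_mem hEgRest

/-- **The count for general `τ` (twisted competitors included).** Under `δ`-preparedness, (N0) and
(IND) as in `uHomogeneousPart_mem_linearFormsSubalgebra_of_linearIndependent`: every centre `(Ψ; γ)`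
for `f` with `γ = 1/ν` on `S` and `γ ≤ 1/(νδ)` off `S` satisfies
`τ(in_δ f) ≤ |S| + #{j ∉ S : γ_j = 1/(νδ)}` — at least `τ(in_δ f) − τ` further weights EQUAL `1/(νδ)`.
(Ours, in the model; hypotheses (N0)/(IND) are not decorative: for `k = 𝔽₂`,
`f = (y + u₁²)(y + u₂²)` one has `τ(in_δ f) = 3` yet `Ψ⁻¹f = y² + y u₂²` admits centres with a single
`u`-weight `1/(νδ)`.)
[cite: CossartJannsenSaito2020, Thm. 8.16 (p. 121), Def. 8.2 (4) (p. 118), Def. 8.13 (pp. 120–121); AbramovichTemkinWlodarczyk2024, Thm. 5.3.1 (p. 1578); AbramovichQuekSchober2025, Thm. 3.5] -/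
theorem hironakaTau_deltaInitial_le_of_linearIndependent
    (hord : monomialOrd (fun _ => 1) f = ν)
    (hτ : S.card = hironakaTau k {homogeneousComponent ν f})
    (hFS : ∀ d ∈ (homogeneousComponent ν f).support, ∀ j ∉ S, d j = 0)
    (hprep : IsDeltaPrepared S ν f) {δ : ℚ} (hδ : hironakaDelta S ν f = δ)
    (hN0 : ∀ d ∈ f.support, blockDeg S d + 1 = ν → (coDeg S d : ℚ) ≠ δ)
    (hind : LinearIndependent k fun l : ↥S => pderiv (l : Fin n) (homogeneousComponent ν f))
    {Ψ : MvPolynomial (Fin n) k ≃ₐ[k] MvPolynomial (Fin n) k} {γ : Fin n → ℚ}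
    (h : IsCentreFor f Ψ γ) (hγS : ∀ i ∈ S, γ i = (ν : ℚ)⁻¹)
    (hγle : ∀ j ∉ S, γ j ≤ ((ν : ℚ) * δ)⁻¹) :
    hironakaTau k {deltaInitial S ν δ f} ≤
      S.card + (Finset.univ.filter (fun j => j ∉ S ∧ γ j = ((ν : ℚ) * δ)⁻¹)).card :=
  hironakaTau_deltaInitial_le_of_isCentreFor hord hτ hFS hprep hδ h hγS hγle
    (uHomogeneousPart_mem_linearFormsSubalgebra_of_linearIndependent hord hτ hFS hprep hδ hN0 hind
      h hγS hγle)

/-- For `τ = 1` (`S = {i₀}`) and `ν ∈ kˣ` hypothesis (IND) holds: `in_ν f = c X_{i₀}^ν` with `c ≠ 0`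
and `∂_{i₀} in_ν f = ν c X_{i₀}^{ν−1} ≠ 0`; so the `τ = 1` count
`hironakaTau_deltaInitial_le_of_tau_eq_one` is the special case `S = {i₀}` of
`hironakaTau_deltaInitial_le_of_linearIndependent`. (Ours, elementary.)
[cite: CossartJannsenSaito2020, Thm. 8.16 (p. 121), Thm. 8.7 (p. 119)] -/
theorem linearIndependent_pderiv_of_tau_eq_one (i₀ : Fin n) (hS : S = {i₀})
    (hord : monomialOrd (fun _ => 1) f = ν)
    (hFS : ∀ d ∈ (homogeneousComponent ν f).support, ∀ j ∉ S, d j = 0) (hνk : (ν : k) ≠ 0) :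
    LinearIndependent k fun l : ↥S => pderiv (l : Fin n) (homogeneousComponent ν f) := by
  classical
  subst hS
  haveI : Subsingleton ↥({i₀} : Finset (Fin n)) := ⟨fun x y =>
    Subtype.ext ((Finset.mem_singleton.mp x.2).trans (Finset.mem_singleton.mp y.2).symm)⟩
  refine LinearIndependent.of_subsingleton ⟨i₀, Finset.mem_singleton_self _⟩ ?_
  -- `in_ν f = c X_{i₀}^ν` with `c ≠ 0`
  set F := homogeneousComponent ν f with hF
  have hf0 : f ≠ 0 := by
    intro hf
    rw [hf, (monomialOrd_eq_top_iff (fun _ : Fin n => (1 : ℕ)) (0 : MvPolynomial (Fin n) k)).mpr rfl]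
      at hord
    exact ENat.top_ne_coe _ hord
  have hsupp : ∀ d ∈ F.support, d = Finsupp.single i₀ ν := by
    intro d hdF
    have hdeg : d.degree = ν := by
      by_contra hne
      rw [mem_support_iff, hF, coeff_homogeneousComponent, if_neg hne] at hdF
      exact hdF rfl
    have hothers : ∀ i, i ≠ i₀ → d i = 0 := fun i hi =>
      hFS d hdF i (fun h' => hi (Finset.mem_singleton.mp h'))
    ext i
    by_cases hi : i = i₀
    · subst hi
      rw [Finsupp.single_eq_same]
      have hc0 : coDeg {i} d = 0 := by
        rw [coDeg_eq_sum_univ]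
        exact Finset.sum_eq_zero fun j hj => hothers j
          (fun h' => (Finset.mem_filter.mp hj).2 (Finset.mem_singleton.mpr h'))
      have : d.degree = d i := by
        rw [degree_eq_blockDeg_add_coDeg {i}, blockDeg_eq_sum_univ, Finset.sum_singleton, hc0,
          add_zero]
      rw [← this, hdeg]
    · rw [Finsupp.single_apply, if_neg (Ne.symm hi)]; exact hothers i hi
  have hc : coeff (Finsupp.single i₀ ν) f ≠ 0 := by
    obtain ⟨d, hd, hdw⟩ := exists_weight_eq_monomialOrd (fun _ => (1 : ℕ)) hf0
    rw [hord] at hdw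
    have hdeg : d.degree = ν := by
      rw [Finsupp.degree_eq_weight_one]; exact_mod_cast hdw
    have hdF : d ∈ F.support := by
      rw [mem_support_iff, hF, coeff_homogeneousComponent, if_pos hdeg]; exact mem_support_iff.mp hd
    rw [← hsupp d hdF]; exact mem_support_iff.mp hd
  have hcF : coeff (Finsupp.single i₀ ν) F = coeff (Finsupp.single i₀ ν) f := by
    rw [hF, coeff_homogeneousComponent, if_pos (by simp [Finsupp.degree_single])]
  have hFeq : F = monomial (Finsupp.single i₀ ν) (coeff (Finsupp.single i₀ ν) f) := by
    have hsub : F.support ⊆ {Finsupp.single i₀ ν} := fun d hd =>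
      Finset.mem_singleton.mpr (hsupp d hd)
    have h1 : F = monomial (Finsupp.single i₀ ν) (coeff (Finsupp.single i₀ ν) F) := by
      conv_lhs => rw [F.as_sum]
      rw [Finset.sum_subset hsub (fun d _ hd => by rw [notMem_support_iff.mp hd, monomial_zero]),
        Finset.sum_singleton]
    rw [hcF] at h1
    exact h1
  change pderiv i₀ F ≠ 0
  rw [hFeq, pderiv_monomial, Ne, monomial_eq_zero, Finsupp.single_eq_same]
  exact mul_ne_zero hc hνk

end CountGeneral


end WeightedBlowup

end Literature.AlgebraicGeometry.Resolution

end
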